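import Summits.KontsevichZagierPeriods.KontsevichZagierPeriods.Theses.LinRedNormalForm
import Literature.NumberTheory.Transcendental.KZKernelConjectureForms
import Literature.NumberTheory.Transcendental.KZRelationsLE
import Literature.NumberTheory.Transcendental.KZUnfolding
import Literature.NumberTheory.Transcendental.MZVSimplexRepProofs
import Literature.NumberTheory.Transcendental.MultipleZetaHoffmanRelationProofs
import Literature.NumberTheory.Transcendental.MultipleZetaEulerProofs
import Literature.NumberTheory.Transcendental.MultipleZetaValuesProofs
import Literature.NumberTheory.Transcendental.MultipleZetaWeightFiveProofs
import Literature.NumberTheory.Transcendental.KZProductIdeal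
import Literature.NumberTheory.Transcendental.NashCubes

/-!
# Disproof of `MzvKernelInKZ` (stmt-KontsevichZagierPeriods-3914) — standing adversary, findings

Crux (route LinRedNormalForm, rank 4):
`MzvKernelInKZ : ∀ c ∈ AddSubgroup.closure genSet, KZ.eval c = 0 → c ∈ KZ.relations`, where
`genSet` = the MZV WORD representations `[Δ_w, q · ∏ᵢ ω_{εᵢ}(tᵢ)]` (all `w`, all letters
`ε : Fin w → Bool`, all `q ∈ ℚ`, every `KZ.IntegralRep w` with that domain and an integrand agreeing
with the word form ON the simplex).

VERDICT (cycle 3, gen 3): NO KILL of the crux — but its WEIGHT-4 RUNG IS NOW A THEOREM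
(`weightKernel_four`, §10): stuffle, shuffle, finite double shuffle `ζ(4) = 4ζ(3,1)` (§8–§9) AND
Euler's `3ζ(4) = 4ζ(2,2)` (§10, Beukers–Kolk–Calabi in half-angle coordinates) are KZ move chains with
absolutely convergent algebraic intermediates; no regularisation is needed at weight 4.  Moreover the
element `[π]` (`KZ.piRep`) is linked: `[π] − 2•Q`, `[π]² − 6•[ζ(2)]`, `[π]⁴ − 90•[ζ(4)] ∈ KZ.relations`
(rational polar chart + ONE Newton–Leibniz move; `Negative/PiLine.lean`, `PiPolar.lean`, `PiDisc.lean`;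
evidence `PiCheck.lean`) — `ζ(2) = π²/6`, `ζ(4) = π⁴/90` are accessible identities of the fixed calculus.
The first open layer is now WEIGHT 5 (§5b: two move chains + the OPEN independence of `ζ(5), ζ(2)ζ(3)`).
Previous verdict (cycle 2, gen 2): NO KILL.  The crux is a special case of the summit
(`of_summit`), so a refutation is a refutation of Conjecture 1 as formalised: it needs an additive
invariant of `KZ.FormalRep` vanishing on the four move sets and separating two equal-valued
ℤ-combinations of MZV word integrals — i.e. a NON-MOTIVIC linear relation among real MZVs; none is
known, every proved MZV relation (duality, double shuffle, associator, Hoffman, …) is motivic.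

INDEX (cycle 2 / gen 2; gen-1's v5 lived only as item evidence, unreadable from the tree, so this
file re-establishes its core results and adds §4–§6)
* §1 shape: `of_kzKernelConjecture`, `of_summit`, `not_summit_of_not`, `not_of_separating_invariant`.
* §2 load-bearing hypotheses: `not_withoutEval` (drop `eval c = 0`: false, witness `[pt, 1]`);
  `withoutClosure_iff_summit` (drop the restriction to the MZV closure: this IS the summit).
* §3 the generators made explicit: `wordRep ε q` (admissible letters), values
  (`value_wordRep_eq_multipleZeta` via the tree fact `KZ.mzvRep_value_holds`), bookkeeping modulo
  relations (`of_wordRep_add`, `of_wordRep_neg`, `of_wordRep_smul_of` via `KZ.scale`), off-domain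
  freedom (`of_sub_of_wordRep_mem_relations`).
* §4 per-weight rungs `WeightKernel w ⊇ WeightKernelAdm w` (the cards' `WeightKernel N`) and the
  FINITE-RANK ENGINE `weightKernelAdm_of_basis` / `weightKernelAdm_of_rankOne`; instances
  `weightKernelAdm_two`, `weightKernelAdm_three_iff` (⟺ `cDual3`), `weightKernelAdm_four_iff`
  (⟺ `cFds4 ∧ cEuler4 ∧ cDual4`), `weightKernelAdm_four_iff'` (Hoffman form), `targets_of_crux`.
* §4b DUALITY IS ONE MOVE `duality_mem_changeOfVariablesRel` (all words; affine involution,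
  `|det| = 1` from `Φ'² = id`) ⇒ `cDual3_mem_relations`, `cDual4_mem_relations`,
  `weightKernelAdm_three` UNCONDITIONAL, `weightKernelAdm_four_iff_two_targets` (⟺ `cFds4 ∧ cEuler4`).
* §4c NON-ADMISSIBLE WORDS CARRY NO REPRESENTATION: `not_integrableOn_wordFun` (slicing/Tonelli
  lower bound `vol(Δⁿ(½))·∫_{½}^1 dt/(1−t) = ∞`, last-letter case via the duality involution and the
  Jacobian formula) ⇒ `of_mem_relations_of_not_adm`, `weightKernel_iff_weightKernelAdm`,
  `weightKernel_two`, `weightKernel_three` (the cards' `WeightKernel 3`, UNCONDITIONAL),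
  `weightKernel_four_iff` (`WeightKernel 4 ⟺ cFds4 ∧ cEuler4`).
* §5 all-weights TRANSFER THEOREM `cruxAdm_of_family` (independent values + spanning inside the
  calculus ⇒ crux on the admissible closure; the typed form of the cards' engine), its converse
  for the spanning half `sub_sum_mem_relations_of_cruxAdm`, `crux_iff_cruxAdm` and the final form
  `crux_of_family : … → MzvKernelInKZ`.
* §5b WEIGHT 5 (`d₅ = 2`, where transcendence first enters): typed targets `cT32`, `cT23`
  (double shuffle evaluations), `targets5_of_weightKernel`, and `weightKernel_five_of`:
  `LinearIndependent ℚ ![ζ(5), ζ(4,1)] → cT32 ∈ rel → cT23 ∈ rel → WeightKernel 5`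
  (`linearIndependent_five_iff`: ⟺ independence of `ζ(5), ζ(2)ζ(3)`, OPEN).
* §6 strength: `zeta_three_not_mem_span_of_crux` — crux + independence-in-the-calculus of the four
  lowest base classes ⇒ `ζ(3) ∉ ℚ + ℚπ² + ℚπ⁴` (open): a proof of the crux is transcendence-complete.
* §7 the weight-4 typed targets `P22`, `cShuffle4`, `cStuffle4` (near-misses of cycle 2) — ALL CLOSED
  in cycle 3: §8 `cStuffle4_mem_relations`, §9 `cShuffle4_mem_relations`, `cFds4_mem_relations`,
  §10 `cEuler4_mem_relations`, `cHoffman4_mem_relations`, `weightKernel_four : WeightKernel 4`, plus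
  `mem_relations_of_nsmul_mem` (integer division), `three_zeta_two_sub_two_G2_mem` (3ζ(2) ≡ 2Q²),
  `fortyfive_C4_sub_eight_G4_mem` (45ζ(4)-cube ≡ 8Q⁴).  This file is now sorry-free.

USE: `import Summits.KontsevichZagierPeriods.KontsevichZagierPeriods.Cruxes.MzvKernelInKZ.Disproof`
resolves on the farm (tested); the sorry-free content of §0–§6 is LANDED (cycle 3) as
`Theorems/MzvKernelInKZ/Negative/{Core,Duality,Engine,WeightsTwoThree,WeightFour,Divergence,Transfer,
WeightFive}.lean` (namespace `Summit.KontsevichZagierPeriods.MzvKernelInKZ.Negative`, same short names;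
`constRep` is `emptyWordRep` there) and §8–§10 as the files listed in their headers — import those.

Everything is sorry-free; axioms = {propext, Classical.choice, Quot.sound} (checked for
`weightKernel_three`, `weightKernel_four_iff`, `duality_mem_changeOfVariablesRel`,
`not_integrableOn_wordFun`, `crux_iff_cruxAdm`, `crux_of_family`, `zeta_three_not_mem_span_of_crux`,
`not_withoutEval`).
-/

noncomputable section

set_option linter.dupNamespace false

open Set MeasureTheory MvPolynomial
open Literature.NumberTheory.Transcendental

namespace Summit.KontsevichZagierPeriods.KontsevichZagierPeriods.Cruxes.MzvKernelInKZ.Disproof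

open Summit.KontsevichZagierPeriods.KontsevichZagierPeriods.Theses.LinRedNormalForm (MzvKernelInKZ)
open Literature.ModelTheory.ExponentialFields (IsSemialgebraic)

/-! ## §0 The crux, its generating set named -/

/-- The open ordered simplex `{1 > t₀ > ⋯ > t_{w-1} > 0}`, literally as inlined in the crux
(definitionally `KZ.openOrderedSimplex w`). -/
def simplex (w : ℕ) : Set (Fin w → ℝ) := {t | (∀ i, 0 < t i) ∧ (∀ i, t i < 1) ∧ StrictAnti t}

theorem simplex_eq_openOrderedSimplex (w : ℕ) : simplex w = KZ.openOrderedSimplex w := rfl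

/-- The word integrand `q · ∏ᵢ ω_{εᵢ}(tᵢ)`, literally as inlined in the crux. -/
def wordFun {w : ℕ} (ε : Fin w → Bool) (q : ℚ) (t : Fin w → ℝ) : ℝ :=
  (q : ℝ) * ∏ i, if ε i then 1 / (1 - t i) else 1 / t i

/-- The generating set of the crux: all MZV word representations. -/
def genSet : Set KZ.FormalRep :=
  {x | ∃ (w : ℕ) (ε : Fin w → Bool) (q : ℚ) (s : KZ.IntegralRep w),
    s.domain = {t | (∀ i, 0 < t i) ∧ (∀ i, t i < 1) ∧ StrictAnti t} ∧
    EqOn s.integrand (fun t => (q : ℝ) * ∏ i, if ε i then 1 / (1 - t i) else 1 / t i) s.domain ∧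
    x = KZ.of s}

/-- Read-back: the crux is the kernel statement on `AddSubgroup.closure genSet` (by `Iff.rfl`). -/
theorem crux_iff :
    MzvKernelInKZ ↔ ∀ c ∈ AddSubgroup.closure genSet, KZ.eval c = 0 → c ∈ KZ.relations :=
  Iff.rfl

/-! ## §1 Shape of any refutation -/

/-- The crux is the kernel conjecture `ker eval = relations` restricted to the MZV closure. -/
theorem of_kzKernelConjecture (h : KZKernelConjecture) : MzvKernelInKZ :=
  fun c _ hc => h c hc

/-- The crux follows from the summit (Conjecture 1 as formalised), via the proved equivalence
`kzKernelConjecture_iff_isRational` of the kernel form with the two-representation form. -/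
theorem of_summit (h : KontsevichZagierPeriods) : MzvKernelInKZ :=
  of_kzKernelConjecture (kzKernelConjecture_iff_isRational.mpr h)

/-- Hence any disproof of the crux disproves the summit: there is no refutation cheaper than a
counterexample to Conjecture 1 on the MZV sector. -/
theorem not_summit_of_not (h : ¬ MzvKernelInKZ) : ¬ KontsevichZagierPeriods :=
  mt of_summit h

/-- TEMPLATE of a refutation: an additive invariant `J` vanishing on the four move sets and
non-zero on some element of the MZV closure with value `0`. (Soundness makes `eval` itself such an
invariant except for the last clause; `J` must see more than the value — a "non-motivic" datum.) -/
theorem not_of_separating_invariant {A : Type*} [AddCommGroup A] (J : KZ.FormalRep →+ A)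
    (hJ : ∀ x ∈ KZ.domainAddRel ∪ KZ.integrandAddRel ∪ KZ.changeOfVariablesRel ∪ KZ.newtonLeibnizRel,
      J x = 0)
    (c : KZ.FormalRep) (hc : c ∈ AddSubgroup.closure genSet) (hc0 : KZ.eval c = 0) (hJc : J c ≠ 0) :
    ¬ MzvKernelInKZ := by
  intro h
  have hker : KZ.relations ≤ J.ker := (AddSubgroup.closure_le _).mpr fun x hx => hJ x hx
  exact hJc (hker (h c hc hc0))

/-! ## §2 Load-bearing hypotheses -/

/-- The crux with the hypothesis `eval c = 0` dropped. -/
def WithoutEval : Prop := ∀ c ∈ AddSubgroup.closure genSet, c ∈ KZ.relations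

/-- The crux with the restriction to the MZV closure dropped: the full kernel conjecture. -/
def WithoutClosure : Prop := ∀ c : KZ.FormalRep, KZ.eval c = 0 → c ∈ KZ.relations

theorem withoutClosure_iff_kzKernelConjecture : WithoutClosure ↔ KZKernelConjecture := Iff.rfl

/-- Dropping the closure restriction gives exactly the summit (kernel form ⟺ Conjecture 1). -/
theorem withoutClosure_iff_summit : WithoutClosure ↔ KontsevichZagierPeriods :=
  kzKernelConjecture_iff_isRational

/-! ## §3 The generators, explicitly -/

section Generators

variable {w : ℕ}

/-- Admissible letters: empty word, or first letter `0` (form `dt/t` at the largest variable) and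
last letter `1` (form `dt/(1-t)` at the smallest) — the convergence condition. Non-admissible words
admit NO integrable representation with `q ≠ 0`, so they contribute only zero representations
(which are relations); the rungs below are therefore stated over admissible letters. -/
def Adm (ε : Fin w → Bool) : Prop :=
  ∀ h : 0 < w, ε ⟨0, h⟩ = false ∧ ε ⟨w - 1, Nat.sub_one_lt_of_lt h⟩ = true

instance (ε : Fin w → Bool) : Decidable (Adm ε) := by
  unfold Adm; infer_instance

/-- The word integrand is the quotient of `ℚ`-polynomials `q / ∏ᵢ pᵢ`, `pᵢ = 1 - Xᵢ` or `Xᵢ`. -/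
theorem wordFun_eq_aeval_div (ε : Fin w → Bool) (q : ℚ) (t : Fin w → ℝ) :
    wordFun ε q t = aeval t (C q : MvPolynomial (Fin w) ℚ) /
      aeval t (∏ i : Fin w, (if ε i then 1 - X i else X i : MvPolynomial (Fin w) ℚ)) := by
  simp only [wordFun, map_prod, aeval_C, eq_ratCast, div_eq_mul_inv, ← Finset.prod_inv_distrib]
  refine congrArg (fun x => (q : ℝ) * x) (Finset.prod_congr rfl fun i _ => ?_)
  split_ifs <;> simp

theorem aeval_prod_ne_zero {ε : Fin w → Bool} {t : Fin w → ℝ} (ht : t ∈ simplex w) :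
    aeval t (∏ i : Fin w, (if ε i then 1 - X i else X i : MvPolynomial (Fin w) ℚ)) ≠ 0 := by
  obtain ⟨h0, h1, -⟩ := ht
  rw [map_prod]
  refine Finset.prod_ne_zero_iff.mpr fun i _ => ?_
  split_ifs
  · simpa [sub_eq_zero] using (h1 i).ne'
  · simpa using (h0 i).ne'

/-- The word integrand is `ℚ`-semialgebraic on the simplex. -/
theorem isSemialgebraicFunOn_wordFun (ε : Fin w → Bool) (q : ℚ) :
    IsSemialgebraicFunOn ℚ (simplex w) (wordFun ε q) := by
  refine (isSemialgebraicFunOn_aeval_div_aeval (KZ.isSemialgebraic_openOrderedSimplex w) (C q) _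
    fun t ht => aeval_prod_ne_zero (ε := ε) ht).congr ?_
  intro t _
  exact (wordFun_eq_aeval_div ε q t).symm

/-- The word integrand with `q = 1` is the tree's product of forms `KZ.mzvForm`. -/
theorem wordFun_one_eq_prod_mzvForm (ε : Fin w → Bool) (t : Fin w → ℝ) :
    wordFun ε 1 t = ∏ i, KZ.mzvForm (ε i) (t i) := by
  simp only [wordFun, Rat.cast_one, one_mul, KZ.mzvForm]

theorem wordFun_eq_mul_wordFun_one (ε : Fin w → Bool) (q : ℚ) (t : Fin w → ℝ) :
    wordFun ε q t = (q : ℝ) * wordFun ε 1 t := by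
  simp [wordFun]

/-- Absolute convergence for admissible letters (the tree's domination lemma
`KZ.integrableOn_prod_mzvForm`). -/
theorem integrableOn_wordFun {ε : Fin w → Bool} (hε : Adm ε) (q : ℚ) :
    IntegrableOn (wordFun ε q) (simplex w) volume := by
  -- extend the letters to `ℕ`
  let ε' : ℕ → Bool := fun k => if h : k < w then ε ⟨k, h⟩ else false
  have h1 : IntegrableOn (fun t : Fin w → ℝ => ∏ i : Fin w, KZ.mzvForm (ε' i) (t i))
      (KZ.openOrderedSimplex w) volume := by
    refine KZ.integrableOn_prod_mzvForm w ε' (fun hw => ?_) (fun hw => ?_)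
    · simp [ε', hw, (hε hw).1]
    · have : w - 1 < w := Nat.sub_one_lt_of_lt hw
      simp [ε', this, (hε hw).2]
  have h2 : (fun t : Fin w → ℝ => ∏ i : Fin w, KZ.mzvForm (ε' i) (t i)) = wordFun ε 1 := by
    funext t
    rw [wordFun_one_eq_prod_mzvForm]
    refine Finset.prod_congr rfl fun i _ => ?_
    simp [ε', i.isLt]
  rw [h2] at h1
  have h3 : wordFun ε q = fun t => (q : ℝ) * wordFun ε 1 t := funext (wordFun_eq_mul_wordFun_one ε q)
  rw [h3]
  exact h1.const_mul _

/-- **The canonical word representation** `[Δ_w, q · ∏ ω_ε]` for admissible letters. Any two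
`IntegralRep`s with this domain and this integrand function are equal (proof irrelevance), so this
is a canonical form for the generators up to off-domain values of the integrand. -/
def wordRep (ε : Fin w → Bool) (q : ℚ) (hε : Adm ε) : KZ.IntegralRep w where
  domain := simplex w
  integrand := wordFun ε q
  isSemialgebraic_domain := KZ.isSemialgebraic_openOrderedSimplex w
  isSemialgebraicFunOn_integrand := isSemialgebraicFunOn_wordFun ε q
  integrableOn := integrableOn_wordFun hε q

@[simp] theorem wordRep_domain (ε : Fin w → Bool) (q : ℚ) (hε : Adm ε) :
    (wordRep ε q hε).domain = simplex w := rfl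

@[simp] theorem wordRep_integrand (ε : Fin w → Bool) (q : ℚ) (hε : Adm ε) :
    (wordRep ε q hε).integrand = wordFun ε q := rfl

theorem of_wordRep_mem_genSet (ε : Fin w → Bool) (q : ℚ) (hε : Adm ε) :
    KZ.of (wordRep ε q hε) ∈ genSet :=
  ⟨w, ε, q, wordRep ε q hε, rfl, fun _ _ => rfl, rfl⟩

theorem of_wordRep_mem_closure (ε : Fin w → Bool) (q : ℚ) (hε : Adm ε) :
    KZ.of (wordRep ε q hε) ∈ AddSubgroup.closure genSet :=
  AddSubgroup.subset_closure (of_wordRep_mem_genSet ε q hε)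

/-- Values scale: `value [Δ, q ω] = q · value [Δ, ω]`. -/
theorem value_wordRep (ε : Fin w → Bool) (q : ℚ) (hε : Adm ε) :
    (wordRep ε q hε).value = (q : ℝ) * (wordRep ε 1 hε).value := by
  simp only [KZ.IntegralRep.value, wordRep_domain, wordRep_integrand]
  rw [← integral_const_mul]
  exact integral_congr_ae (Filter.Eventually.of_forall fun t => wordFun_eq_mul_wordFun_one ε q t)

/-! ### Congruence and bookkeeping modulo relations -/

/-- A representation whose integrand vanishes on its domain is a relation. -/
theorem of_mem_relations_of_eqOn_zero {n : ℕ} (r : KZ.IntegralRep n)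
    (h : EqOn r.integrand 0 r.domain) : KZ.of r ∈ KZ.relations :=
  KZ.levelRel_le_relations (KZ.of_mem_levelRel_of_eqOn_zero r h)

/-- The zero word representation is a relation. -/
theorem of_wordRep_zero_mem_relations (ε : Fin w → Bool) (hε : Adm ε) :
    KZ.of (wordRep ε 0 hε) ∈ KZ.relations :=
  of_mem_relations_of_eqOn_zero _ fun t _ => by simp [wordFun]

/-- **Congruence** (off-domain freedom): two representations with the same domain whose
integrands agree ON the domain differ by a relation (integrand additivity against a zero
representation). In particular every generator of the crux with admissible letters is
`≡ [wordRep ε q]` modulo relations. -/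
theorem of_sub_of_mem_relations_of_eqOn {n : ℕ} {r r' : KZ.IntegralRep n}
    (hd : r'.domain = r.domain) (h : EqOn r.integrand r'.integrand r.domain) :
    KZ.of r - KZ.of r' ∈ KZ.relations := by
  let z : KZ.IntegralRep n :=
    ⟨r.domain, 0, r.isSemialgebraic_domain,
      (isSemialgebraicFunOn_aeval r.isSemialgebraic_domain 0).congr fun x _ => by simp,
      integrableOn_zero⟩
  have h1 : KZ.of r - KZ.of r' - KZ.of z ∈ KZ.relations :=
    KZ.integrandAddRel_subset_relations ⟨n, r, r', z, hd, rfl, fun x hx => by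
      simp [z, h hx], rfl⟩
  have h2 : KZ.of z ∈ KZ.relations := of_mem_relations_of_eqOn_zero z (fun _ _ => rfl)
  have : KZ.of r - KZ.of r' = (KZ.of r - KZ.of r' - KZ.of z) + KZ.of z := by abel
  rw [this]
  exact KZ.relations.add_mem h1 h2

/-- Every generator with admissible letters is congruent to the canonical word representation. -/
theorem of_sub_of_wordRep_mem_relations {ε : Fin w → Bool} {q : ℚ} (hε : Adm ε)
    (s : KZ.IntegralRep w) (hd : s.domain = simplex w)
    (hi : EqOn s.integrand (fun t => (q : ℝ) * ∏ i, if ε i then 1 / (1 - t i) else 1 / t i)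
      s.domain) :
    KZ.of s - KZ.of (wordRep ε q hε) ∈ KZ.relations :=
  of_sub_of_mem_relations_of_eqOn (by simp [hd]) fun t ht => hi ht

/-- Integrand additivity on word representations: `[Δ,(q₁+q₂)ω] − [Δ,q₁ω] − [Δ,q₂ω]` is ONE move. -/
theorem of_wordRep_add (ε : Fin w → Bool) (q₁ q₂ : ℚ) (hε : Adm ε) :
    KZ.of (wordRep ε (q₁ + q₂) hε) - KZ.of (wordRep ε q₁ hε) - KZ.of (wordRep ε q₂ hε) ∈
      KZ.relations :=
  KZ.integrandAddRel_subset_relations ⟨w, wordRep ε (q₁ + q₂) hε, wordRep ε q₁ hε,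
    wordRep ε q₂ hε, rfl, rfl, fun t _ => by
      simp only [wordRep_integrand, Pi.add_apply, wordFun, Rat.cast_add]; ring, rfl⟩

/-- `[Δ, qω] + [Δ, (−q)ω]` is a relation (two moves). -/
theorem of_wordRep_neg (ε : Fin w → Bool) (q : ℚ) (hε : Adm ε) :
    KZ.of (wordRep ε q hε) + KZ.of (wordRep ε (-q) hε) ∈ KZ.relations := by
  have h1 := of_wordRep_add ε q (-q) hε
  have h2 := of_wordRep_zero_mem_relations ε hε
  rw [show q + -q = 0 by ring] at h1
  have : KZ.of (wordRep ε q hε) + KZ.of (wordRep ε (-q) hε) =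
      KZ.of (wordRep ε 0 hε) - (KZ.of (wordRep ε 0 hε) - KZ.of (wordRep ε q hε) -
        KZ.of (wordRep ε (-q) hε)) := by abel
  rw [this]
  exact KZ.relations.sub_mem h2 h1

/-- Rational constants are algebraic. -/
theorem isAlgebraic_ratCast (q : ℚ) : IsAlgebraic ℚ (q : ℝ) := isAlgebraic_algebraMap q

/-- **Rational rescaling of a relation between word representations is a relation** (the scaling
endomorphism `KZ.scale` preserves relations; no division by integers is ever needed). -/
theorem of_wordRep_smul_of {w' : ℕ} {ε : Fin w → Bool} {ε' : Fin w' → Bool} (hε : Adm ε)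
    (hε' : Adm ε') {a b : ℚ}
    (h : KZ.of (wordRep ε a hε) - KZ.of (wordRep ε' b hε') ∈ KZ.relations) (q : ℚ) :
    KZ.of (wordRep ε (q * a) hε) - KZ.of (wordRep ε' (q * b) hε') ∈ KZ.relations := by
  have hs := KZ.scale_mem_relations (q : ℝ) (isAlgebraic_ratCast q) h
  rw [map_sub, KZ.scale_of, KZ.scale_of] at hs
  have e1 : KZ.of ((wordRep ε a hε).constMul (q : ℝ) (isAlgebraic_ratCast q)) -
      KZ.of (wordRep ε (q * a) hε) ∈ KZ.relations :=
    of_sub_of_mem_relations_of_eqOn rfl fun t _ => by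
      simp only [KZ.IntegralRep.integrand_constMul, wordRep_integrand, wordFun, Rat.cast_mul]
      ring
  have e2 : KZ.of ((wordRep ε' b hε').constMul (q : ℝ) (isAlgebraic_ratCast q)) -
      KZ.of (wordRep ε' (q * b) hε') ∈ KZ.relations :=
    of_sub_of_mem_relations_of_eqOn rfl fun t _ => by
      simp only [KZ.IntegralRep.integrand_constMul, wordRep_integrand, wordFun, Rat.cast_mul]
      ring
  have : KZ.of (wordRep ε (q * a) hε) - KZ.of (wordRep ε' (q * b) hε') =
      (KZ.of ((wordRep ε a hε).constMul (q : ℝ) (isAlgebraic_ratCast q)) -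
        KZ.of ((wordRep ε' b hε').constMul (q : ℝ) (isAlgebraic_ratCast q))) -
      (KZ.of ((wordRep ε a hε).constMul (q : ℝ) (isAlgebraic_ratCast q)) -
        KZ.of (wordRep ε (q * a) hε)) +
      (KZ.of ((wordRep ε' b hε').constMul (q : ℝ) (isAlgebraic_ratCast q)) -
        KZ.of (wordRep ε' (q * b) hε')) := by abel
  rw [this]
  exact KZ.relations.add_mem (KZ.relations.sub_mem hs e1) e2

end Generators

/-! ### The weight-zero generator `[pt, q]` and `not_withoutEval` -/

/-- The empty word (weight `0`): the rational constant `q` as a zero-dimensional representation. -/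
def constRep (q : ℚ) : KZ.IntegralRep 0 := wordRep (w := 0) Fin.elim0 q (fun h => absurd h (by decide))

theorem simplex_zero : simplex 0 = univ := by
  ext t
  simp only [simplex, mem_setOf_eq, IsEmpty.forall_iff, true_and, mem_univ, iff_true]
  intro a b hab
  exact a.elim0

/-- `value [pt, q] = q`: `ℝ⁰` is one point of Lebesgue volume `1`. -/
theorem value_constRep (q : ℚ) : (constRep q).value = q := by
  simp only [KZ.IntegralRep.value, constRep, wordRep_domain, wordRep_integrand, simplex_zero,
    Measure.restrict_univ]
  obtain ⟨x, hx⟩ : ∃ x : Fin 0 → ℝ, (volume : Measure (Fin 0 → ℝ)) = Measure.dirac x :=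
    ⟨_, by rw [volume_pi, Measure.pi_of_empty]⟩
  rw [hx, integral_dirac]
  simp [wordFun]

/-- **Load-bearing: `eval c = 0` cannot be dropped.** `[pt, 1]` lies in the MZV closure and is not
a relation (relations evaluate to `0`, soundness). -/
theorem not_withoutEval : ¬ WithoutEval := by
  intro h
  have h1 := h _ (of_wordRep_mem_closure (w := 0) Fin.elim0 1 (fun h => absurd h (by decide)))
  have h2 : KZ.eval (KZ.of (constRep 1)) = 0 :=
    (AddMonoidHom.mem_ker).1 (KZ.relations_le_ker_eval_holds h1)
  rw [KZ.eval_of, value_constRep] at h2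
  norm_num at h2


/-! ## §4 The per-weight rungs and the finite-rank engine

The idea cards on this crux (isi-weight-certificates, hoffman-basis-split, cube-avatars-ayoub-stokes)
all propose the split  `crux ⇐ (spanning inside the calculus) ∧ (ℚ-independence of a basis of real
values) ∧ (weight grading)`.  The engine below is the typed, proved form of the first implication,
weight by weight, together with its cheap converse for the spanning half.  It shows exactly where
transcendence enters: `LinearIndependent ℚ (values of the base words)` — vacuous in NO weight, but
reducible to `value ≠ 0` (provable: MZVs are positive) when the base has ONE element, i.e. in
weights `2, 3, 4` (`d_w = 1`), and equal to an OPEN independence statement from weight `5` on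
(`d₅ = 2`: `ζ(5)` versus `ζ(2)ζ(3)`). -/

section Engine

variable {w k : ℕ}

/-- Generators of a fixed weight `w` (all letters). -/
def genSetW (w : ℕ) : Set KZ.FormalRep :=
  {x | ∃ (ε : Fin w → Bool) (q : ℚ) (s : KZ.IntegralRep w),
    s.domain = simplex w ∧ EqOn s.integrand (wordFun ε q) s.domain ∧ x = KZ.of s}

/-- Generators of weight `w` with ADMISSIBLE letters (the others are zero representations). -/
def genSetAdm (w : ℕ) : Set KZ.FormalRep :=
  {x | ∃ (ε : Fin w → Bool) (q : ℚ) (s : KZ.IntegralRep w),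
    Adm ε ∧ s.domain = simplex w ∧ EqOn s.integrand (wordFun ε q) s.domain ∧ x = KZ.of s}

/-- The weight-`w` rung of the crux (the cards' `WeightKernel w`). -/
def WeightKernel (w : ℕ) : Prop :=
  ∀ c ∈ AddSubgroup.closure (genSetW w), KZ.eval c = 0 → c ∈ KZ.relations

/-- The weight-`w` rung over admissible letters. -/
def WeightKernelAdm (w : ℕ) : Prop :=
  ∀ c ∈ AddSubgroup.closure (genSetAdm w), KZ.eval c = 0 → c ∈ KZ.relations

theorem genSetW_subset_genSet : genSetW w ⊆ genSet := by
  rintro x ⟨ε, q, s, hd, hi, rfl⟩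
  exact ⟨w, ε, q, s, hd, hi, rfl⟩

theorem genSetAdm_subset_genSetW : genSetAdm w ⊆ genSetW w := by
  rintro x ⟨ε, q, s, -, hd, hi, rfl⟩
  exact ⟨ε, q, s, hd, hi, rfl⟩

/-- The rungs are honest special cases of the crux. -/
theorem weightKernel_of_crux (h : MzvKernelInKZ) : WeightKernel w :=
  fun c hc => h c (AddSubgroup.closure_mono genSetW_subset_genSet hc)

theorem weightKernelAdm_of_weightKernel (h : WeightKernel w) : WeightKernelAdm w :=
  fun c hc => h c (AddSubgroup.closure_mono genSetAdm_subset_genSetW hc)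

theorem weightKernelAdm_of_crux (h : MzvKernelInKZ) : WeightKernelAdm w :=
  weightKernelAdm_of_weightKernel (weightKernel_of_crux h)

theorem of_wordRep_mem_genSetAdm (ε : Fin w → Bool) (q : ℚ) (hε : Adm ε) :
    KZ.of (wordRep ε q hε) ∈ genSetAdm w :=
  ⟨ε, q, wordRep ε q hε, hε, rfl, fun _ _ => rfl, rfl⟩

variable (B : Fin k → (Fin w → Bool)) (hB : ∀ j, Adm (B j))

/-- NORMAL FORM with respect to a base family `B` of admissible words: `∑ⱼ [Δ_w, Qⱼ · ω_{Bⱼ}]`. -/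
def nf (Q : Fin k → ℚ) : KZ.FormalRep := ∑ j, KZ.of (wordRep (B j) (Q j) (hB j))

theorem nf_mem_closure (Q : Fin k → ℚ) : nf B hB Q ∈ AddSubgroup.closure (genSetAdm w) :=
  sum_mem fun _ _ => AddSubgroup.subset_closure (of_wordRep_mem_genSetAdm _ _ _)

theorem nf_zero_mem_relations : nf B hB 0 ∈ KZ.relations :=
  sum_mem fun _ _ => of_wordRep_zero_mem_relations _ _

theorem nf_add (Q₁ Q₂ : Fin k → ℚ) :
    nf B hB (Q₁ + Q₂) - nf B hB Q₁ - nf B hB Q₂ ∈ KZ.relations := by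
  simp only [nf, ← Finset.sum_sub_distrib, Pi.add_apply]
  exact sum_mem fun j _ => of_wordRep_add _ _ _ _

theorem nf_neg (Q : Fin k → ℚ) : nf B hB Q + nf B hB (-Q) ∈ KZ.relations := by
  simp only [nf, ← Finset.sum_add_distrib, Pi.neg_apply]
  exact sum_mem fun j _ => of_wordRep_neg _ _ _

/-- Rational rescaling of a normal form is the normal form of the rescaled coefficients, modulo
relations (`KZ.scale` multiplies integrands; no formal division is used). -/
theorem scale_nf_sub_nf (q : ℚ) (Q : Fin k → ℚ) :
    KZ.scale (q : ℝ) (isAlgebraic_ratCast q) (nf B hB Q) - nf B hB (q • Q) ∈ KZ.relations := by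
  simp only [nf, map_sum, KZ.scale_of, ← Finset.sum_sub_distrib, Pi.smul_apply, smul_eq_mul]
  refine sum_mem fun j _ => of_sub_of_mem_relations_of_eqOn rfl fun t _ => ?_
  simp only [KZ.IntegralRep.integrand_constMul, wordRep_integrand, wordFun, Rat.cast_mul]
  ring

theorem eval_nf (Q : Fin k → ℚ) :
    KZ.eval (nf B hB Q) = ∑ j, (Q j : ℝ) * (wordRep (B j) 1 (hB j)).value := by
  simp only [nf, map_sum, KZ.eval_of]
  exact Finset.sum_congr rfl fun j _ => value_wordRep _ _ _

/-- **THE FINITE-RANK ENGINE.** If the values of a base family `B` of admissible words of weight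
`w` are `ℚ`-linearly independent, and every admissible word representation of weight `w` is
congruent MODULO RELATIONS to a rational combination of the base representations (spanning INSIDE
the calculus), then the weight-`w` rung of the crux holds.  Proof: every element of the closure is
congruent to a normal form `∑ⱼ [Δ, Qⱼ ω_{Bⱼ}]` (integrand additivity, `KZ.scale`); `eval c = 0`
and independence force `Q = 0`; zero representations are relations.  This is the honest content of
the cards' transfer "HoffmanIndependence N → certificates N → WeightKernel N". -/
theorem weightKernelAdm_of_basis
    (hind : LinearIndependent ℚ (fun j => (wordRep (B j) 1 (hB j)).value))
    (hspan : ∀ (ε : Fin w → Bool) (hε : Adm ε), ∃ a : Fin k → ℚ,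
      KZ.of (wordRep ε 1 hε) - nf B hB a ∈ KZ.relations) :
    WeightKernelAdm w := by
  intro c hc hc0
  have key : ∃ Q : Fin k → ℚ, c - nf B hB Q ∈ KZ.relations := by
    clear hc0
    induction hc using AddSubgroup.closure_induction with
    | mem x hx =>
      obtain ⟨ε, q, s, hε, hd, hi, rfl⟩ := hx
      obtain ⟨a, ha⟩ := hspan ε hε
      refine ⟨q • a, ?_⟩
      have h1 : KZ.of s - KZ.of (wordRep ε q hε) ∈ KZ.relations :=
        of_sub_of_wordRep_mem_relations hε s hd hi
      have h2 := KZ.scale_mem_relations (q : ℝ) (isAlgebraic_ratCast q) ha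
      rw [map_sub, KZ.scale_of] at h2
      have h3 : KZ.of ((wordRep ε 1 hε).constMul (q : ℝ) (isAlgebraic_ratCast q)) -
          KZ.of (wordRep ε q hε) ∈ KZ.relations :=
        of_sub_of_mem_relations_of_eqOn rfl fun t _ => by
          simp only [KZ.IntegralRep.integrand_constMul, wordRep_integrand, wordFun, Rat.cast_one]
          ring
      have h4 := scale_nf_sub_nf B hB q a
      have : KZ.of s - nf B hB (q • a) =
          (KZ.of s - KZ.of (wordRep ε q hε)) -
          (KZ.of ((wordRep ε 1 hε).constMul (q : ℝ) (isAlgebraic_ratCast q)) -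
            KZ.of (wordRep ε q hε)) +
          (KZ.of ((wordRep ε 1 hε).constMul (q : ℝ) (isAlgebraic_ratCast q)) -
            KZ.scale (q : ℝ) (isAlgebraic_ratCast q) (nf B hB a)) +
          (KZ.scale (q : ℝ) (isAlgebraic_ratCast q) (nf B hB a) - nf B hB (q • a)) := by abel
      rw [this]
      exact KZ.relations.add_mem (KZ.relations.add_mem (KZ.relations.sub_mem h1 h3) h2) h4
    | zero =>
      refine ⟨0, ?_⟩
      simpa using KZ.relations.neg_mem (nf_zero_mem_relations B hB)
    | add x y _ _ ihx ihy =>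
      obtain ⟨Q₁, h₁⟩ := ihx
      obtain ⟨Q₂, h₂⟩ := ihy
      refine ⟨Q₁ + Q₂, ?_⟩
      have : x + y - nf B hB (Q₁ + Q₂) =
          (x - nf B hB Q₁) + (y - nf B hB Q₂) - (nf B hB (Q₁ + Q₂) - nf B hB Q₁ - nf B hB Q₂) := by
        abel
      rw [this]
      exact KZ.relations.sub_mem (KZ.relations.add_mem h₁ h₂) (nf_add B hB Q₁ Q₂)
    | neg x _ ih =>
      obtain ⟨Q, hQ⟩ := ih
      refine ⟨-Q, ?_⟩
      have : -x - nf B hB (-Q) = -(x - nf B hB Q) - (nf B hB Q + nf B hB (-Q)) := by abel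
      rw [this]
      exact KZ.relations.sub_mem (KZ.relations.neg_mem hQ) (nf_neg B hB Q)
  obtain ⟨Q, hQ⟩ := key
  have hev : KZ.eval (nf B hB Q) = 0 := by
    have h := (AddMonoidHom.mem_ker).1 (KZ.relations_le_ker_eval_holds hQ)
    rwa [map_sub, hc0, zero_sub, neg_eq_zero] at h
  rw [eval_nf] at hev
  have hQ0 : ∀ j, Q j = 0 := by
    refine Fintype.linearIndependent_iff.mp hind Q ?_
    simpa [Rat.smul_def] using hev
  have hQz : Q = 0 := funext hQ0
  subst hQz
  have : c = (c - nf B hB 0) + nf B hB 0 := by abel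
  rw [this]
  exact KZ.relations.add_mem hQ (nf_zero_mem_relations B hB)

/-- Cheap converse (the SPANNING half is forced by the rung, given the real-valued expansion —
e.g. Brown's theorem `hoffmanSpan_eq_mzvSpace` for the Hoffman base): if the value of `[Δ, ω_ε]`
is the rational combination `∑ aⱼ · value [Δ, ω_{Bⱼ}]`, the rung makes the corresponding formal
combination a relation.  (So `crux ⇒ HoffmanSpanInKZ`, cf. CoactionDevissage item 3166.) -/
theorem sub_nf_mem_relations_of_weightKernelAdm (h : WeightKernelAdm w) {ε : Fin w → Bool}
    (hε : Adm ε) (a : Fin k → ℚ)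
    (hval : (wordRep ε 1 hε).value = ∑ j, (a j : ℝ) * (wordRep (B j) 1 (hB j)).value) :
    KZ.of (wordRep ε 1 hε) - nf B hB a ∈ KZ.relations := by
  refine h _ (sub_mem (AddSubgroup.subset_closure (of_wordRep_mem_genSetAdm _ _ _))
    (nf_mem_closure B hB a)) ?_
  rw [map_sub, KZ.eval_of, eval_nf, hval, sub_self]

/-- **RANK ONE.** If one admissible word `ε₀` of weight `w` has non-zero integral and every
admissible word representation is congruent modulo relations to a rational multiple of `[Δ, ω_{ε₀}]`,
the weight-`w` rung holds — with NO transcendence input beyond `value ≠ 0`. -/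
theorem weightKernelAdm_of_rankOne (ε₀ : Fin w → Bool) (h₀ : Adm ε₀)
    (hv : (wordRep ε₀ 1 h₀).value ≠ 0) (ρ : (Fin w → Bool) → ℚ)
    (hρ : ∀ (ε : Fin w → Bool) (hε : Adm ε),
      KZ.of (wordRep ε 1 hε) - KZ.of (wordRep ε₀ (ρ ε) h₀) ∈ KZ.relations) :
    WeightKernelAdm w := by
  refine weightKernelAdm_of_basis (fun _ : Fin 1 => ε₀) (fun _ => h₀) ?_ fun ε hε => ⟨fun _ => ρ ε, ?_⟩
  · exact linearIndependent_unique_iff.mpr hv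
  · simpa [nf] using hρ ε hε

end Engine


/-! ### Values of the word representations (Kontsevich's formula, tree fact `KZ.mzvRep_value`) -/

section Values

/-- Bridge to the tree: the canonical word representation of the binary word of an admissible
index `s` has value `ζ(s)` (`KZ.mzvRep_value_holds`). -/
theorem value_wordRep_eq_multipleZeta (s : List ℕ) (hs : MZV.IsAdmissible s)
    (ε : Fin (MZV.weight s) → Bool) (hε : Adm ε)
    (hw : ∀ i : Fin (MZV.weight s), ε i = (MZV.binaryWord s).getD i false) :
    (wordRep ε 1 hε).value = multipleZeta s := by
  rw [← KZ.mzvRep_value_holds s hs (KZ.mzvIntegrand_isSemialgebraicFunOn_holds s)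
    (KZ.mzvIntegrand_integrableOn_holds s hs)]
  change ∫ t in simplex (MZV.weight s), wordFun ε 1 t =
    ∫ t in KZ.openOrderedSimplex (MZV.weight s), KZ.mzvIntegrand s t
  refine integral_congr_ae (Filter.Eventually.of_forall fun t => ?_)
  rw [wordFun_one_eq_prod_mzvForm]
  exact Finset.prod_congr rfl fun i _ => by rw [hw i]

/-- The seven admissible words of weight `≤ 4` (letters listed from the largest variable). -/
def ω2 : Fin 2 → Bool := ![false, true]
def ω3 : Fin 3 → Bool := ![false, false, true]
def ω21 : Fin 3 → Bool := ![false, true, true]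
def ω4 : Fin 4 → Bool := ![false, false, false, true]
def ω31 : Fin 4 → Bool := ![false, false, true, true]
def ω22 : Fin 4 → Bool := ![false, true, false, true]
def ω211 : Fin 4 → Bool := ![false, true, true, true]

theorem adm_ω2 : Adm ω2 := by decide
theorem adm_ω3 : Adm ω3 := by decide
theorem adm_ω21 : Adm ω21 := by decide
theorem adm_ω4 : Adm ω4 := by decide
theorem adm_ω31 : Adm ω31 := by decide
theorem adm_ω22 : Adm ω22 := by decide
theorem adm_ω211 : Adm ω211 := by decide

theorem value_ω2 : (wordRep ω2 1 adm_ω2).value = Real.pi ^ 2 / 6 := by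
  rw [← multipleZeta_two]
  exact value_wordRep_eq_multipleZeta [2] (by decide) ω2 adm_ω2 (by decide)

theorem value_ω3 : (wordRep ω3 1 adm_ω3).value = multipleZeta [3] :=
  value_wordRep_eq_multipleZeta [3] (by decide) ω3 adm_ω3 (by decide)

theorem value_ω21 : (wordRep ω21 1 adm_ω21).value = multipleZeta [3] := by
  rw [← euler_zeta_two_one_holds]
  exact value_wordRep_eq_multipleZeta [2, 1] (by decide) ω21 adm_ω21 (by decide)

theorem value_ω4 : (wordRep ω4 1 adm_ω4).value = Real.pi ^ 4 / 90 := by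
  rw [← multipleZeta_four]
  exact value_wordRep_eq_multipleZeta [4] (by decide) ω4 adm_ω4 (by decide)

theorem value_ω31 : (wordRep ω31 1 adm_ω31).value = Real.pi ^ 4 / 360 := by
  rw [← multipleZeta_three_one]
  exact value_wordRep_eq_multipleZeta [3, 1] (by decide) ω31 adm_ω31 (by decide)

theorem value_ω22 : (wordRep ω22 1 adm_ω22).value = Real.pi ^ 4 / 120 := by
  rw [← multipleZeta_two_two]
  exact value_wordRep_eq_multipleZeta [2, 2] (by decide) ω22 adm_ω22 (by decide)

theorem value_ω211 : (wordRep ω211 1 adm_ω211).value = Real.pi ^ 4 / 90 := by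
  rw [← multipleZeta_two_one_one]
  exact value_wordRep_eq_multipleZeta [2, 1, 1] (by decide) ω211 adm_ω211 (by decide)

theorem value_ω2_ne_zero : (wordRep ω2 1 adm_ω2).value ≠ 0 := by
  rw [value_ω2]; positivity

theorem value_ω3_ne_zero : (wordRep ω3 1 adm_ω3).value ≠ 0 := by
  rw [value_ω3]
  exact (multipleZeta_pos_of_isAdmissible_holds (s := [3]) (by decide)).ne'

theorem value_ω4_ne_zero : (wordRep ω4 1 adm_ω4).value ≠ 0 := by
  rw [value_ω4]; positivity

end Values

/-! ### Weight 2: unconditional -/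

theorem adm_two_eq {ε : Fin 2 → Bool} (hε : Adm ε) : ε = ω2 := by
  obtain ⟨h0, h1⟩ := hε (by decide)
  funext i
  fin_cases i
  · simpa [ω2] using h0
  · simpa [ω2] using h1

/-- **The weight-2 rung holds**: one admissible word, `ζ(2) ≠ 0`, bookkeeping. -/
theorem weightKernelAdm_two : WeightKernelAdm 2 := by
  refine weightKernelAdm_of_rankOne ω2 adm_ω2 value_ω2_ne_zero (fun _ => 1) fun ε hε => ?_
  obtain rfl := adm_two_eq hε
  simp

/-! ### Weight 3: equivalent to ONE typed membership (duality `ζ(2,1) = ζ(3)` as a move chain) -/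

/-- TYPED TARGET, weight 3: duality `[Δ₃, ω₀₁₁] − [Δ₃, ω₀₀₁]` (value `ζ(2,1) − ζ(3) = 0`).
Gen-1 of this seat proved it is ONE change-of-variables move `tᵢ ↦ 1 − t_{2−i}`
(evidence MzvKernelInKZDualityMove.lean on the item; to be landed by a prover under
`Theorems/MzvKernelInKZ/`). -/
def cDual3 : KZ.FormalRep := KZ.of (wordRep ω21 1 adm_ω21) - KZ.of (wordRep ω3 1 adm_ω3)

theorem cDual3_mem_closure : cDual3 ∈ AddSubgroup.closure (genSetAdm 3) :=
  sub_mem (AddSubgroup.subset_closure (of_wordRep_mem_genSetAdm _ _ _))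
    (AddSubgroup.subset_closure (of_wordRep_mem_genSetAdm _ _ _))

theorem eval_cDual3 : KZ.eval cDual3 = 0 := by
  rw [cDual3, map_sub, KZ.eval_of, KZ.eval_of, value_ω21, value_ω3, sub_self]

theorem adm_three_cases {ε : Fin 3 → Bool} (hε : Adm ε) : ε = ω3 ∨ ε = ω21 := by
  obtain ⟨h0, h2⟩ := hε (by decide)
  cases h1 : ε 1
  · left
    funext i
    fin_cases i
    · simpa [ω3] using h0
    · simpa [ω3] using h1
    · simpa [ω3] using h2
  · right
    funext i
    fin_cases i
    · simpa [ω21] using h0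
    · simpa [ω21] using h1
    · simpa [ω21] using h2

/-- **Weight 3 ⟺ duality is a relation.** -/
theorem weightKernelAdm_three_iff : WeightKernelAdm 3 ↔ cDual3 ∈ KZ.relations := by
  constructor
  · intro h
    exact h _ cDual3_mem_closure eval_cDual3
  · intro hD
    refine weightKernelAdm_of_rankOne ω3 adm_ω3 value_ω3_ne_zero (fun _ => 1) fun ε hε => ?_
    rcases adm_three_cases hε with rfl | rfl
    · simp
    · exact hD

/-! ### Weight 4: equivalent to THREE typed memberships -/

/-- TYPED TARGET (finite double shuffle at weight 4, route Grothendieck item 0275):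
`[Δ₄, ω₀₀₀₁] − [Δ₄, 4·ω₀₀₁₁]`, value `ζ(4) − 4ζ(3,1) = 0`. -/
def cFds4 : KZ.FormalRep := KZ.of (wordRep ω4 1 adm_ω4) - KZ.of (wordRep ω31 4 adm_ω31)

/-- TYPED TARGET (Euler's evaluation `ζ(2,2) = ¾ζ(4)`, = 4·Hoffman − FDS):
`[Δ₄, 3·ω₀₀₀₁] − [Δ₄, 4·ω₀₁₀₁]`, value `3ζ(4) − 4ζ(2,2) = 0`. -/
def cEuler4 : KZ.FormalRep := KZ.of (wordRep ω4 3 adm_ω4) - KZ.of (wordRep ω22 4 adm_ω22)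

/-- TYPED TARGET (duality at weight 4): `[Δ₄, ω₀₀₀₁] − [Δ₄, ω₀₁₁₁]`, value `ζ(4) − ζ(2,1,1) = 0`;
one change-of-variables move (gen-1 evidence, as for `cDual3`). -/
def cDual4 : KZ.FormalRep := KZ.of (wordRep ω4 1 adm_ω4) - KZ.of (wordRep ω211 1 adm_ω211)

/-- TYPED TARGET (Hoffman's relation at weight 4, the live instance of cruxes
HoffmanRelationInKZ 3930 / CoactionDevissage 3167 / Deregularisation 3906):
`[Δ₄, ω₀₀₀₁] − [Δ₄, ω₀₀₁₁] − [Δ₄, ω₀₁₀₁]`, value `ζ(4) − ζ(3,1) − ζ(2,2) = 0`. -/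
def cHoffman4 : KZ.FormalRep :=
  KZ.of (wordRep ω4 1 adm_ω4) - KZ.of (wordRep ω31 1 adm_ω31) - KZ.of (wordRep ω22 1 adm_ω22)

theorem cFds4_mem_closure : cFds4 ∈ AddSubgroup.closure (genSetAdm 4) :=
  sub_mem (AddSubgroup.subset_closure (of_wordRep_mem_genSetAdm _ _ _))
    (AddSubgroup.subset_closure (of_wordRep_mem_genSetAdm _ _ _))

theorem cEuler4_mem_closure : cEuler4 ∈ AddSubgroup.closure (genSetAdm 4) :=
  sub_mem (AddSubgroup.subset_closure (of_wordRep_mem_genSetAdm _ _ _))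
    (AddSubgroup.subset_closure (of_wordRep_mem_genSetAdm _ _ _))

theorem cDual4_mem_closure : cDual4 ∈ AddSubgroup.closure (genSetAdm 4) :=
  sub_mem (AddSubgroup.subset_closure (of_wordRep_mem_genSetAdm _ _ _))
    (AddSubgroup.subset_closure (of_wordRep_mem_genSetAdm _ _ _))

theorem cHoffman4_mem_closure : cHoffman4 ∈ AddSubgroup.closure (genSetAdm 4) :=
  sub_mem (sub_mem (AddSubgroup.subset_closure (of_wordRep_mem_genSetAdm _ _ _))
    (AddSubgroup.subset_closure (of_wordRep_mem_genSetAdm _ _ _)))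
    (AddSubgroup.subset_closure (of_wordRep_mem_genSetAdm _ _ _))

theorem eval_cFds4 : KZ.eval cFds4 = 0 := by
  rw [cFds4, map_sub, KZ.eval_of, KZ.eval_of, value_wordRep ω31 4, value_ω4, value_ω31]
  ring

theorem eval_cEuler4 : KZ.eval cEuler4 = 0 := by
  rw [cEuler4, map_sub, KZ.eval_of, KZ.eval_of, value_wordRep ω4 3, value_wordRep ω22 4, value_ω4,
    value_ω22]
  ring

theorem eval_cDual4 : KZ.eval cDual4 = 0 := by
  rw [cDual4, map_sub, KZ.eval_of, KZ.eval_of, value_ω4, value_ω211, sub_self]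

theorem eval_cHoffman4 : KZ.eval cHoffman4 = 0 := by
  rw [cHoffman4, map_sub, map_sub, KZ.eval_of, KZ.eval_of, KZ.eval_of, value_ω4, value_ω31,
    value_ω22]
  ring

theorem adm_four_cases {ε : Fin 4 → Bool} (hε : Adm ε) :
    ε = ω4 ∨ ε = ω31 ∨ ε = ω22 ∨ ε = ω211 := by
  obtain ⟨h0, h3⟩ := hε (by decide)
  cases h1 : ε 1 <;> cases h2 : ε 2
  · left
    funext i; fin_cases i
    · simpa [ω4] using h0
    · simpa [ω4] using h1
    · simpa [ω4] using h2
    · simpa [ω4] using h3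
  · right; left
    funext i; fin_cases i
    · simpa [ω31] using h0
    · simpa [ω31] using h1
    · simpa [ω31] using h2
    · simpa [ω31] using h3
  · right; right; left
    funext i; fin_cases i
    · simpa [ω22] using h0
    · simpa [ω22] using h1
    · simpa [ω22] using h2
    · simpa [ω22] using h3
  · right; right; right
    funext i; fin_cases i
    · simpa [ω211] using h0
    · simpa [ω211] using h1
    · simpa [ω211] using h2
    · simpa [ω211] using h3

/-- **Weight 4 ⟺ three typed memberships** (finite double shuffle, Euler, duality).  The converse
direction is the rank-one engine with base word `ω₀₀₀₁` (`ζ(4) = π⁴/90 ≠ 0`) and ratios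
`¼, ¾, 1` obtained from the three targets by rational rescaling (`KZ.scale`). -/
theorem weightKernelAdm_four_iff :
    WeightKernelAdm 4 ↔
      cFds4 ∈ KZ.relations ∧ cEuler4 ∈ KZ.relations ∧ cDual4 ∈ KZ.relations := by
  constructor
  · intro h
    exact ⟨h _ cFds4_mem_closure eval_cFds4, h _ cEuler4_mem_closure eval_cEuler4,
      h _ cDual4_mem_closure eval_cDual4⟩
  · rintro ⟨hF, hE, hD⟩
    refine weightKernelAdm_of_rankOne ω4 adm_ω4 value_ω4_ne_zero
      (fun ε => if ε = ω31 then 1 / 4 else if ε = ω22 then 3 / 4 else 1) fun ε hε => ?_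
    rcases adm_four_cases hε with rfl | rfl | rfl | rfl
    · simp [ω4, ω31, ω22]
    · have h := of_wordRep_smul_of adm_ω4 adm_ω31 hF (1 / 4)
      norm_num at h
      simpa [ω31, ω22] using KZ.relations.neg_mem h
    · have h := of_wordRep_smul_of adm_ω4 adm_ω22 hE (1 / 4)
      norm_num at h
      have h22 : ¬ (ω22 = ω31) := by decide
      simpa [h22] using KZ.relations.neg_mem h
    · have h1 : ¬ (ω211 = ω31) := by decide
      have h2 : ¬ (ω211 = ω22) := by decide
      simpa [h1, h2, cDual4] using KZ.relations.neg_mem hD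

/-- Hoffman ↔ Euler given finite double shuffle: pure bookkeeping inside the calculus
(`[ω₃₁] ≡ [¼ω₄]`, integrand additivity `[¼ω₄] + [¾ω₄] ≡ [ω₄]`, rescaling by `4` and `¼`). -/
theorem cHoffman4_mem_iff_cEuler4_mem (hF : cFds4 ∈ KZ.relations) :
    cHoffman4 ∈ KZ.relations ↔ cEuler4 ∈ KZ.relations := by
  -- `[ω₃₁] − [¼ ω₄]`
  have h31 : KZ.of (wordRep ω31 1 adm_ω31) - KZ.of (wordRep ω4 (1 / 4) adm_ω4) ∈ KZ.relations := by
    have h := of_wordRep_smul_of adm_ω4 adm_ω31 hF (1 / 4)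
    norm_num at h
    simpa using KZ.relations.neg_mem h
  -- `[ω₄] − [¼ω₄] − [¾ω₄]`
  have hadd : KZ.of (wordRep ω4 1 adm_ω4) - KZ.of (wordRep ω4 (1 / 4) adm_ω4) -
      KZ.of (wordRep ω4 (3 / 4) adm_ω4) ∈ KZ.relations := by
    have h := of_wordRep_add ω4 (1 / 4) (3 / 4) adm_ω4
    norm_num at h
    exact h
  constructor
  · intro hH
    -- `[ω₂₂] ≡ [ω₄] − [ω₃₁] ≡ [¾ω₄]`, then rescale by 4
    have h22 : KZ.of (wordRep ω22 1 adm_ω22) - KZ.of (wordRep ω4 (3 / 4) adm_ω4) ∈ KZ.relations := by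
      have : KZ.of (wordRep ω22 1 adm_ω22) - KZ.of (wordRep ω4 (3 / 4) adm_ω4) =
          (KZ.of (wordRep ω4 1 adm_ω4) - KZ.of (wordRep ω4 (1 / 4) adm_ω4) -
            KZ.of (wordRep ω4 (3 / 4) adm_ω4)) - cHoffman4 -
          (KZ.of (wordRep ω31 1 adm_ω31) - KZ.of (wordRep ω4 (1 / 4) adm_ω4)) := by
        simp only [cHoffman4]; abel
      rw [this]
      exact KZ.relations.sub_mem (KZ.relations.sub_mem hadd hH) h31
    have h := of_wordRep_smul_of adm_ω22 adm_ω4 h22 4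
    norm_num at h
    simpa [cEuler4] using KZ.relations.neg_mem h
  · intro hE
    have h22 : KZ.of (wordRep ω22 1 adm_ω22) - KZ.of (wordRep ω4 (3 / 4) adm_ω4) ∈ KZ.relations := by
      have h := of_wordRep_smul_of adm_ω4 adm_ω22 hE (1 / 4)
      norm_num at h
      simpa using KZ.relations.neg_mem h
    have : cHoffman4 = (KZ.of (wordRep ω4 1 adm_ω4) - KZ.of (wordRep ω4 (1 / 4) adm_ω4) -
        KZ.of (wordRep ω4 (3 / 4) adm_ω4)) -
        (KZ.of (wordRep ω31 1 adm_ω31) - KZ.of (wordRep ω4 (1 / 4) adm_ω4)) -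
        (KZ.of (wordRep ω22 1 adm_ω22) - KZ.of (wordRep ω4 (3 / 4) adm_ω4)) := by
      simp only [cHoffman4]; abel
    rw [this]
    exact KZ.relations.sub_mem (KZ.relations.sub_mem hadd h31) h22

/-- The weight-4 rung in the form the idea cards use (FDS 0275, Hoffman 3930, duality 3933). -/
theorem weightKernelAdm_four_iff' :
    WeightKernelAdm 4 ↔
      cFds4 ∈ KZ.relations ∧ cHoffman4 ∈ KZ.relations ∧ cDual4 ∈ KZ.relations := by
  rw [weightKernelAdm_four_iff]
  constructor
  · rintro ⟨hF, hE, hD⟩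
    exact ⟨hF, (cHoffman4_mem_iff_cEuler4_mem hF).mpr hE, hD⟩
  · rintro ⟨hF, hH, hD⟩
    exact ⟨hF, (cHoffman4_mem_iff_cEuler4_mem hF).mp hH, hD⟩

/-- What the crux itself says at weight 4: the four typed elements ARE relations (if it holds). -/
theorem targets_of_crux (h : MzvKernelInKZ) :
    cDual3 ∈ KZ.relations ∧ cFds4 ∈ KZ.relations ∧ cEuler4 ∈ KZ.relations ∧
      cHoffman4 ∈ KZ.relations ∧ cDual4 ∈ KZ.relations := by
  have h3 := weightKernelAdm_of_crux (w := 3) h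
  have h4 := weightKernelAdm_of_crux (w := 4) h
  exact ⟨h3 _ cDual3_mem_closure eval_cDual3, h4 _ cFds4_mem_closure eval_cFds4,
    h4 _ cEuler4_mem_closure eval_cEuler4, h4 _ cHoffman4_mem_closure eval_cHoffman4,
    h4 _ cDual4_mem_closure eval_cDual4⟩


/-! ## §4b DUALITY IS ONE MOVE (positive support lemma, re-proved; gen-1 evidence was not
readable from the tree).  For every word `ε` the representations `[Δ_w, q ω_ε]` and
`[Δ_w, q ω_{ε†}]`, `ε†ᵢ = ¬ ε_{w-1-i}`, differ by ONE change-of-variables move along the affine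
involution `Φ(t)ᵢ = 1 − t_{w−1−i}` of the simplex (`|det Φ'| = 1` because `Φ'² = id`).
Consequences: `cDual3`, `cDual4 ∈ KZ.relations`; the weight-3 rung is UNCONDITIONAL; the weight-4
rung is equivalent to the TWO memberships `cFds4`, `cEuler4` (equivalently `cFds4`, `cHoffman4`). -/

section Duality

variable {w : ℕ}

/-- The dual word `ε†ᵢ = ¬ ε (rev i)`. -/
def dualWord (ε : Fin w → Bool) : Fin w → Bool := fun i => !(ε (Fin.rev i))

theorem adm_dualWord {ε : Fin w → Bool} (hε : Adm ε) : Adm (dualWord ε) := by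
  intro h
  obtain ⟨h0, h1⟩ := hε h
  have e0 : Fin.rev (⟨0, h⟩ : Fin w) = ⟨w - 1, Nat.sub_one_lt_of_lt h⟩ := Fin.ext (by simp)
  have e1 : Fin.rev (⟨w - 1, Nat.sub_one_lt_of_lt h⟩ : Fin w) = ⟨0, h⟩ := Fin.ext (by simp; omega)
  simp [dualWord, e0, e1, h0, h1]

/-- The duality involution of the simplex. -/
def dualMap (w : ℕ) (x : Fin w → ℝ) : Fin w → ℝ := fun i => 1 - x (Fin.rev i)

/-- Its (constant) derivative `v ↦ (i ↦ −v (rev i))`. -/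
def dualLin (w : ℕ) : (Fin w → ℝ) →L[ℝ] (Fin w → ℝ) :=
  -(LinearMap.toContinuousLinearMap (LinearMap.funLeft ℝ ℝ (Fin.rev : Fin w → Fin w)))

@[simp] theorem dualLin_apply (v : Fin w → ℝ) (i : Fin w) : dualLin w v i = -v (Fin.rev i) := by
  simp [dualLin, LinearMap.funLeft_apply]

@[simp] theorem dualMap_apply (x : Fin w → ℝ) (i : Fin w) : dualMap w x i = 1 - x (Fin.rev i) := rfl

theorem dualMap_dualMap (x : Fin w → ℝ) : dualMap w (dualMap w x) = x := by
  funext i; simp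

theorem dualMap_eq_add (x : Fin w → ℝ) : dualMap w x = dualLin w x + fun _ => (1 : ℝ) := by
  funext i; simp; ring

theorem hasFDerivAt_dualMap (x : Fin w → ℝ) : HasFDerivAt (dualMap w) (dualLin w) x := by
  have : dualMap w = fun x => dualLin w x + fun _ => (1 : ℝ) := funext (dualMap_eq_add)
  rw [this]
  exact (dualLin w).hasFDerivAt.add_const _

/-- `Φ'² = id`, hence `|det Φ'| = 1` (no permutation sign needs computing). -/
theorem abs_det_dualLin : |(dualLin w).det| = 1 := by
  have hcomp : (dualLin w : (Fin w → ℝ) →ₗ[ℝ] (Fin w → ℝ)).comp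
      (dualLin w : (Fin w → ℝ) →ₗ[ℝ] (Fin w → ℝ)) = LinearMap.id := by
    apply LinearMap.ext
    intro v
    funext i
    simp
  have h := congrArg LinearMap.det hcomp
  rw [LinearMap.det_comp, LinearMap.det_id] at h
  change |LinearMap.det (dualLin w : (Fin w → ℝ) →ₗ[ℝ] (Fin w → ℝ))| = 1
  rcases mul_self_eq_one_iff.mp h with h1 | h1 <;> simp [h1]

theorem dualMap_mem_simplex {x : Fin w → ℝ} (hx : x ∈ simplex w) : dualMap w x ∈ simplex w := by
  obtain ⟨h0, h1, ha⟩ := hx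
  refine ⟨fun i => ?_, fun i => ?_, fun i j hij => ?_⟩
  · simp only [dualMap_apply]; linarith [h1 (Fin.rev i)]
  · simp only [dualMap_apply]; linarith [h0 (Fin.rev i)]
  · simp only [dualMap_apply]
    have : Fin.rev j < Fin.rev i := Fin.rev_lt_rev.mpr hij
    linarith [ha this]

theorem image_dualMap_simplex : dualMap w '' simplex w = simplex w := by
  apply Subset.antisymm
  · rintro _ ⟨x, hx, rfl⟩
    exact dualMap_mem_simplex hx
  · intro x hx
    exact ⟨dualMap w x, dualMap_mem_simplex hx, dualMap_dualMap x⟩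

theorem injOn_dualMap : InjOn (dualMap w) (simplex w) := by
  intro x _ y _ h
  rw [← dualMap_dualMap x, ← dualMap_dualMap y, h]

/-- The involution is a polynomial map over `ℚ`, hence `ℚ`-semialgebraic on the simplex. -/
theorem isSemialgebraicMapOn_dualMap : IsSemialgebraicMapOn ℚ (simplex w) (dualMap w) := by
  have h := isSemialgebraicMapOn_aeval (KZ.isSemialgebraic_openOrderedSimplex w)
    (fun j : Fin w => (1 - X (Fin.rev j) : MvPolynomial (Fin w) ℚ))
  refine h.congr fun x _ => ?_
  funext j
  simp

/-- The integrand identity `ω_{ε†}(Φ t) = ω_ε(t)` (reindex by `rev`; `1 − (1 − a) = a`). -/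
theorem wordFun_dualWord_dualMap (ε : Fin w → Bool) (q : ℚ) (x : Fin w → ℝ) :
    wordFun (dualWord ε) q (dualMap w x) = wordFun ε q x := by
  simp only [wordFun, dualWord, dualMap_apply]
  congr 1
  rw [← Equiv.prod_comp Fin.revPerm (fun i => if ε i then 1 / (1 - x i) else 1 / x i)]
  refine Finset.prod_congr rfl fun i _ => ?_
  simp only [Fin.revPerm_apply]
  cases ε (Fin.rev i) <;> simp

/-- **DUALITY IS ONE CHANGE-OF-VARIABLES MOVE.** -/
theorem duality_mem_changeOfVariablesRel (ε : Fin w → Bool) (q : ℚ) (hε : Adm ε) :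
    KZ.of (wordRep ε q hε) - KZ.of (wordRep (dualWord ε) q (adm_dualWord hε)) ∈
      KZ.changeOfVariablesRel :=
  ⟨w, wordRep ε q hε, wordRep (dualWord ε) q (adm_dualWord hε), dualMap w, fun _ => dualLin w,
    isSemialgebraicMapOn_dualMap,
    fun x _ => (hasFDerivAt_dualMap x).hasFDerivWithinAt,
    injOn_dualMap,
    image_dualMap_simplex.symm,
    fun x _ => by rw [wordRep_integrand, wordRep_integrand, abs_det_dualLin, mul_one,
      wordFun_dualWord_dualMap],
    rfl⟩

theorem duality_mem_relations (ε : Fin w → Bool) (q : ℚ) (hε : Adm ε) :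
    KZ.of (wordRep ε q hε) - KZ.of (wordRep (dualWord ε) q (adm_dualWord hε)) ∈ KZ.relations :=
  KZ.changeOfVariablesRel_subset_relations (duality_mem_changeOfVariablesRel ε q hε)

theorem wordRep_congr {ε ε' : Fin w → Bool} (h : ε = ε') (q : ℚ) (hε : Adm ε) (hε' : Adm ε') :
    wordRep ε q hε = wordRep ε' q hε' := by
  subst h; rfl

theorem dualWord_ω3 : dualWord ω3 = ω21 := by decide
theorem dualWord_ω4 : dualWord ω4 = ω211 := by decide

/-- `ζ(2,1) = ζ(3)` inside the calculus: `cDual3` is (minus) one move. -/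
theorem cDual3_mem_relations : cDual3 ∈ KZ.relations := by
  have h := duality_mem_relations ω3 1 adm_ω3
  rw [wordRep_congr dualWord_ω3 1 (adm_dualWord adm_ω3) adm_ω21] at h
  simpa [cDual3] using KZ.relations.neg_mem h

/-- `ζ(2,1,1) = ζ(4)` inside the calculus: `cDual4` is one move. -/
theorem cDual4_mem_relations : cDual4 ∈ KZ.relations := by
  have h := duality_mem_relations ω4 1 adm_ω4
  rw [wordRep_congr dualWord_ω4 1 (adm_dualWord adm_ω4) adm_ω211] at h
  exact h

/-- **THE WEIGHT-3 RUNG OF THE CRUX HOLDS, unconditionally** (duality move + bookkeeping +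
`ζ(3) > 0`). Picture by weight: `w = 2` trivial, `w = 3` proved, `w = 4` ⟺ two move-chain
problems, `w ≥ 5` meets an open independence statement (engine hypothesis `hind`). -/
theorem weightKernelAdm_three : WeightKernelAdm 3 :=
  weightKernelAdm_three_iff.mpr cDual3_mem_relations

/-- **THE WEIGHT-4 RUNG ⟺ TWO TYPED MEMBERSHIPS**: the finite double shuffle element `cFds4`
(`ζ(4) = 4ζ(3,1)`, item 0275) and the Euler element `cEuler4` (`3ζ(4) = 4ζ(2,2)`). -/
theorem weightKernelAdm_four_iff_two_targets :
    WeightKernelAdm 4 ↔ cFds4 ∈ KZ.relations ∧ cEuler4 ∈ KZ.relations := by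
  rw [weightKernelAdm_four_iff]
  exact ⟨fun h => ⟨h.1, h.2.1⟩, fun h => ⟨h.1, h.2, cDual4_mem_relations⟩⟩

/-- Same with Hoffman's relation in place of Euler's evaluation. -/
theorem weightKernelAdm_four_iff_fds_hoffman :
    WeightKernelAdm 4 ↔ cFds4 ∈ KZ.relations ∧ cHoffman4 ∈ KZ.relations := by
  rw [weightKernelAdm_four_iff']
  exact ⟨fun h => ⟨h.1, h.2.1⟩, fun h => ⟨h.1, h.2, cDual4_mem_relations⟩⟩

end Duality


/-! ## §4c NON-ADMISSIBLE WORDS CARRY NO REPRESENTATION (divergence), hence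
`WeightKernel w ↔ WeightKernelAdm w` and the crux is equivalent to its admissible form

A word whose first letter is `1` (form `dt/(1−t)` at the largest variable) or whose last letter is
`0` has a NON-integrable integrand on the simplex for every `q ≠ 0`: slicing along the largest
variable (`KZ.MZVSimplex.wordLIntegral_cons`, Tonelli) bounds the lower Lebesgue integral below by
`vol(Δⁿ(½)) · ∫_{½}^{1} dt/(1−t) = ∞`; the last-letter case is the first-letter case of the dual
word through the duality involution (§4b).  So every generator of the crux with non-admissible
letters has `q = 0`, i.e. is a zero representation, i.e. a relation — the "junk" part of the
generating set is formally absorbed. -/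

section Divergence

open ENNReal

variable {w : ℕ}

/-- The ordered simplex below `x` is open. -/
theorem isOpen_simplexLT (n : ℕ) (x : ℝ) :
    IsOpen {t : Fin n → ℝ | (∀ i, 0 < t i) ∧ (∀ i, t i < x) ∧ StrictAnti t} := by
  have h1 : IsOpen {t : Fin n → ℝ | ∀ i, 0 < t i} := by
    rw [Set.setOf_forall]
    exact isOpen_iInter_of_finite fun i => isOpen_lt continuous_const (continuous_apply i)
  have h2 : IsOpen {t : Fin n → ℝ | ∀ i, t i < x} := by
    rw [Set.setOf_forall]
    exact isOpen_iInter_of_finite fun i => isOpen_lt (continuous_apply i) continuous_const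
  have h3 : IsOpen {t : Fin n → ℝ | StrictAnti t} := by
    have : {t : Fin n → ℝ | StrictAnti t} = ⋂ i, ⋂ j, ⋂ (_ : i < j), {t | t j < t i} := by
      ext t; simp [StrictAnti]
    rw [this]
    exact isOpen_iInter_of_finite fun i => isOpen_iInter_of_finite fun j =>
      isOpen_iInter_of_finite fun _ => isOpen_lt (continuous_apply j) (continuous_apply i)
  have : {t : Fin n → ℝ | (∀ i, 0 < t i) ∧ (∀ i, t i < x) ∧ StrictAnti t} =
      {t | ∀ i, 0 < t i} ∩ {t | ∀ i, t i < x} ∩ {t : Fin n → ℝ | StrictAnti t} := by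
    ext t; simp [and_assoc]
  rw [this]
  exact (h1.inter h2).inter h3

/-- The half-size simplex `Δⁿ(½)` has positive Lebesgue measure (open and non-empty). -/
theorem volume_simplexLT_half_ne_zero (n : ℕ) :
    volume {t : Fin n → ℝ | (∀ i, 0 < t i) ∧ (∀ i, t i < 1 / 2) ∧ StrictAnti t} ≠ 0 := by
  refine ((isOpen_simplexLT n (1 / 2)).measure_pos (μ := volume)
    ⟨fun i => 1 / (4 * ((i : ℝ) + 2)), ?_⟩).ne'
  refine ⟨fun i => by positivity, fun i => ?_, fun i j hij => ?_⟩
  · have hi : (0 : ℝ) ≤ i := Nat.cast_nonneg _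
    exact one_div_lt_one_div_of_lt (by norm_num) (by nlinarith)
  · have h : (i : ℝ) < j := by exact_mod_cast hij
    exact one_div_lt_one_div_of_lt (by positivity) (by nlinarith)

/-- `∫_{½}^{1} dt/(1−t) = ∞` (as a lower Lebesgue integral). -/
theorem lintegral_inv_one_sub_eq_top :
    ∫⁻ t in Ioo (1 / 2 : ℝ) 1, ENNReal.ofReal (1 / (1 - t)) = ∞ := by
  by_contra hne
  have hlt : ∫⁻ t in Ioo (1 / 2 : ℝ) 1, ENNReal.ofReal (1 / (1 - t)) < ∞ := lt_top_iff_ne_top.mpr hne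
  have hmeas : Measurable fun t : ℝ => 1 / (1 - t) := measurable_const.div (measurable_const.sub measurable_id)
  have hint : IntegrableOn (fun t : ℝ => 1 / (1 - t)) (Ioo (1 / 2 : ℝ) 1) := by
    refine ⟨hmeas.aestronglyMeasurable, ?_⟩
    rw [hasFiniteIntegral_iff_ofReal]
    · exact hlt
    · exact (ae_restrict_iff' measurableSet_Ioo).mpr (ae_of_all _ fun t ht => by
        have : 0 < 1 - t := by linarith [ht.2]
        positivity)
  have hint' : IntegrableOn (fun t : ℝ => (t - 1)⁻¹) (Ioo (1 / 2 : ℝ) 1) := by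
    refine (hint.neg).congr_fun (fun t _ => ?_) measurableSet_Ioo
    simp only [Pi.neg_apply, one_div]
    rw [← inv_neg, neg_sub]
  have h := (intervalIntegrable_sub_inv_iff (a := (1 / 2 : ℝ)) (b := 1) (c := 1)).mp
    ((intervalIntegrable_iff_integrableOn_Ioo_of_le (by norm_num)).mpr hint')
  norm_num [Set.uIcc_of_le] at h

/-- **Divergence for a word starting with the letter `1`.** -/
theorem lintegral_word_true_cons_eq_top (L : List Bool) (n : ℕ) :
    ∫⁻ t in {t : Fin (n + 1) → ℝ | (∀ i, 0 < t i) ∧ (∀ i, t i < 1) ∧ StrictAnti t},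
        ∏ i : Fin (n + 1), ENNReal.ofReal (KZ.mzvForm ((true :: L).getD i false) (t i)) = ∞ := by
  rw [KZ.MZVSimplex.wordLIntegral_cons]
  set H : Set (Fin n → ℝ) := {t | (∀ i, 0 < t i) ∧ (∀ i, t i < 1 / 2) ∧ StrictAnti t} with hH
  have hm := volume_simplexLT_half_ne_zero n
  -- lower bound of the inner integral on `t₀ > ½`
  have hΛ : ∀ t₀ ∈ Ioo (1 / 2 : ℝ) 1, volume H ≤
      ∫⁻ t in {t : Fin n → ℝ | (∀ i, 0 < t i) ∧ (∀ i, t i < t₀) ∧ StrictAnti t},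
        ∏ i : Fin n, ENNReal.ofReal (KZ.mzvForm (L.getD i false) (t i)) := by
    intro t₀ ht₀
    calc volume H = ∫⁻ _ in H, (1 : ℝ≥0∞) := by rw [setLIntegral_const, one_mul]
      _ ≤ ∫⁻ t in H, ∏ i : Fin n, ENNReal.ofReal (KZ.mzvForm (L.getD i false) (t i)) := by
          refine setLIntegral_mono' (KZ.MZVSimplex.measurableSet_simplexLT n (1 / 2)) fun t ht => ?_
          refine Finset.one_le_prod' fun i _ => ENNReal.one_le_ofReal.mpr ?_
          have h0 : 0 < t i := ht.1 i
          have h1 : t i < 1 := (ht.2.1 i).trans (by norm_num)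
          cases L.getD i false
          · rw [KZ.mzvForm_false, le_div_iff₀ h0]; linarith
          · rw [KZ.mzvForm_true, le_div_iff₀ (by linarith)]; linarith
      _ ≤ _ := by
          refine lintegral_mono_set fun t ht => ?_
          exact ⟨ht.1, fun i => (ht.2.1 i).trans ht₀.1, ht.2.2⟩
  refine top_unique ?_
  have hmeas : Measurable fun t₀ : ℝ => ENNReal.ofReal (1 / (1 - t₀)) :=
    (measurable_const.div (measurable_const.sub measurable_id)).ennreal_ofReal
  calc (⊤ : ℝ≥0∞) = (∫⁻ t₀ in Ioo (1 / 2 : ℝ) 1, ENNReal.ofReal (1 / (1 - t₀))) * volume H := by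
        rw [lintegral_inv_one_sub_eq_top, ENNReal.top_mul hm]
    _ = ∫⁻ t₀ in Ioo (1 / 2 : ℝ) 1, ENNReal.ofReal (1 / (1 - t₀)) * volume H :=
        (lintegral_mul_const _ hmeas).symm
    _ ≤ ∫⁻ t₀ in Ioo (1 / 2 : ℝ) 1, ENNReal.ofReal (KZ.mzvForm true t₀) *
          ∫⁻ t in {t : Fin n → ℝ | (∀ i, 0 < t i) ∧ (∀ i, t i < t₀) ∧ StrictAnti t},
            ∏ i : Fin n, ENNReal.ofReal (KZ.mzvForm (L.getD i false) (t i)) := by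
        refine setLIntegral_mono' measurableSet_Ioo fun t₀ ht₀ => ?_
        rw [KZ.mzvForm_true]
        exact mul_le_mul' le_rfl (hΛ t₀ ht₀)
    _ ≤ _ := lintegral_mono_set (Ioo_subset_Ioo (by norm_num) le_rfl)

theorem measurableSet_simplex (w : ℕ) : MeasurableSet (simplex w) :=
  KZ.measurableSet_openOrderedSimplex w

/-- **No representation for a word starting with `1`**: `q · ∏ ω_ε` with `ε₀ = 1`, `q ≠ 0` is not
integrable on the simplex. -/
theorem not_integrableOn_wordFun_of_head {n : ℕ} (ε : Fin (n + 1) → Bool) (h0 : ε 0 = true)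
    {q : ℚ} (hq : q ≠ 0) : ¬ IntegrableOn (wordFun ε q) (simplex (n + 1)) volume := by
  intro hint
  have h1 : IntegrableOn (wordFun ε 1) (simplex (n + 1)) volume := by
    refine IntegrableOn.congr_fun (hint.const_mul ((q : ℝ)⁻¹)) (fun t _ => ?_)
      (measurableSet_simplex _)
    have hq' : (q : ℝ) ≠ 0 := by exact_mod_cast hq
    rw [wordFun_eq_mul_wordFun_one ε q t, ← mul_assoc, inv_mul_cancel₀ hq', one_mul]
  have h2 := h1.lintegral_lt_top
  have h3 : ∫⁻ t in simplex (n + 1), ENNReal.ofReal (wordFun ε 1 t) =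
      ∫⁻ t in simplex (n + 1), ∏ i : Fin (n + 1), ENNReal.ofReal
        (KZ.mzvForm ((true :: List.ofFn (fun j : Fin n => ε j.succ)).getD i false) (t i)) := by
    refine setLIntegral_congr_fun (measurableSet_simplex _) fun t ht => ?_
    rw [wordFun_one_eq_prod_mzvForm,
      ENNReal.ofReal_prod_of_nonneg fun i _ => (KZ.mzvForm_pos _ (ht.1 i) (ht.2.1 i)).le]
    refine Finset.prod_congr rfl fun i _ => ?_
    congr 2
    induction i using Fin.cases with
    | zero => simp [h0]
    | succ j => simp [List.getD_eq_getElem?_getD, j.isLt]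
  rw [h3] at h2
  exact absurd (lintegral_word_true_cons_eq_top (List.ofFn fun j : Fin n => ε j.succ) n) h2.ne

theorem dualWord_dualWord (ε : Fin w → Bool) : dualWord (dualWord ε) = ε := by
  funext i; simp [dualWord]

/-- Integrability is invariant under duality (Jacobian formula for the involution). -/
theorem integrableOn_wordFun_iff_dual (ε : Fin w → Bool) (q : ℚ) :
    IntegrableOn (wordFun ε q) (simplex w) volume ↔
      IntegrableOn (wordFun (dualWord ε) q) (simplex w) volume := by
  have h := integrableOn_image_iff_integrableOn_abs_det_fderiv_smul volume (measurableSet_simplex w)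
    (fun x _ => (hasFDerivAt_dualMap x).hasFDerivWithinAt) injOn_dualMap (wordFun ε q)
  rw [image_dualMap_simplex] at h
  rw [h]
  refine integrableOn_congr_fun (fun x _ => ?_) (measurableSet_simplex w)
  rw [abs_det_dualLin, one_smul, ← wordFun_dualWord_dualMap (dualWord ε) q x, dualWord_dualWord]

theorem not_adm_iff {n : ℕ} (ε : Fin (n + 1) → Bool) :
    ¬ Adm ε ↔ ε 0 = true ∨ ε (Fin.last n) = false := by
  have e : (⟨n + 1 - 1, Nat.sub_one_lt_of_lt (Nat.succ_pos n)⟩ : Fin (n + 1)) = Fin.last n :=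
    Fin.ext (by simp)
  constructor
  · intro h
    by_cases h0 : ε 0 = true
    · exact Or.inl h0
    · right
      by_contra h1
      apply h
      intro _
      refine ⟨by simpa using h0, ?_⟩
      rw [e]
      simpa using h1
  · rintro (h | h) hA
    · have := (hA (Nat.succ_pos n)).1
      simp_all
    · have := (hA (Nat.succ_pos n)).2
      rw [e] at this
      simp_all

/-- **NON-ADMISSIBLE WORDS HAVE NO REPRESENTATION**: for `¬ Adm ε` and `q ≠ 0` the word integrand
is not absolutely integrable on the simplex. -/
theorem not_integrableOn_wordFun {ε : Fin w → Bool} (hε : ¬ Adm ε) {q : ℚ} (hq : q ≠ 0) :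
    ¬ IntegrableOn (wordFun ε q) (simplex w) volume := by
  obtain ⟨n, rfl⟩ : ∃ n, w = n + 1 := by
    cases w with
    | zero => exact absurd (fun h => absurd h (lt_irrefl 0)) hε
    | succ n => exact ⟨n, rfl⟩
  rcases (not_adm_iff ε).mp hε with h | h
  · exact not_integrableOn_wordFun_of_head ε h hq
  · rw [integrableOn_wordFun_iff_dual]
    refine not_integrableOn_wordFun_of_head (dualWord ε) ?_ hq
    simp [dualWord, Fin.rev_zero, h]

/-- Hence a generator of the crux with non-admissible letters has `q = 0` … -/
theorem eq_zero_of_not_adm {ε : Fin w → Bool} {q : ℚ} (s : KZ.IntegralRep w)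
    (hd : s.domain = simplex w) (hi : EqOn s.integrand (wordFun ε q) s.domain) (hε : ¬ Adm ε) :
    q = 0 := by
  by_contra hq
  refine not_integrableOn_wordFun hε hq ?_
  have h := s.integrableOn.congr_fun hi (KZ.IntegralRep.measurableSet_domain_holds s)
  rwa [hd] at h

/-- … and is therefore a relation (zero integrand on the domain). -/
theorem of_mem_relations_of_not_adm {ε : Fin w → Bool} {q : ℚ} (s : KZ.IntegralRep w)
    (hd : s.domain = simplex w) (hi : EqOn s.integrand (wordFun ε q) s.domain) (hε : ¬ Adm ε) :
    KZ.of s ∈ KZ.relations := by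
  have hq := eq_zero_of_not_adm s hd hi hε
  subst hq
  exact of_mem_relations_of_eqOn_zero s fun t ht => by simp [hi ht, wordFun]

/-- Every element of the full weight-`w` closure is congruent to one of the admissible closure. -/
theorem exists_adm_congr {c : KZ.FormalRep} (hc : c ∈ AddSubgroup.closure (genSetW w)) :
    ∃ c' ∈ AddSubgroup.closure (genSetAdm w), c - c' ∈ KZ.relations := by
  induction hc using AddSubgroup.closure_induction with
  | mem x hx =>
    obtain ⟨ε, q, s, hd, hi, rfl⟩ := hx
    by_cases hε : Adm ε
    · exact ⟨KZ.of s, AddSubgroup.subset_closure ⟨ε, q, s, hε, hd, hi, rfl⟩, by simp⟩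
    · exact ⟨0, zero_mem _, by simpa using of_mem_relations_of_not_adm s hd hi hε⟩
  | zero => exact ⟨0, zero_mem _, by simp⟩
  | add x y _ _ ihx ihy =>
    obtain ⟨c₁, h₁, e₁⟩ := ihx
    obtain ⟨c₂, h₂, e₂⟩ := ihy
    refine ⟨c₁ + c₂, add_mem h₁ h₂, ?_⟩
    have : x + y - (c₁ + c₂) = (x - c₁) + (y - c₂) := by abel
    rw [this]
    exact add_mem e₁ e₂
  | neg x _ ih =>
    obtain ⟨c', h', e'⟩ := ih
    refine ⟨-c', neg_mem h', ?_⟩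
    have : -x - -c' = -(x - c') := by abel
    rw [this]
    exact neg_mem e'

/-- **`WeightKernel w ↔ WeightKernelAdm w`**: the cards' rung IS the admissible rung. -/
theorem weightKernel_iff_weightKernelAdm : WeightKernel w ↔ WeightKernelAdm w := by
  refine ⟨weightKernelAdm_of_weightKernel, fun h c hc hc0 => ?_⟩
  obtain ⟨c', hc', e⟩ := exists_adm_congr hc
  have hev : KZ.eval c' = 0 := by
    have := (AddMonoidHom.mem_ker).1 (KZ.relations_le_ker_eval_holds e)
    rwa [map_sub, hc0, zero_sub, neg_eq_zero] at this
  have := add_mem e (h c' hc' hev)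
  simpa using this

/-- So the weight-3 rung holds for the cards' `WeightKernel 3` verbatim, and `WeightKernel 4` is
exactly the two typed memberships. -/
theorem weightKernel_three : WeightKernel 3 :=
  weightKernel_iff_weightKernelAdm.mpr weightKernelAdm_three

theorem weightKernel_two : WeightKernel 2 :=
  weightKernel_iff_weightKernelAdm.mpr weightKernelAdm_two

theorem weightKernel_four_iff : WeightKernel 4 ↔ cFds4 ∈ KZ.relations ∧ cEuler4 ∈ KZ.relations :=
  weightKernel_iff_weightKernelAdm.trans weightKernelAdm_four_iff_two_targets

end Divergence

/-! ## §5 The all-weights TRANSFER THEOREM (the idea cards' engine, typed and proved)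

`cruxAdm_of_family`: if a family `B` of admissible words (any index type, all weights mixed —
e.g. the empty word together with the Hoffman words) has `ℚ`-linearly independent VALUES and spans
every admissible word representation MODULO RELATIONS with rational coefficients, then the crux
holds on the admissible closure.  The independence hypothesis for `B = {∅} ∪ Hoffman` is the
Hoffman-basis form of Zagier's conjecture (transcendence, open); the spanning hypothesis is
`HoffmanSpanInKZ` (CoactionDevissage 3166, move chains); NOTHING ELSE is needed — in particular no
integer division and no weight-grading argument beyond what independence of the mixed family says.
Conversely the spanning half is forced by the crux (`sub_sum_mem_relations_of_cruxAdm`). -/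

section Transfer

/-- All admissible generators, all weights. -/
def genSetAdmAll : Set KZ.FormalRep :=
  {x | ∃ (w : ℕ) (ε : Fin w → Bool) (q : ℚ) (s : KZ.IntegralRep w),
    Adm ε ∧ s.domain = simplex w ∧ EqOn s.integrand (wordFun ε q) s.domain ∧ x = KZ.of s}

/-- The crux on the admissible closure (non-admissible generators are zero representations). -/
def CruxAdm : Prop :=
  ∀ c ∈ AddSubgroup.closure genSetAdmAll, KZ.eval c = 0 → c ∈ KZ.relations

theorem genSetAdmAll_subset_genSet : genSetAdmAll ⊆ genSet := by
  rintro x ⟨w, ε, q, s, -, hd, hi, rfl⟩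
  exact ⟨w, ε, q, s, hd, hi, rfl⟩

theorem cruxAdm_of_crux (h : MzvKernelInKZ) : CruxAdm :=
  fun c hc => h c (AddSubgroup.closure_mono genSetAdmAll_subset_genSet hc)

theorem of_wordRep_mem_genSetAdmAll {w : ℕ} (ε : Fin w → Bool) (q : ℚ) (hε : Adm ε) :
    KZ.of (wordRep ε q hε) ∈ genSetAdmAll :=
  ⟨w, ε, q, wordRep ε q hε, hε, rfl, fun _ _ => rfl, rfl⟩

/-- The class map to `FormalRep ⧸ relations` (the group of "rules-periods"). -/
def cls : KZ.FormalRep →+ KZ.FormalRep ⧸ KZ.relations := QuotientAddGroup.mk' KZ.relations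

theorem cls_eq_zero_iff {c : KZ.FormalRep} : cls c = 0 ↔ c ∈ KZ.relations :=
  QuotientAddGroup.eq_zero_iff c

theorem cls_eq_cls_iff {c c' : KZ.FormalRep} : cls c = cls c' ↔ c - c' ∈ KZ.relations := by
  rw [← sub_eq_zero, ← map_sub, cls_eq_zero_iff]

/-- Evaluation descends to the quotient (soundness). -/
def evalQ : KZ.FormalRep ⧸ KZ.relations →+ ℝ :=
  QuotientAddGroup.lift KZ.relations KZ.eval KZ.relations_le_ker_eval_holds

@[simp] theorem evalQ_cls (c : KZ.FormalRep) : evalQ (cls c) = KZ.eval c := rfl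

variable {ι : Type*} {wt : ι → ℕ} (B : ∀ j, Fin (wt j) → Bool) (hB : ∀ j, Adm (B j))

/-- The coefficient map of one base word, `q ↦ class of [Δ, q ω_{Bⱼ}]`: ADDITIVE, by integrand
additivity. -/
def coefHom (j : ι) : ℚ →+ KZ.FormalRep ⧸ KZ.relations where
  toFun q := cls (KZ.of (wordRep (B j) q (hB j)))
  map_zero' := cls_eq_zero_iff.mpr (of_wordRep_zero_mem_relations _ _)
  map_add' q₁ q₂ := by
    rw [← map_add, cls_eq_cls_iff, ← sub_sub]
    exact of_wordRep_add _ _ _ _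

@[simp] theorem coefHom_apply (j : ι) (q : ℚ) :
    coefHom B hB j q = cls (KZ.of (wordRep (B j) q (hB j))) := rfl

/-- The normal-form map on finitely supported rational coefficient vectors. -/
def nfHom : (ι →₀ ℚ) →+ KZ.FormalRep ⧸ KZ.relations := Finsupp.liftAddHom (coefHom B hB)

theorem nfHom_apply (l : ι →₀ ℚ) :
    nfHom B hB l = l.sum fun j q => cls (KZ.of (wordRep (B j) q (hB j))) :=
  Finsupp.liftAddHom_apply _ _

theorem cls_finsuppSum (l : ι →₀ ℚ) :
    cls (l.sum fun j q => KZ.of (wordRep (B j) q (hB j))) = nfHom B hB l := by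
  rw [map_finsuppSum, nfHom_apply]

theorem evalQ_nfHom (l : ι →₀ ℚ) :
    evalQ (nfHom B hB l) = l.sum fun j q => (q : ℝ) * (wordRep (B j) 1 (hB j)).value := by
  rw [nfHom_apply, map_finsuppSum]
  exact Finsupp.sum_congr fun j _ => by rw [evalQ_cls, KZ.eval_of, value_wordRep]

/-- Rational rescaling of a representative of a normal form. -/
theorem cls_scale_finsuppSum (q : ℚ) (a : ι →₀ ℚ) :
    cls (KZ.scale (q : ℝ) (isAlgebraic_ratCast q) (a.sum fun j r => KZ.of (wordRep (B j) r (hB j)))) =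
      nfHom B hB (q • a) := by
  rw [map_finsuppSum, map_finsuppSum, nfHom_apply, Finsupp.sum_smul_index]
  · refine Finsupp.sum_congr fun j _ => ?_
    rw [KZ.scale_of, cls_eq_cls_iff]
    exact of_sub_of_mem_relations_of_eqOn rfl fun t _ => by
      simp only [KZ.IntegralRep.integrand_constMul, wordRep_integrand, wordFun, Rat.cast_mul]
      ring
  · intro j
    exact cls_eq_zero_iff.mpr (of_wordRep_zero_mem_relations _ _)

/-- **TRANSFER THEOREM** (independent values + spanning inside the calculus ⇒ the crux on the
admissible closure). -/
theorem cruxAdm_of_family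
    (hind : LinearIndependent ℚ fun j => (wordRep (B j) 1 (hB j)).value)
    (hspan : ∀ (w : ℕ) (ε : Fin w → Bool) (hε : Adm ε), ∃ a : ι →₀ ℚ,
      KZ.of (wordRep ε 1 hε) - a.sum (fun j r => KZ.of (wordRep (B j) r (hB j))) ∈ KZ.relations) :
    CruxAdm := by
  intro c hc hc0
  have key : ∃ l : ι →₀ ℚ, cls c = nfHom B hB l := by
    clear hc0
    induction hc using AddSubgroup.closure_induction with
    | mem x hx =>
      obtain ⟨w, ε, q, s, hε, hd, hi, rfl⟩ := hx
      obtain ⟨a, ha⟩ := hspan w ε hε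
      refine ⟨q • a, ?_⟩
      have h1 : cls (KZ.of s) = cls (KZ.of (wordRep ε q hε)) :=
        cls_eq_cls_iff.mpr (of_sub_of_wordRep_mem_relations hε s hd hi)
      have h2 : cls (KZ.of (wordRep ε q hε)) =
          cls (KZ.scale (q : ℝ) (isAlgebraic_ratCast q) (KZ.of (wordRep ε 1 hε))) := by
        rw [KZ.scale_of, cls_eq_cls_iff]
        exact of_sub_of_mem_relations_of_eqOn rfl fun t _ => by
          simp only [KZ.IntegralRep.integrand_constMul, wordRep_integrand, wordFun, Rat.cast_one]
          ring
      have h3 : cls (KZ.scale (q : ℝ) (isAlgebraic_ratCast q) (KZ.of (wordRep ε 1 hε))) =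
          cls (KZ.scale (q : ℝ) (isAlgebraic_ratCast q)
            (a.sum fun j r => KZ.of (wordRep (B j) r (hB j)))) := by
        rw [cls_eq_cls_iff, ← map_sub]
        exact KZ.scale_mem_relations _ _ ha
      rw [h1, h2, h3, cls_scale_finsuppSum]
    | zero => exact ⟨0, by simp⟩
    | add x y _ _ ihx ihy =>
      obtain ⟨l₁, h₁⟩ := ihx
      obtain ⟨l₂, h₂⟩ := ihy
      exact ⟨l₁ + l₂, by rw [map_add, map_add, h₁, h₂]⟩
    | neg x _ ih =>
      obtain ⟨l, h⟩ := ih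
      exact ⟨-l, by rw [map_neg, map_neg, h]⟩
  obtain ⟨l, hl⟩ := key
  have hev : evalQ (nfHom B hB l) = 0 := by rw [← hl, evalQ_cls, hc0]
  have hl0 : l = 0 := by
    refine linearIndependent_iff.mp hind l ?_
    rw [Finsupp.linearCombination_apply]
    rw [evalQ_nfHom] at hev
    simpa [Rat.smul_def] using hev
  rw [hl0, map_zero, cls_eq_zero_iff] at hl
  exact hl

/-- Cheap converse: the crux forces the spanning half whenever the values span
(e.g. Brown's `hoffmanSpan_eq_mzvSpace`). -/
theorem sub_sum_mem_relations_of_cruxAdm (h : CruxAdm) {w : ℕ} {ε : Fin w → Bool} (hε : Adm ε)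
    (a : ι →₀ ℚ)
    (hval : (wordRep ε 1 hε).value = a.sum fun j r => (r : ℝ) * (wordRep (B j) 1 (hB j)).value) :
    KZ.of (wordRep ε 1 hε) - a.sum (fun j r => KZ.of (wordRep (B j) r (hB j))) ∈ KZ.relations := by
  have hsum : (a.sum fun j r => KZ.of (wordRep (B j) r (hB j))) ∈ AddSubgroup.closure genSetAdmAll :=
    sum_mem fun j _ => AddSubgroup.subset_closure (of_wordRep_mem_genSetAdmAll _ _ _)
  refine h _ (sub_mem (AddSubgroup.subset_closure (of_wordRep_mem_genSetAdmAll _ _ _)) hsum) ?_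
  rw [map_sub, KZ.eval_of, hval, map_finsuppSum, sub_eq_zero]
  exact Finsupp.sum_congr fun j _ => by rw [KZ.eval_of, value_wordRep (B j) (a j)]

end Transfer

section AdmAll

variable {w : ℕ}

/-- All-weights version: every element of the crux's closure is congruent to one of the admissible
closure. -/
theorem exists_admAll_congr {c : KZ.FormalRep} (hc : c ∈ AddSubgroup.closure genSet) :
    ∃ c' ∈ AddSubgroup.closure genSetAdmAll, c - c' ∈ KZ.relations := by
  induction hc using AddSubgroup.closure_induction with
  | mem x hx =>
    obtain ⟨w, ε, q, s, hd, hi, rfl⟩ := hx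
    by_cases hε : Adm ε
    · exact ⟨KZ.of s, AddSubgroup.subset_closure ⟨w, ε, q, s, hε, hd, hi, rfl⟩, by simp⟩
    · exact ⟨0, zero_mem _, by simpa using of_mem_relations_of_not_adm s hd hi hε⟩
  | zero => exact ⟨0, zero_mem _, by simp⟩
  | add x y _ _ ihx ihy =>
    obtain ⟨c₁, h₁, e₁⟩ := ihx
    obtain ⟨c₂, h₂, e₂⟩ := ihy
    refine ⟨c₁ + c₂, add_mem h₁ h₂, ?_⟩
    have : x + y - (c₁ + c₂) = (x - c₁) + (y - c₂) := by abel
    rw [this]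
    exact add_mem e₁ e₂
  | neg x _ ih =>
    obtain ⟨c', h', e'⟩ := ih
    refine ⟨-c', neg_mem h', ?_⟩
    have : -x - -c' = -(x - c') := by abel
    rw [this]
    exact neg_mem e'

/-- **THE CRUX IS EQUIVALENT TO ITS ADMISSIBLE FORM** — so the transfer theorem `cruxAdm_of_family`
(§5) proves the crux itself from (independence of values) ∧ (spanning inside the calculus). -/
theorem crux_iff_cruxAdm : MzvKernelInKZ ↔ CruxAdm := by
  refine ⟨cruxAdm_of_crux, fun h c hc hc0 => ?_⟩
  obtain ⟨c', hc', e⟩ := exists_admAll_congr hc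
  have hev : KZ.eval c' = 0 := by
    have := (AddMonoidHom.mem_ker).1 (KZ.relations_le_ker_eval_holds e)
    rwa [map_sub, hc0, zero_sub, neg_eq_zero] at this
  have := add_mem e (h c' hc' hev)
  simpa using this

/-- **TRANSFER, final form**: independent values + spanning inside the calculus ⇒ `MzvKernelInKZ`. -/
theorem crux_of_family {ι : Type*} {wt : ι → ℕ} (B : ∀ j, Fin (wt j) → Bool) (hB : ∀ j, Adm (B j))
    (hind : LinearIndependent ℚ fun j => (wordRep (B j) 1 (hB j)).value)
    (hspan : ∀ (w : ℕ) (ε : Fin w → Bool) (hε : Adm ε), ∃ a : ι →₀ ℚ,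
      KZ.of (wordRep ε 1 hε) - a.sum (fun j r => KZ.of (wordRep (B j) r (hB j))) ∈ KZ.relations) :
    MzvKernelInKZ :=
  crux_iff_cruxAdm.mpr (cruxAdm_of_family B hB hind hspan)

end AdmAll

/-! ## §5b WEIGHT 5: where transcendence FIRST enters (`d₅ = 2`)

Eight admissible words; inside the calculus duality identifies `311~41, 221~32, 212~23, 2111~5`
(§4b), so with base `{ζ(5), ζ(4,1)}` the spanning half is TWO typed memberships (the double
shuffle evaluations `2ζ(3,2) = ζ(5) − 6ζ(4,1)`, `2ζ(2,3) = ζ(5) + 4ζ(4,1)`), and the engine closes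
`WeightKernel 5` exactly when `ζ(5), ζ(4,1)` are `ℚ`-linearly independent — equivalently
`ζ(2)ζ(3)/ζ(5) ∉ ℚ` (Euler: `ζ(4,1) = 2ζ(5) − ζ(2)ζ(3)`), which is OPEN.  This is the precise
sense of the crux's why-might-fail "needs Zagier's conjecture": already its weight-5 rung is
(two move chains) + (one open irrationality). -/

section WeightFive

variable {w : ℕ}

/-- The coefficient map of one word `q ↦ class of [Δ, q ω_ε]` (additive). -/
def wcls (ε : Fin w → Bool) (hε : Adm ε) : ℚ →+ KZ.FormalRep ⧸ KZ.relations where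
  toFun q := cls (KZ.of (wordRep ε q hε))
  map_zero' := cls_eq_zero_iff.mpr (of_wordRep_zero_mem_relations _ _)
  map_add' q₁ q₂ := by
    rw [← map_add, cls_eq_cls_iff, ← sub_sub]
    exact of_wordRep_add _ _ _ _

theorem cls_of_wordRep (ε : Fin w → Bool) (q : ℚ) (hε : Adm ε) :
    cls (KZ.of (wordRep ε q hε)) = wcls ε hε q := rfl

theorem cls_scale_of_wordRep (c a : ℚ) (ε : Fin w → Bool) (hε : Adm ε) :
    cls (KZ.scale (c : ℝ) (isAlgebraic_ratCast c) (KZ.of (wordRep ε a hε))) = wcls ε hε (c * a) := by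
  rw [KZ.scale_of, ← cls_of_wordRep, cls_eq_cls_iff]
  exact of_sub_of_mem_relations_of_eqOn rfl fun t _ => by
    simp only [KZ.IntegralRep.integrand_constMul, wordRep_integrand, wordFun, Rat.cast_mul]
    ring

theorem wcls_dualWord (ε : Fin w → Bool) (hε : Adm ε) (q : ℚ) :
    wcls (dualWord ε) (adm_dualWord hε) q = wcls ε hε q := by
  rw [← cls_of_wordRep, ← cls_of_wordRep, eq_comm, cls_eq_cls_iff]
  exact duality_mem_relations ε q hε

theorem wcls_congr {ε ε' : Fin w → Bool} (h : ε = ε') (hε : Adm ε) (hε' : Adm ε') :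
    wcls ε hε = wcls ε' hε' := by
  subst h; rfl

/-- The admissible words of weight 5. -/
def ω5 : Fin 5 → Bool := ![false, false, false, false, true]
def ω41 : Fin 5 → Bool := ![false, false, false, true, true]
def ω32 : Fin 5 → Bool := ![false, false, true, false, true]
def ω23 : Fin 5 → Bool := ![false, true, false, false, true]
def ω311 : Fin 5 → Bool := ![false, false, true, true, true]
def ω221 : Fin 5 → Bool := ![false, true, false, true, true]
def ω212 : Fin 5 → Bool := ![false, true, true, false, true]
def ω2111 : Fin 5 → Bool := ![false, true, true, true, true]

theorem adm_ω5 : Adm ω5 := by decide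
theorem adm_ω41 : Adm ω41 := by decide
theorem adm_ω32 : Adm ω32 := by decide
theorem adm_ω23 : Adm ω23 := by decide
theorem adm_ω311 : Adm ω311 := by decide
theorem adm_ω221 : Adm ω221 := by decide
theorem adm_ω212 : Adm ω212 := by decide
theorem adm_ω2111 : Adm ω2111 := by decide

theorem dualWord_ω41 : dualWord ω41 = ω311 := by decide
theorem dualWord_ω32 : dualWord ω32 = ω221 := by decide
theorem dualWord_ω23 : dualWord ω23 = ω212 := by decide
theorem dualWord_ω5 : dualWord ω5 = ω2111 := by decide

theorem value_ω5 : (wordRep ω5 1 adm_ω5).value = multipleZeta [5] :=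
  value_wordRep_eq_multipleZeta [5] (by decide) ω5 adm_ω5 (by decide)

theorem value_ω41 : (wordRep ω41 1 adm_ω41).value = multipleZeta [4, 1] :=
  value_wordRep_eq_multipleZeta [4, 1] (by decide) ω41 adm_ω41 (by decide)

theorem value_ω32 : (wordRep ω32 1 adm_ω32).value = multipleZeta [3, 2] :=
  value_wordRep_eq_multipleZeta [3, 2] (by decide) ω32 adm_ω32 (by decide)

theorem value_ω23 : (wordRep ω23 1 adm_ω23).value = multipleZeta [2, 3] :=
  value_wordRep_eq_multipleZeta [2, 3] (by decide) ω23 adm_ω23 (by decide)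

/-- TYPED TARGET, weight 5: `[Δ₅, 2ω₃₂] − [Δ₅, ω₅] + [Δ₅, 6ω₄₁]` (value `2ζ(3,2) − ζ(5) + 6ζ(4,1) = 0`,
a double shuffle evaluation). -/
def cT32 : KZ.FormalRep :=
  KZ.of (wordRep ω32 2 adm_ω32) - KZ.of (wordRep ω5 1 adm_ω5) + KZ.of (wordRep ω41 6 adm_ω41)

/-- TYPED TARGET, weight 5: `[Δ₅, 2ω₂₃] − [Δ₅, ω₅] − [Δ₅, 4ω₄₁]` (value `2ζ(2,3) − ζ(5) − 4ζ(4,1) = 0`). -/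
def cT23 : KZ.FormalRep :=
  KZ.of (wordRep ω23 2 adm_ω23) - KZ.of (wordRep ω5 1 adm_ω5) - KZ.of (wordRep ω41 4 adm_ω41)

theorem eval_cT32 : KZ.eval cT32 = 0 := by
  rw [cT32, map_add, map_sub, KZ.eval_of, KZ.eval_of, KZ.eval_of, value_wordRep ω32 2,
    value_wordRep ω41 6, value_ω32, value_ω5, value_ω41, multipleZeta_three_two_eq,
    multipleZeta_four_one_eq]
  ring

theorem eval_cT23 : KZ.eval cT23 = 0 := by
  rw [cT23, map_sub, map_sub, KZ.eval_of, KZ.eval_of, KZ.eval_of, value_wordRep ω23 2,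
    value_wordRep ω41 4, value_ω23, value_ω5, value_ω41, multipleZeta_two_three_eq,
    multipleZeta_four_one_eq]
  ring

theorem cT32_mem_closure : cT32 ∈ AddSubgroup.closure (genSetW 5) :=
  add_mem (sub_mem (AddSubgroup.subset_closure (genSetAdm_subset_genSetW (of_wordRep_mem_genSetAdm _ _ _)))
    (AddSubgroup.subset_closure (genSetAdm_subset_genSetW (of_wordRep_mem_genSetAdm _ _ _))))
    (AddSubgroup.subset_closure (genSetAdm_subset_genSetW (of_wordRep_mem_genSetAdm _ _ _)))

theorem cT23_mem_closure : cT23 ∈ AddSubgroup.closure (genSetW 5) :=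
  sub_mem (sub_mem (AddSubgroup.subset_closure (genSetAdm_subset_genSetW (of_wordRep_mem_genSetAdm _ _ _)))
    (AddSubgroup.subset_closure (genSetAdm_subset_genSetW (of_wordRep_mem_genSetAdm _ _ _))))
    (AddSubgroup.subset_closure (genSetAdm_subset_genSetW (of_wordRep_mem_genSetAdm _ _ _)))

/-- The calculus half of the weight-5 rung is forced by the rung (values from the tree's weight-5
double shuffle theorems). -/
theorem targets5_of_weightKernel (h : WeightKernel 5) : cT32 ∈ KZ.relations ∧ cT23 ∈ KZ.relations :=
  ⟨h _ cT32_mem_closure eval_cT32, h _ cT23_mem_closure eval_cT23⟩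

theorem adm_five_cases {ε : Fin 5 → Bool} (hε : Adm ε) :
    ε = ω5 ∨ ε = ω41 ∨ ε = ω32 ∨ ε = ω23 ∨ ε = ω311 ∨ ε = ω221 ∨ ε = ω212 ∨ ε = ω2111 := by
  obtain ⟨h0, h4⟩ := hε (by decide)
  have key : ∀ ε' : Fin 5 → Bool, ε' 0 = false → ε' 4 = true →
      ε' = ![false, ε' 1, ε' 2, ε' 3, true] := by
    intro ε' e0 e4
    funext i
    fin_cases i <;> simp [e0, e4]
  have hk := key ε (by simpa using h0) (by simpa using h4)
  rw [hk]
  cases ε 1 <;> cases ε 2 <;> cases ε 3 <;> decide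

/-- In the quotient: the two targets, rescaled by `½`. -/
theorem wcls_ω32_of (h32 : cT32 ∈ KZ.relations) :
    wcls ω32 adm_ω32 1 = wcls ω5 adm_ω5 (1 / 2) + wcls ω41 adm_ω41 (-3) := by
  have h := cls_eq_zero_iff.mpr (KZ.scale_mem_relations ((1 / 2 : ℚ) : ℝ) (isAlgebraic_ratCast _) h32)
  rw [cT32, map_add, map_sub, map_add, map_sub, cls_scale_of_wordRep, cls_scale_of_wordRep,
    cls_scale_of_wordRep] at h
  norm_num at h
  rw [map_neg, ← sub_eq_zero, ← h]
  abel

theorem wcls_ω23_of (h23 : cT23 ∈ KZ.relations) :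
    wcls ω23 adm_ω23 1 = wcls ω5 adm_ω5 (1 / 2) + wcls ω41 adm_ω41 2 := by
  have h := cls_eq_zero_iff.mpr (KZ.scale_mem_relations ((1 / 2 : ℚ) : ℝ) (isAlgebraic_ratCast _) h23)
  rw [cT23, map_sub, map_sub, map_sub, map_sub, cls_scale_of_wordRep, cls_scale_of_wordRep,
    cls_scale_of_wordRep] at h
  norm_num at h
  rw [← sub_eq_zero, ← h]
  abel

/-- **THE WEIGHT-5 RUNG = two move chains + ONE open irrationality.** -/
theorem weightKernel_five_of
    (hind : LinearIndependent ℚ ![multipleZeta [5], multipleZeta [4, 1]])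
    (h32 : cT32 ∈ KZ.relations) (h23 : cT23 ∈ KZ.relations) : WeightKernel 5 := by
  rw [weightKernel_iff_weightKernelAdm]
  have hB : ∀ j : Fin 2, Adm ((![ω5, ω41] : Fin 2 → (Fin 5 → Bool)) j) := by
    intro j; fin_cases j
    · exact adm_ω5
    · exact adm_ω41
  refine weightKernelAdm_of_basis ![ω5, ω41] hB ?_ fun ε hε => ?_
  · convert hind using 1
    funext j
    fin_cases j
    · exact value_ω5
    · exact value_ω41
  · -- spanning, case by case, in the quotient
    have goal_iff : ∀ a : Fin 2 → ℚ,
        (KZ.of (wordRep ε 1 hε) - nf ![ω5, ω41] hB a ∈ KZ.relations ↔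
          wcls ε hε 1 = wcls ω5 adm_ω5 (a 0) + wcls ω41 adm_ω41 (a 1)) := by
      intro a
      rw [← cls_eq_cls_iff, nf, Fin.sum_univ_two, map_add]
      rfl
    have e32 := wcls_ω32_of h32
    have e23 := wcls_ω23_of h23
    rcases adm_five_cases hε with rfl | rfl | rfl | rfl | rfl | rfl | rfl | rfl
    · exact ⟨![1, 0], (goal_iff _).mpr (by simp)⟩
    · exact ⟨![0, 1], (goal_iff _).mpr (by simp)⟩
    · exact ⟨![1 / 2, -3], (goal_iff _).mpr (by simpa using e32)⟩
    · exact ⟨![1 / 2, 2], (goal_iff _).mpr (by simpa using e23)⟩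
    · refine ⟨![0, 1], (goal_iff _).mpr ?_⟩
      rw [← wcls_congr dualWord_ω41 (adm_dualWord adm_ω41) hε, wcls_dualWord ω41 adm_ω41]
      simp
    · refine ⟨![1 / 2, -3], (goal_iff _).mpr ?_⟩
      rw [← wcls_congr dualWord_ω32 (adm_dualWord adm_ω32) hε, wcls_dualWord ω32 adm_ω32]
      simpa using e32
    · refine ⟨![1 / 2, 2], (goal_iff _).mpr ?_⟩
      rw [← wcls_congr dualWord_ω23 (adm_dualWord adm_ω23) hε, wcls_dualWord ω23 adm_ω23]
      simpa using e23
    · refine ⟨![1, 0], (goal_iff _).mpr ?_⟩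
      rw [← wcls_congr dualWord_ω5 (adm_dualWord adm_ω5) hε, wcls_dualWord ω5 adm_ω5]
      simp

/-- The independence hypothesis in the form usually quoted: by Euler's `ζ(4,1) = 2ζ(5) − ζ(2)ζ(3)`,
`ζ(5), ζ(4,1)` are independent iff `ζ(5), ζ(2)ζ(3)` are. -/
theorem linearIndependent_five_iff :
    LinearIndependent ℚ ![multipleZeta [5], multipleZeta [4, 1]] ↔
      LinearIndependent ℚ ![multipleZeta [5], multipleZeta [2] * multipleZeta [3]] := by
  rw [LinearIndependent.pair_iff, LinearIndependent.pair_iff]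
  constructor
  · intro h s t hst
    -- s ζ5 + t ζ2ζ3 = 0, with ζ2ζ3 = 2ζ5 − ζ41
    have := h (s + 2 * t) (-t) (by
      rw [multipleZeta_four_one_eq]
      simp only [Rat.smul_def, Rat.cast_add, Rat.cast_mul, Rat.cast_neg, Rat.cast_ofNat] at hst ⊢
      linarith)
    obtain ⟨h1, h2⟩ := this
    constructor <;> linarith
  · intro h s t hst
    have := h (s + 2 * t) (-t) (by
      rw [multipleZeta_four_one_eq] at hst
      simp only [Rat.smul_def, Rat.cast_add, Rat.cast_mul, Rat.cast_neg, Rat.cast_ofNat] at hst ⊢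
      linarith)
    obtain ⟨h1, h2⟩ := this
    constructor <;> linarith

end WeightFive

/-! ## §6 Strength: what any PROOF of the crux must contain

`zeta_three_not_mem_span_of_crux`: if the calculus cannot produce a non-trivial relation among the
four classes `[pt, ·], [Δ₂, ·ω₀₁], [Δ₃, ·ω₀₀₁], [Δ₄, ·ω₀₀₀₁]` (this is what motivic soundness of the
four moves plus the motivic independence of `1, ζᵐ(2), ζᵐ(3), ζᵐ(4)` predicts — nobody expects a move
chain realising a "fake" relation), then the crux already implies `ζ(3) ∉ ℚ + ℚπ² + ℚπ⁴`, which is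
OPEN.  So a proof of the crux is transcendence-complete on its sector: it must decide such
independence questions, not merely supply move chains. -/

section Strength

/-- Independence IN THE CALCULUS of the four lowest base classes (rational-coefficient form). -/
def LowBaseIndependentInCalculus : Prop :=
  ∀ a b c d : ℚ,
    KZ.of (constRep a) + KZ.of (wordRep ω2 b adm_ω2) + KZ.of (wordRep ω3 c adm_ω3) +
        KZ.of (wordRep ω4 d adm_ω4) ∈ KZ.relations →
      a = 0 ∧ b = 0 ∧ c = 0 ∧ d = 0

/-- **Crux + independence in the calculus ⇒ `ζ(3) ∉ ℚ + ℚπ² + ℚπ⁴`** (open). -/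
theorem zeta_three_not_mem_span_of_crux (h : MzvKernelInKZ) (hI : LowBaseIndependentInCalculus)
    (a b d : ℚ) : multipleZeta [3] ≠ a + b * Real.pi ^ 2 + d * Real.pi ^ 4 := by
  intro h3
  -- the vanishing combination `[pt,a] + [Δ₂, 6b·ω] + [Δ₃, (−1)·ω] + [Δ₄, 90d·ω]`
  set c : KZ.FormalRep := KZ.of (constRep a) + KZ.of (wordRep ω2 (6 * b) adm_ω2) +
    KZ.of (wordRep ω3 (-1) adm_ω3) + KZ.of (wordRep ω4 (90 * d) adm_ω4) with hc
  have hmem : c ∈ AddSubgroup.closure genSet := by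
    refine add_mem (add_mem (add_mem ?_ ?_) ?_) ?_ <;>
      exact AddSubgroup.subset_closure (of_wordRep_mem_genSet _ _ _)
  have hev : KZ.eval c = 0 := by
    simp only [hc, map_add, KZ.eval_of, value_constRep]
    rw [value_wordRep ω2 (6 * b), value_wordRep ω3 (-1), value_wordRep ω4 (90 * d), value_ω2,
      value_ω3, value_ω4, h3]
    push_cast
    ring
  have hrel := h c hmem hev
  have := (hI a (6 * b) (-1) (90 * d) hrel).2.2.1
  norm_num at this

end Strength

/-! ## §7 Near-misses (the live prover targets; `sorry` permitted in this work file only)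

With §4b, the first open layer of the crux is EXACTLY `cFds4 ∈ relations ∧ cEuler4 ∈ relations`
(equivalently `cFds4 ∧ cHoffman4`).  Candidate chains, all with absolutely convergent rational
intermediates (NO regularisation), taken from the idea cards on this crux and checked for VALUE
consistency by this seat:
* `cFds4` (finite double shuffle `ζ(2)·ζ(2) = 2ζ(2,2) + 4ζ(3,1)` & `= 2ζ(2,2) + ζ(4)`): shuffle half =
  domain additivity of `Δ₂ × Δ₂` into six simplices (rule 1a, null overlaps) + coordinate
  permutations (rule 2); stuffle half = Soudères' cubical identity
  `1/((1−a)(1−b)) = 1/((1−ab)(1−a)) + b/((1−ab)(1−b))` (rule 1b) after the cubical chart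
  `(t₀,t₁,…) ↦ (x₁ = t₀, x₂ = t₁/t₀, …)` (rule 2); both halves share the product representation
  `[Δ₂ × Δ₂, ω₀₁ ⊗ ω₀₁]` (KZProduct.prod), so `cFds4` never needs the value `ζ(2)²`.
* `cHoffman4` (Hoffman `ζ(4) = ζ(3,1) + ζ(2,2)`): card two-posets-interior-landen — Kaneko–Yamamoto
  integral-series identity with `k = (1)`, `l = (1,2)`: the order polytope `{a<b<c>d}` dissects
  into `2[ζ(3,1)] + [ζ(2,2)]` (rule 1a), its forest chart gives `[□⁴, v/((1−vpq)(1−vr))]`, the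
  interior Landen step `E′ : [□³, v/((1−yv)(1−vs))] ~ [□³, 1/((1−yv)(1−yvr))]` (both sides
  `= 2ζ(3)`: `∫ log²(1−v)/v` and `2∫ log t·log(1−t)/t`, checked by hand here) is claimed to be four
  moves (fibrewise Möbius involution `φ_y(t) = (1−t)/(1−yt)` + two positive partial fractions),
  and `1/((1−Y)(1−xY)) = Y/((1−Y)(1−xY)) + 1/(1−xY)` returns `[ζ(3,1)] + [ζ(4)]`.
  Card cube-avatars-ayoub-stokes proposes instead single Newton–Leibniz moves on cube avatars.
Obstruction recorded by gen 1 (finite model, kit j004895): finite double shuffle + duality span only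
2 of the 3 kernel dimensions at weight 4 — `cEuler4`/`cHoffman4` is NOT in the FDS+duality span, so
at least one chain beyond products-and-dissections (Landen-type or Stokes-type) is necessary. -/

section NearMisses

/-- The product representation `[Δ₂ × Δ₂, ω₀₁ ⊗ ω₀₁]` of `ζ(2)·ζ(2)` (KZProduct; dimension `2 + 2`). -/
def P22 : KZ.IntegralRep 4 := (wordRep ω2 1 adm_ω2).prod (wordRep ω2 1 adm_ω2)

theorem value_P22 : P22.value = (Real.pi ^ 2 / 6) ^ 2 := by
  rw [P22, KZ.IntegralRep.value_prod, value_ω2]; ring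

/-- FINER TYPED TARGET (shuffle half of `cFds4`): `[Δ₂×Δ₂, ω₀₁⊗ω₀₁] − [Δ₄, 2ω₀₁₀₁] − [Δ₄, 4ω₀₀₁₁]`
(`ζ(2)² = 2ζ(2,2) + 4ζ(3,1)`): a DISSECTION of `Δ₂ × Δ₂` into the six shuffle cells (rule 1a, the
ties `xᵢ = xⱼ` are null) followed by six coordinate permutations (`KZ.permRel ⊆ rule 2`) and
integrand additivity to merge equal words.  Entirely inside products-and-dissections. -/
def cShuffle4 : KZ.FormalRep :=
  KZ.of P22 - KZ.of (wordRep ω22 2 adm_ω22) - KZ.of (wordRep ω31 4 adm_ω31)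

/-- FINER TYPED TARGET (stuffle half of `cFds4`): `[Δ₂×Δ₂, ω₀₁⊗ω₀₁] − [Δ₄, 2ω₀₁₀₁] − [Δ₄, ω₀₀₀₁]`
(`ζ(2)² = 2ζ(2,2) + ζ(4)`): cubical charts `(t₀,t₁) ↦ (x₁,x₂) = (t₀, t₁/t₀)` (rule 2) turn the
three word reps into `[□⁴, ·]` with kernels `1/(1−x₁x₂)`-type, and Soudères' identity
`1/((1−a)(1−b)) = 1/((1−ab)(1−a)) + b/((1−ab)(1−b))` (rule 1b, all terms positive and convergent)
does the stuffle; the diagonal term is `ζ(4)` after one more monomial chart. -/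
def cStuffle4 : KZ.FormalRep :=
  KZ.of P22 - KZ.of (wordRep ω22 2 adm_ω22) - KZ.of (wordRep ω4 1 adm_ω4)

theorem eval_cShuffle4 : KZ.eval cShuffle4 = 0 := by
  rw [cShuffle4, map_sub, map_sub, KZ.eval_of, KZ.eval_of, KZ.eval_of, value_P22,
    value_wordRep ω22 2, value_wordRep ω31 4, value_ω22, value_ω31]
  ring

theorem eval_cStuffle4 : KZ.eval cStuffle4 = 0 := by
  rw [cStuffle4, map_sub, map_sub, KZ.eval_of, KZ.eval_of, KZ.eval_of, value_P22,
    value_wordRep ω22 2, value_ω22, value_ω4]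
  ring

/-- `cFds4 = cShuffle4 − cStuffle4`: the finite double shuffle element never needs the VALUE
`ζ(2)²`, only the common product representation. -/
theorem cFds4_eq_cShuffle4_sub_cStuffle4 : cFds4 = cShuffle4 - cStuffle4 := by
  simp only [cFds4, cShuffle4, cStuffle4]; abel

theorem cFds4_mem_relations_of (hsh : cShuffle4 ∈ KZ.relations) (hst : cStuffle4 ∈ KZ.relations) :
    cFds4 ∈ KZ.relations := by
  rw [cFds4_eq_cShuffle4_sub_cStuffle4]
  exact sub_mem hsh hst






end NearMisses

/-! ## §8 (cycle 3) THE STUFFLE `ζ(2)² = 2ζ(2,2) + ζ(4)` IS A MOVE CHAIN — near-miss of §7 CLOSED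

Cubical chart of `Δ₄` (det `x₀³x₁²x₂`, polynomial bijection `(0,1)⁴ → Δ₄`), product chart of
`Δ₂ × Δ₂` (det `x₀x₂`), Soudères' partial fractions as two integrand additivities, a block swap;
landed as `Theorems/MzvKernelInKZ/Negative/CubicalChart.lean`, `StuffleFour.lean`. -/

section StuffleChain
/-! ## The open cube and the cubical chart `x ↦ (x₀, x₀x₁, x₀x₁x₂, x₀x₁x₂x₃)` -/

/-- The open unit cube `(0,1)⁴`. [folklore] -/
abbrev cube4 : Set (Fin 4 → ℝ) := openUnitCube 4

theorem mem_cube4 {x : Fin 4 → ℝ} : x ∈ cube4 ↔ ∀ i, 0 < x i ∧ x i < 1 := by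
  simp [mem_openUnitCube_iff]

/-- The cubical chart of the simplex `Δ₄`. [folklore] -/
def cubMap (x : Fin 4 → ℝ) : Fin 4 → ℝ :=
  ![x 0, x 0 * x 1, x 0 * x 1 * x 2, x 0 * x 1 * x 2 * x 3]

@[simp] theorem cubMap_zero (x : Fin 4 → ℝ) : cubMap x 0 = x 0 := rfl
@[simp] theorem cubMap_one (x : Fin 4 → ℝ) : cubMap x 1 = x 0 * x 1 := rfl
@[simp] theorem cubMap_two (x : Fin 4 → ℝ) : cubMap x 2 = x 0 * x 1 * x 2 := rfl
@[simp] theorem cubMap_three (x : Fin 4 → ℝ) : cubMap x 3 = x 0 * x 1 * x 2 * x 3 := rfl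

/-- The Jacobian matrix of the cubical chart. [folklore] -/
def cubJac (x : Fin 4 → ℝ) : Matrix (Fin 4) (Fin 4) ℝ :=
  !![1, 0, 0, 0;
     x 1, x 0, 0, 0;
     x 1 * x 2, x 0 * x 2, x 0 * x 1, 0;
     x 1 * x 2 * x 3, x 0 * x 2 * x 3, x 0 * x 1 * x 3, x 0 * x 1 * x 2]

/-- The derivative of the cubical chart, as a continuous linear map. [folklore] -/
def cubDeriv (x : Fin 4 → ℝ) : (Fin 4 → ℝ) →L[ℝ] (Fin 4 → ℝ) :=
  LinearMap.toContinuousLinearMap (Matrix.toLin' (cubJac x))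

theorem cubDeriv_apply (x v : Fin 4 → ℝ) : cubDeriv x v = (cubJac x).mulVec v := rfl

theorem det_cubJac (x : Fin 4 → ℝ) : (cubJac x).det = x 0 ^ 3 * x 1 ^ 2 * x 2 := by
  simp [cubJac, Matrix.det_succ_row_zero, Fin.sum_univ_succ]
  ring

theorem det_cubDeriv (x : Fin 4 → ℝ) : (cubDeriv x).det = x 0 ^ 3 * x 1 ^ 2 * x 2 := by
  rw [← det_cubJac]
  exact LinearMap.det_toLin' _

/-- Coordinate projections are differentiable with derivative the projection. -/
theorem hasFDerivAt_coord (i : Fin 4) (x : Fin 4 → ℝ) :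
    HasFDerivAt (fun y : Fin 4 → ℝ => y i)
      (ContinuousLinearMap.proj (R := ℝ) (φ := fun _ : Fin 4 => ℝ) i) x :=
  hasFDerivAt_apply i x

theorem hasFDerivAt_cubMap (x : Fin 4 → ℝ) : HasFDerivAt cubMap (cubDeriv x) x := by
  have h0 := hasFDerivAt_coord 0 x
  have h1 := hasFDerivAt_coord 1 x
  have h2 := hasFDerivAt_coord 2 x
  have h3 := hasFDerivAt_coord 3 x
  have c0 : HasFDerivAt (fun y : Fin 4 → ℝ => cubMap y 0)
      ((ContinuousLinearMap.proj 0).comp (cubDeriv x)) x := by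
    refine h0.congr_fderiv ?_
    ext v
    simp [cubDeriv_apply, cubJac, dotProduct, Fin.sum_univ_four]
  have c1 : HasFDerivAt (fun y : Fin 4 → ℝ => cubMap y 1)
      ((ContinuousLinearMap.proj 1).comp (cubDeriv x)) x := by
    refine (h0.mul h1).congr_fderiv ?_
    ext v
    simp [cubDeriv_apply, cubJac, dotProduct, Fin.sum_univ_four]
    ring
  have c2 : HasFDerivAt (fun y : Fin 4 → ℝ => cubMap y 2)
      ((ContinuousLinearMap.proj 2).comp (cubDeriv x)) x := by
    refine ((h0.mul h1).mul h2).congr_fderiv ?_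
    ext v
    simp [cubDeriv_apply, cubJac, dotProduct, Fin.sum_univ_four]
    ring
  have c3 : HasFDerivAt (fun y : Fin 4 → ℝ => cubMap y 3)
      ((ContinuousLinearMap.proj 3).comp (cubDeriv x)) x := by
    refine (((h0.mul h1).mul h2).mul h3).congr_fderiv ?_
    ext v
    simp [cubDeriv_apply, cubJac, dotProduct, Fin.sum_univ_four]
    ring
  rw [hasFDerivAt_pi']
  intro i
  fin_cases i
  · exact c0
  · exact c1
  · exact c2
  · exact c3

theorem injOn_cubMap : InjOn cubMap cube4 := by
  intro x hx y hy h
  rw [mem_cube4] at hx hy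
  have e0 : x 0 = y 0 := by simpa using congrFun h 0
  have e1' : x 0 * x 1 = y 0 * y 1 := by simpa using congrFun h 1
  have e2' : x 0 * x 1 * x 2 = y 0 * y 1 * y 2 := by simpa using congrFun h 2
  have e3' : x 0 * x 1 * x 2 * x 3 = y 0 * y 1 * y 2 * y 3 := by simpa using congrFun h 3
  have hx0 := (hx 0).1; have hx1 := (hx 1).1; have hx2 := (hx 2).1
  have e1 : x 1 = y 1 := by
    rw [e0] at e1'
    exact mul_left_cancel₀ (hy 0).1.ne' e1'
  have e2 : x 2 = y 2 := by
    rw [e0, e1] at e2'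
    exact mul_left_cancel₀ (mul_pos (hy 0).1 (hy 1).1).ne' e2'
  have e3 : x 3 = y 3 := by
    rw [e0, e1, e2] at e3'
    exact mul_left_cancel₀ (mul_pos (mul_pos (hy 0).1 (hy 1).1) (hy 2).1).ne' e3'
  funext i
  fin_cases i <;> assumption

theorem cubMap_mem_simplex {x : Fin 4 → ℝ} (hx : x ∈ cube4) : cubMap x ∈ simplex 4 := by
  rw [mem_cube4] at hx
  obtain ⟨h0, h0'⟩ := hx 0
  obtain ⟨h1, h1'⟩ := hx 1
  obtain ⟨h2, h2'⟩ := hx 2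
  obtain ⟨h3, h3'⟩ := hx 3
  have p01 : 0 < x 0 * x 1 := mul_pos h0 h1
  have p012 : 0 < x 0 * x 1 * x 2 := mul_pos p01 h2
  have p0123 : 0 < x 0 * x 1 * x 2 * x 3 := mul_pos p012 h3
  refine ⟨fun i => ?_, fun i => ?_, ?_⟩
  · fin_cases i <;> simp [p01, p012, p0123, h0]
  · fin_cases i
    · simpa using h0'
    · simpa using mul_lt_one_of_nonneg_of_lt_one_left h0.le h0' h1'.le
    · simpa using mul_lt_one_of_nonneg_of_lt_one_left p01.le
        (mul_lt_one_of_nonneg_of_lt_one_left h0.le h0' h1'.le) h2'.le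
    · simpa using mul_lt_one_of_nonneg_of_lt_one_left p012.le
        (mul_lt_one_of_nonneg_of_lt_one_left p01.le
          (mul_lt_one_of_nonneg_of_lt_one_left h0.le h0' h1'.le) h2'.le) h3'.le
  · -- strictly decreasing
    rw [Fin.strictAnti_iff_succ_lt]  -- hypothetical name; fixed below if wrong
    intro i
    fin_cases i
    · simpa using mul_lt_of_lt_one_right h0 h1'
    · simpa using mul_lt_of_lt_one_right p01 h2'
    · simpa using mul_lt_of_lt_one_right p012 h3'

/-- The inverse chart (successive quotients). -/
def cubInv (t : Fin 4 → ℝ) : Fin 4 → ℝ := ![t 0, t 1 / t 0, t 2 / t 1, t 3 / t 2]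

theorem cubMap_cubInv {t : Fin 4 → ℝ} (ht : t ∈ simplex 4) : cubMap (cubInv t) = t := by
  obtain ⟨h0, -, -⟩ := ht
  have t0 := (h0 0).ne'; have t1 := (h0 1).ne'; have t2 := (h0 2).ne'
  funext i
  fin_cases i <;> simp [cubMap, cubInv] <;> field_simp

theorem cubInv_mem_cube {t : Fin 4 → ℝ} (ht : t ∈ simplex 4) : cubInv t ∈ cube4 := by
  obtain ⟨h0, h1, ha⟩ := ht
  rw [mem_cube4]
  have d10 : t 1 < t 0 := ha (by decide : (0 : Fin 4) < 1)
  have d21 : t 2 < t 1 := ha (by decide : (1 : Fin 4) < 2)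
  have d32 : t 3 < t 2 := ha (by decide : (2 : Fin 4) < 3)
  intro i
  fin_cases i
  · simpa [cubInv] using ⟨h0 0, h1 0⟩
  · simp only [cubInv]
    exact ⟨by simpa using div_pos (h0 1) (h0 0), by simpa using (div_lt_one (h0 0)).mpr d10⟩
  · simp only [cubInv]
    exact ⟨by simpa using div_pos (h0 2) (h0 1), by simpa using (div_lt_one (h0 1)).mpr d21⟩
  · simp only [cubInv]
    exact ⟨by simpa using div_pos (h0 3) (h0 2), by simpa using (div_lt_one (h0 2)).mpr d32⟩

theorem image_cubMap : cubMap '' cube4 = simplex 4 := by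
  apply Subset.antisymm
  · rintro _ ⟨x, hx, rfl⟩
    exact cubMap_mem_simplex hx
  · intro t ht
    exact ⟨cubInv t, cubInv_mem_cube ht, cubMap_cubInv ht⟩

/-- The cubical chart is a polynomial map over `ℚ`, hence `ℚ`-semialgebraic on the cube. -/
theorem isSemialgebraicMapOn_cubMap : IsSemialgebraicMapOn ℚ cube4 cubMap := by
  have h := isSemialgebraicMapOn_aeval (isSemialgebraic_openUnitCube (d := 4))
    (![X 0, X 0 * X 1, X 0 * X 1 * X 2, X 0 * X 1 * X 2 * X 3] : Fin 4 → MvPolynomial (Fin 4) ℚ)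
  refine h.congr fun x _ => ?_
  funext j
  fin_cases j <;> simp [cubMap]


/-! ## The word integrands pulled back to the cube -/

theorem wordFun_ω4 (t : Fin 4 → ℝ) :
    wordFun ω4 1 t = 1 / t 0 * (1 / t 1) * (1 / t 2) * (1 / (1 - t 3)) := by
  simp [wordFun, ω4, Fin.prod_univ_four]

theorem wordFun_ω22 (t : Fin 4 → ℝ) :
    wordFun ω22 1 t = 1 / t 0 * (1 / (1 - t 1)) * (1 / t 2) * (1 / (1 - t 3)) := by
  simp [wordFun, ω22, Fin.prod_univ_four]

theorem wordFun_ω2 (t : Fin 2 → ℝ) : wordFun ω2 1 t = 1 / t 0 * (1 / (1 - t 1)) := by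
  simp [wordFun, ω2, Fin.prod_univ_two]

/-- Positivity facts on the cube. -/
theorem cube_facts {x : Fin 4 → ℝ} (hx : x ∈ cube4) :
    0 < x 0 ∧ 0 < x 1 ∧ 0 < x 2 ∧ 0 < x 3 ∧ x 0 < 1 ∧ x 1 < 1 ∧ x 2 < 1 ∧ x 3 < 1 ∧
      x 0 * x 1 < 1 ∧ x 2 * x 3 < 1 ∧ x 0 * x 1 * x 2 * x 3 < 1 := by
  rw [mem_cube4] at hx
  obtain ⟨h0, h0'⟩ := hx 0
  obtain ⟨h1, h1'⟩ := hx 1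
  obtain ⟨h2, h2'⟩ := hx 2
  obtain ⟨h3, h3'⟩ := hx 3
  have p01 : x 0 * x 1 < 1 := mul_lt_one_of_nonneg_of_lt_one_left h0.le h0' h1'.le
  have p23 : x 2 * x 3 < 1 := mul_lt_one_of_nonneg_of_lt_one_left h2.le h2' h3'.le
  have p0123 : x 0 * x 1 * x 2 * x 3 < 1 := by
    have := mul_lt_one_of_nonneg_of_lt_one_left (mul_pos h0 h1).le p01 p23.le
    linarith [show x 0 * x 1 * x 2 * x 3 = x 0 * x 1 * (x 2 * x 3) by ring]
  exact ⟨h0, h1, h2, h3, h0', h1', h2', h3', p01, p23, p0123⟩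

/-- The cube integrand of `ζ(4)`: `1/(1 − x₀x₁x₂x₃)`. -/
def f4 (x : Fin 4 → ℝ) : ℝ := 1 / (1 - x 0 * x 1 * x 2 * x 3)

/-- The cube integrand of `ζ(2,2)`: `x₀x₁/((1 − x₀x₁)(1 − x₀x₁x₂x₃))`. -/
def f22 (x : Fin 4 → ℝ) : ℝ := x 0 * x 1 / ((1 - x 0 * x 1) * (1 - x 0 * x 1 * x 2 * x 3))

/-- The cube integrand of `ζ(2)²`: `1/((1 − x₀x₁)(1 − x₂x₃))`. -/
def fprod (x : Fin 4 → ℝ) : ℝ := 1 / ((1 - x 0 * x 1) * (1 - x 2 * x 3))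

/-- PULLBACK IDENTITY for `ζ(4)`. -/
theorem f4_eq {x : Fin 4 → ℝ} (hx : x ∈ cube4) :
    f4 x = wordFun ω4 1 (cubMap x) * |(cubDeriv x).det| := by
  obtain ⟨h0, h1, h2, h3, -, -, -, -, -, -, p⟩ := cube_facts hx
  rw [det_cubDeriv, abs_of_pos (by positivity), wordFun_ω4]
  simp only [cubMap_zero, cubMap_one, cubMap_two, cubMap_three, f4]
  have : (1 : ℝ) - x 0 * x 1 * x 2 * x 3 ≠ 0 := by linarith
  field_simp

/-- PULLBACK IDENTITY for `ζ(2,2)`. -/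
theorem f22_eq {x : Fin 4 → ℝ} (hx : x ∈ cube4) :
    f22 x = wordFun ω22 1 (cubMap x) * |(cubDeriv x).det| := by
  obtain ⟨h0, h1, h2, h3, -, -, -, -, p01, -, p⟩ := cube_facts hx
  rw [det_cubDeriv, abs_of_pos (by positivity), wordFun_ω22]
  simp only [cubMap_zero, cubMap_one, cubMap_two, cubMap_three, f22]
  have : (1 : ℝ) - x 0 * x 1 * x 2 * x 3 ≠ 0 := by linarith
  have : (1 : ℝ) - x 0 * x 1 ≠ 0 := by linarith
  field_simp

/-- Semialgebraicity of the three cube integrands (quotients of `ℚ`-polynomials with denominators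
positive on the cube). -/
theorem isSemialgebraicFunOn_f4 : IsSemialgebraicFunOn ℚ cube4 f4 := by
  refine (isSemialgebraicFunOn_aeval_div_aeval (isSemialgebraic_openUnitCube (d := 4))
    (1 : MvPolynomial (Fin 4) ℚ) (1 - X 0 * X 1 * X 2 * X 3) fun x hx => ?_).congr fun x hx => ?_
  · obtain ⟨-, -, -, -, -, -, -, -, -, -, p⟩ := cube_facts hx
    simp only [map_sub, map_one, map_mul, aeval_X]
    linarith
  · simp [f4]

theorem isSemialgebraicFunOn_f22 : IsSemialgebraicFunOn ℚ cube4 f22 := by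
  refine (isSemialgebraicFunOn_aeval_div_aeval (isSemialgebraic_openUnitCube (d := 4))
    (X 0 * X 1 : MvPolynomial (Fin 4) ℚ) ((1 - X 0 * X 1) * (1 - X 0 * X 1 * X 2 * X 3))
    fun x hx => ?_).congr fun x hx => ?_
  · obtain ⟨-, -, -, -, -, -, -, -, p01, -, p⟩ := cube_facts hx
    simp only [map_sub, map_one, map_mul, aeval_X]
    exact mul_ne_zero (by linarith) (by linarith)
  · simp [f22]

theorem isSemialgebraicFunOn_fprod : IsSemialgebraicFunOn ℚ cube4 fprod := by
  refine (isSemialgebraicFunOn_aeval_div_aeval (isSemialgebraic_openUnitCube (d := 4))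
    (1 : MvPolynomial (Fin 4) ℚ) ((1 - X 0 * X 1) * (1 - X 2 * X 3))
    fun x hx => ?_).congr fun x hx => ?_
  · obtain ⟨-, -, -, -, -, -, -, -, p01, p23, -⟩ := cube_facts hx
    simp only [map_sub, map_one, map_mul, aeval_X]
    exact mul_ne_zero (by linarith) (by linarith)
  · simp [fprod]

theorem measurableSet_cube4 : MeasurableSet cube4 := (isOpen_openUnitCube (d := 4)).measurableSet

/-- Integrability of the pulled-back integrands, transported from the simplex through the chart
(`integrableOn_image_iff_integrableOn_abs_det_fderiv_smul`). -/
theorem integrableOn_f4 : IntegrableOn f4 cube4 volume := by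
  have h := (integrableOn_image_iff_integrableOn_abs_det_fderiv_smul volume measurableSet_cube4
    (fun x _ => (hasFDerivAt_cubMap x).hasFDerivWithinAt) injOn_cubMap (wordFun ω4 1)).mp
    (by rw [image_cubMap]; exact integrableOn_wordFun adm_ω4 1)
  refine h.congr_fun (fun x hx => ?_) measurableSet_cube4
  dsimp only
  rw [smul_eq_mul, mul_comm, ← f4_eq hx]

theorem integrableOn_f22 : IntegrableOn f22 cube4 volume := by
  have h := (integrableOn_image_iff_integrableOn_abs_det_fderiv_smul volume measurableSet_cube4
    (fun x _ => (hasFDerivAt_cubMap x).hasFDerivWithinAt) injOn_cubMap (wordFun ω22 1)).mp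
    (by rw [image_cubMap]; exact integrableOn_wordFun adm_ω22 1)
  refine h.congr_fun (fun x hx => ?_) measurableSet_cube4
  dsimp only
  rw [smul_eq_mul, mul_comm, ← f22_eq hx]

/-- The cube representation of `ζ(4)`. -/
def C4 : KZ.IntegralRep 4 :=
  ⟨cube4, f4, isSemialgebraic_openUnitCube, isSemialgebraicFunOn_f4, integrableOn_f4⟩

/-- The cube representation of `ζ(2,2)`. -/
def C22 : KZ.IntegralRep 4 :=
  ⟨cube4, f22, isSemialgebraic_openUnitCube, isSemialgebraicFunOn_f22, integrableOn_f22⟩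

/-- **`[□⁴, 1/(1−abcd)] − [Δ₄, ω₀₀₀₁]` is ONE change-of-variables move** (the cubical chart). -/
theorem C4_sub_mem_changeOfVariablesRel :
    KZ.of C4 - KZ.of (wordRep ω4 1 adm_ω4) ∈ KZ.changeOfVariablesRel :=
  ⟨4, C4, wordRep ω4 1 adm_ω4, cubMap, fun x => cubDeriv x, isSemialgebraicMapOn_cubMap,
    fun x _ => (hasFDerivAt_cubMap x).hasFDerivWithinAt, injOn_cubMap, image_cubMap.symm,
    fun _ hx => f4_eq hx, rfl⟩

/-- **`[□⁴, ab/((1−ab)(1−abcd))] − [Δ₄, ω₀₁₀₁]` is ONE change-of-variables move.** -/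
theorem C22_sub_mem_changeOfVariablesRel :
    KZ.of C22 - KZ.of (wordRep ω22 1 adm_ω22) ∈ KZ.changeOfVariablesRel :=
  ⟨4, C22, wordRep ω22 1 adm_ω22, cubMap, fun x => cubDeriv x, isSemialgebraicMapOn_cubMap,
    fun x _ => (hasFDerivAt_cubMap x).hasFDerivWithinAt, injOn_cubMap, image_cubMap.symm,
    fun _ hx => f22_eq hx, rfl⟩


/-! ## The product chart `x ↦ (x₀, x₀x₁, x₂, x₂x₃)` : `□⁴ → Δ₂ × Δ₂` -/

/-- The product of the cubical charts of two `Δ₂`'s. -/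
def prodMap (x : Fin 4 → ℝ) : Fin 4 → ℝ := ![x 0, x 0 * x 1, x 2, x 2 * x 3]

@[simp] theorem prodMap_zero (x : Fin 4 → ℝ) : prodMap x 0 = x 0 := rfl
@[simp] theorem prodMap_one (x : Fin 4 → ℝ) : prodMap x 1 = x 0 * x 1 := rfl
@[simp] theorem prodMap_two (x : Fin 4 → ℝ) : prodMap x 2 = x 2 := rfl
@[simp] theorem prodMap_three (x : Fin 4 → ℝ) : prodMap x 3 = x 2 * x 3 := rfl

/-- Its Jacobian matrix. -/
def prodJac (x : Fin 4 → ℝ) : Matrix (Fin 4) (Fin 4) ℝ :=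
  !![1, 0, 0, 0;
     x 1, x 0, 0, 0;
     0, 0, 1, 0;
     0, 0, x 3, x 2]

/-- Its derivative. -/
def prodDeriv (x : Fin 4 → ℝ) : (Fin 4 → ℝ) →L[ℝ] (Fin 4 → ℝ) :=
  LinearMap.toContinuousLinearMap (Matrix.toLin' (prodJac x))

theorem prodDeriv_apply (x v : Fin 4 → ℝ) : prodDeriv x v = (prodJac x).mulVec v := rfl

theorem det_prodJac (x : Fin 4 → ℝ) : (prodJac x).det = x 0 * x 2 := by
  simp [prodJac, Matrix.det_succ_row_zero, Fin.sum_univ_succ]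

theorem det_prodDeriv (x : Fin 4 → ℝ) : (prodDeriv x).det = x 0 * x 2 := by
  rw [← det_prodJac]
  exact LinearMap.det_toLin' _

theorem hasFDerivAt_prodMap (x : Fin 4 → ℝ) : HasFDerivAt prodMap (prodDeriv x) x := by
  have h0 := hasFDerivAt_coord 0 x
  have h1 := hasFDerivAt_coord 1 x
  have h2 := hasFDerivAt_coord 2 x
  have h3 := hasFDerivAt_coord 3 x
  have c0 : HasFDerivAt (fun y : Fin 4 → ℝ => prodMap y 0)
      ((ContinuousLinearMap.proj 0).comp (prodDeriv x)) x := by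
    refine h0.congr_fderiv ?_
    ext v
    simp [prodDeriv_apply, prodJac, dotProduct, Fin.sum_univ_four]
  have c1 : HasFDerivAt (fun y : Fin 4 → ℝ => prodMap y 1)
      ((ContinuousLinearMap.proj 1).comp (prodDeriv x)) x := by
    refine (h0.mul h1).congr_fderiv ?_
    ext v
    simp [prodDeriv_apply, prodJac, dotProduct, Fin.sum_univ_four]
    ring
  have c2 : HasFDerivAt (fun y : Fin 4 → ℝ => prodMap y 2)
      ((ContinuousLinearMap.proj 2).comp (prodDeriv x)) x := by
    refine h2.congr_fderiv ?_
    ext v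
    simp [prodDeriv_apply, prodJac, dotProduct, Fin.sum_univ_four]
  have c3 : HasFDerivAt (fun y : Fin 4 → ℝ => prodMap y 3)
      ((ContinuousLinearMap.proj 3).comp (prodDeriv x)) x := by
    refine (h2.mul h3).congr_fderiv ?_
    ext v
    simp [prodDeriv_apply, prodJac, dotProduct, Fin.sum_univ_four]
    ring
  rw [hasFDerivAt_pi']
  intro i
  fin_cases i
  · exact c0
  · exact c1
  · exact c2
  · exact c3

theorem injOn_prodMap : InjOn prodMap cube4 := by
  intro x hx y hy h
  rw [mem_cube4] at hx hy
  have e0 : x 0 = y 0 := by simpa using congrFun h 0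
  have e1' : x 0 * x 1 = y 0 * y 1 := by simpa using congrFun h 1
  have e2 : x 2 = y 2 := by simpa using congrFun h 2
  have e3' : x 2 * x 3 = y 2 * y 3 := by simpa using congrFun h 3
  have e1 : x 1 = y 1 := by
    rw [e0] at e1'
    exact mul_left_cancel₀ (hy 0).1.ne' e1'
  have e3 : x 3 = y 3 := by
    rw [e2] at e3'
    exact mul_left_cancel₀ (hy 2).1.ne' e3'
  funext i
  fin_cases i <;> assumption

/-- Membership in `Δ₂`, coordinatewise. -/
theorem mem_simplex_two {t : Fin 2 → ℝ} :
    t ∈ simplex 2 ↔ 0 < t 0 ∧ 0 < t 1 ∧ t 0 < 1 ∧ t 1 < 1 ∧ t 1 < t 0 := by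
  simp only [simplex, mem_setOf_eq, Fin.forall_fin_two, Fin.strictAnti_iff_succ_lt,
    Fin.forall_fin_one]
  constructor
  · rintro ⟨⟨a, b⟩, ⟨c, d⟩, e⟩
    exact ⟨a, b, c, d, by simpa using e⟩
  · rintro ⟨a, b, c, d, e⟩
    exact ⟨⟨a, b⟩, ⟨c, d⟩, by simpa using e⟩


theorem P22_domain : P22.domain =
    KZ.IntegralRep.prodDomain (wordRep ω2 1 adm_ω2) (wordRep ω2 1 adm_ω2) := rfl

theorem P22_integrand : P22.integrand =
    KZ.IntegralRep.prodFun (wordRep ω2 1 adm_ω2) (wordRep ω2 1 adm_ω2) :=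
  KZ.IntegralRep.prod_integrand_eq _ _

theorem mem_P22_domain {z : Fin 4 → ℝ} :
    z ∈ P22.domain ↔ (0 < z 0 ∧ 0 < z 1 ∧ z 0 < 1 ∧ z 1 < 1 ∧ z 1 < z 0) ∧
      (0 < z 2 ∧ 0 < z 3 ∧ z 2 < 1 ∧ z 3 < 1 ∧ z 3 < z 2) := by
  rw [P22_domain, KZ.IntegralRep.mem_prodDomain, wordRep_domain, mem_simplex_two, mem_simplex_two]
  simp [Fin.natAdd, Fin.castAdd]

theorem P22_integrand_apply (z : Fin 4 → ℝ) :
    P22.integrand z = 1 / z 0 * (1 / (1 - z 1)) * (1 / z 2 * (1 / (1 - z 3))) := by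
  rw [P22_integrand, KZ.IntegralRep.prodFun_apply, wordRep_integrand, wordFun_ω2, wordFun_ω2]
  simp [Fin.natAdd, Fin.castAdd]

theorem prodMap_mem_P22_domain {x : Fin 4 → ℝ} (hx : x ∈ cube4) : prodMap x ∈ P22.domain := by
  obtain ⟨h0, h1, h2, h3, h0', h1', h2', h3', p01, p23, -⟩ := cube_facts hx
  rw [mem_P22_domain]
  simp only [prodMap_zero, prodMap_one, prodMap_two, prodMap_three]
  exact ⟨⟨h0, mul_pos h0 h1, h0', p01, mul_lt_of_lt_one_right h0 h1'⟩,
    ⟨h2, mul_pos h2 h3, h2', p23, mul_lt_of_lt_one_right h2 h3'⟩⟩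

/-- The inverse of the product chart. -/
def prodInv (z : Fin 4 → ℝ) : Fin 4 → ℝ := ![z 0, z 1 / z 0, z 2, z 3 / z 2]

theorem prodMap_prodInv {z : Fin 4 → ℝ} (hz : z ∈ P22.domain) : prodMap (prodInv z) = z := by
  rw [mem_P22_domain] at hz
  have z0 := hz.1.1.ne'; have z2 := hz.2.1.ne'
  funext i
  fin_cases i <;> simp [prodMap, prodInv] <;> field_simp

theorem prodInv_mem_cube {z : Fin 4 → ℝ} (hz : z ∈ P22.domain) : prodInv z ∈ cube4 := by
  rw [mem_P22_domain] at hz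
  obtain ⟨⟨a0, a1, a0', -, a10⟩, ⟨b0, b1, b0', -, b10⟩⟩ := hz
  rw [mem_cube4]
  intro i
  fin_cases i
  · simpa [prodInv] using ⟨a0, a0'⟩
  · simp only [prodInv]
    exact ⟨by simpa using div_pos a1 a0, by simpa using (div_lt_one a0).mpr a10⟩
  · simpa [prodInv] using ⟨b0, b0'⟩
  · simp only [prodInv]
    exact ⟨by simpa using div_pos b1 b0, by simpa using (div_lt_one b0).mpr b10⟩

theorem image_prodMap : prodMap '' cube4 = P22.domain := by
  apply Subset.antisymm
  · rintro _ ⟨x, hx, rfl⟩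
    exact prodMap_mem_P22_domain hx
  · intro z hz
    exact ⟨prodInv z, prodInv_mem_cube hz, prodMap_prodInv hz⟩

theorem isSemialgebraicMapOn_prodMap : IsSemialgebraicMapOn ℚ cube4 prodMap := by
  have h := isSemialgebraicMapOn_aeval (isSemialgebraic_openUnitCube (d := 4))
    (![X 0, X 0 * X 1, X 2, X 2 * X 3] : Fin 4 → MvPolynomial (Fin 4) ℚ)
  refine h.congr fun x _ => ?_
  funext j
  fin_cases j <;> simp [prodMap]

/-- PULLBACK IDENTITY for the product. -/
theorem fprod_eq {x : Fin 4 → ℝ} (hx : x ∈ cube4) :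
    fprod x = P22.integrand (prodMap x) * |(prodDeriv x).det| := by
  obtain ⟨h0, h1, h2, h3, -, -, -, -, p01, p23, -⟩ := cube_facts hx
  rw [det_prodDeriv, abs_of_pos (by positivity), P22_integrand_apply]
  simp only [prodMap_zero, prodMap_one, prodMap_two, prodMap_three, fprod]
  have : (1 : ℝ) - x 0 * x 1 ≠ 0 := by linarith
  have : (1 : ℝ) - x 2 * x 3 ≠ 0 := by linarith
  field_simp

theorem integrableOn_fprod : IntegrableOn fprod cube4 volume := by
  have hP : IntegrableOn P22.integrand (prodMap '' cube4) volume := by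
    rw [image_prodMap]; exact P22.integrableOn
  have h := (integrableOn_image_iff_integrableOn_abs_det_fderiv_smul volume measurableSet_cube4
    (fun x _ => (hasFDerivAt_prodMap x).hasFDerivWithinAt) injOn_prodMap P22.integrand).mp hP
  refine h.congr_fun (fun x hx => ?_) measurableSet_cube4
  dsimp only
  rw [smul_eq_mul, mul_comm, ← fprod_eq hx]

/-- The cube representation of `ζ(2)²`. -/
def Cprod : KZ.IntegralRep 4 :=
  ⟨cube4, fprod, isSemialgebraic_openUnitCube, isSemialgebraicFunOn_fprod, integrableOn_fprod⟩

/-- **`[□⁴, 1/((1−ab)(1−cd))] − [Δ₂ × Δ₂, ω₀₁ ⊗ ω₀₁]` is ONE change-of-variables move.** -/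
theorem Cprod_sub_P22_mem_changeOfVariablesRel :
    KZ.of Cprod - KZ.of P22 ∈ KZ.changeOfVariablesRel :=
  ⟨4, Cprod, P22, prodMap, fun x => prodDeriv x, isSemialgebraicMapOn_prodMap,
    fun x _ => (hasFDerivAt_prodMap x).hasFDerivWithinAt, injOn_prodMap, image_prodMap.symm,
    fun _ hx => fprod_eq hx, rfl⟩

/-! ## Soudères' partial fractions on the cube: two integrand-additivity moves -/

/-- The block swap `(a,b,c,d) ↦ (c,d,a,b)` of the coordinates. -/
def blockSwap : Equiv.Perm (Fin 4) := Equiv.swap 0 2 * Equiv.swap 1 3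

@[simp] theorem blockSwap_zero : blockSwap 0 = 2 := by decide
@[simp] theorem blockSwap_one : blockSwap 1 = 3 := by decide
@[simp] theorem blockSwap_two : blockSwap 2 = 0 := by decide
@[simp] theorem blockSwap_three : blockSwap 3 = 1 := by decide

/-- `[□⁴, cd/((1−cd)(1−abcd))]`: the `ζ(2,2)` cube representation with the blocks swapped. -/
def C22r : KZ.IntegralRep 4 := C22.reindex blockSwap

theorem C22r_domain : C22r.domain = cube4 := by
  ext w
  simp only [C22r, KZ.IntegralRep.reindex_domain, mem_setOf_eq]
  change (fun i => w (blockSwap i)) ∈ cube4 ↔ w ∈ cube4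
  rw [mem_cube4, mem_cube4]
  constructor
  · intro h i
    fin_cases i
    · simpa using h 2
    · simpa using h 3
    · simpa using h 0
    · simpa using h 1
  · intro h i
    fin_cases i
    · simpa using h 2
    · simpa using h 3
    · simpa using h 0
    · simpa using h 1

theorem C22r_integrand_apply (w : Fin 4 → ℝ) :
    C22r.integrand w = w 2 * w 3 / ((1 - w 2 * w 3) * (1 - w 2 * w 3 * w 0 * w 1)) := by
  simp [C22r, C22, f22]

/-- `[□⁴, 1/(1−abcd) + ab/((1−ab)(1−abcd))]` (the sum of the `ζ(4)` and `ζ(2,2)` integrands). -/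
def Csum : KZ.IntegralRep 4 :=
  ⟨cube4, f4 + f22, isSemialgebraic_openUnitCube,
    IsSemialgebraicFunOn.add_holds isSemialgebraicFunOn_f4 isSemialgebraicFunOn_f22,
    integrableOn_f4.add integrableOn_f22⟩

/-- **Soudères' identity, first half**: `1/((1−ab)(1−cd)) = [1/(1−abcd) + ab/((1−ab)(1−abcd))] +
cd/((1−cd)(1−abcd))` on the cube — ONE integrand-additivity move. -/
theorem Cprod_sub_Csum_sub_C22r_mem : KZ.of Cprod - KZ.of Csum - KZ.of C22r ∈ KZ.integrandAddRel := by
  refine ⟨4, Cprod, Csum, C22r, rfl, C22r_domain, fun x hx => ?_, rfl⟩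
  obtain ⟨h0, h1, h2, h3, -, -, -, -, p01, p23, p⟩ := cube_facts hx
  have e1 : (1 : ℝ) - x 0 * x 1 ≠ 0 := by linarith
  have e2 : (1 : ℝ) - x 2 * x 3 ≠ 0 := by linarith
  have e3 : (1 : ℝ) - x 0 * x 1 * x 2 * x 3 ≠ 0 := by linarith
  have e4 : (1 : ℝ) - x 2 * x 3 * x 0 * x 1 ≠ 0 := by linarith
  change fprod x = (f4 x + f22 x) + C22r.integrand x
  rw [C22r_integrand_apply]
  simp only [fprod, f4, f22]
  field_simp
  ring

/-- **Second half**: `1/(1−abcd) + ab/((1−ab)(1−abcd))` splits — ONE integrand-additivity move. -/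
theorem Csum_sub_C4_sub_C22_mem : KZ.of Csum - KZ.of C4 - KZ.of C22 ∈ KZ.integrandAddRel :=
  ⟨4, Csum, C4, C22, rfl, rfl, fun _ _ => rfl, rfl⟩

/-- The block swap is a coordinate permutation, hence a relation. -/
theorem C22_sub_C22r_mem : KZ.of C22 - KZ.of C22r ∈ KZ.relations :=
  KZ.of_sub_of_reindex_mem_relations C22 blockSwap

/-! ## Assembly: the stuffle `ζ(2)² = 2ζ(2,2) + ζ(4)` as a move chain -/


/-- **THE STUFFLE AT WEIGHT 4 IS A MOVE CHAIN** with absolutely convergent rational intermediates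
(three changes of variables, two integrand additivities, one coordinate permutation, bookkeeping):
`cStuffle4 ∈ KZ.relations`. -/
theorem cStuffle4_mem_relations : cStuffle4 ∈ KZ.relations := by
  have h1 := KZ.changeOfVariablesRel_subset_relations Cprod_sub_P22_mem_changeOfVariablesRel
  have h2 := KZ.integrandAddRel_subset_relations Cprod_sub_Csum_sub_C22r_mem
  have h3 := KZ.integrandAddRel_subset_relations Csum_sub_C4_sub_C22_mem
  have h4 := C22_sub_C22r_mem
  have h5 := KZ.changeOfVariablesRel_subset_relations C4_sub_mem_changeOfVariablesRel
  have h6 := KZ.changeOfVariablesRel_subset_relations C22_sub_mem_changeOfVariablesRel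
  have h7 := of_wordRep_add ω22 1 1 adm_ω22
  norm_num at h7
  have : cStuffle4 = -(KZ.of Cprod - KZ.of P22) + (KZ.of Cprod - KZ.of Csum - KZ.of C22r)
      + (KZ.of Csum - KZ.of C4 - KZ.of C22) - (KZ.of C22 - KZ.of C22r)
      + (KZ.of C4 - KZ.of (wordRep ω4 1 adm_ω4))
      + (KZ.of C22 - KZ.of (wordRep ω22 1 adm_ω22)) + (KZ.of C22 - KZ.of (wordRep ω22 1 adm_ω22))
      - (KZ.of (wordRep ω22 2 adm_ω22) - KZ.of (wordRep ω22 1 adm_ω22)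
          - KZ.of (wordRep ω22 1 adm_ω22)) := by
    simp only [cStuffle4]; abel
  rw [this]
  refine sub_mem (add_mem (add_mem (add_mem (sub_mem (add_mem (add_mem (neg_mem h1) h2) h3) h4)
    h5) h6) h6) h7


end StuffleChain

/-! ## §9 (cycle 3) THE SHUFFLE `ζ(2)² = 2ζ(2,2) + 4ζ(3,1)` AND `ζ(4) = 4ζ(3,1)` ARE MOVE CHAINS

Six-cell dissection of `Δ₂ × Δ₂` by rule (1a) with disjoint pieces, null remainder in four
hyperplanes, each cell a word representation up to a coordinate permutation; `cFds4 = shuffle −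
stuffle`.  The crux's named "first test" PASSES; route Grothendieck item 0275 follows (evidence
attached there).  Landed as `Negative/ShuffleCells.lean`, `Negative/ShuffleFour.lean`. -/

section ShuffleChain
/-! ## The shuffle `ζ(2)² = 2ζ(2,2) + 4ζ(3,1)`: dissection of `Δ₂ × Δ₂` into six cells -/


theorem wordFun_ω31 (t : Fin 4 → ℝ) :
    wordFun ω31 1 t = 1 / t 0 * (1 / t 1) * (1 / (1 - t 2)) * (1 / (1 - t 3)) := by
  simp [wordFun, ω31, Fin.prod_univ_four]

/-- Membership in `Δ₄`, coordinatewise. -/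
theorem mem_simplex_four {t : Fin 4 → ℝ} :
    t ∈ simplex 4 ↔ (0 < t 0 ∧ 0 < t 1 ∧ 0 < t 2 ∧ 0 < t 3) ∧ (t 0 < 1 ∧ t 1 < 1 ∧ t 2 < 1 ∧ t 3 < 1) ∧
      (t 1 < t 0 ∧ t 2 < t 1 ∧ t 3 < t 2) := by
  simp only [simplex, mem_setOf_eq, Fin.forall_fin_succ, Fin.strictAnti_iff_succ_lt,
    IsEmpty.forall_iff, and_true]
  simp

/-- An open cell of the dissection: `P22.domain` cut by three strict inequalities
`z (a 1) < z (a 0)`, `z (a 2) < z (a 1)`, `z (a 3) < z (a 2)` (the chain `z ∘ a` decreasing). -/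
def cell (a : Fin 4 → Fin 4) : Set (Fin 4 → ℝ) :=
  P22.domain ∩ {z | z (a 1) < z (a 0) ∧ z (a 2) < z (a 1) ∧ z (a 3) < z (a 2)}

theorem cell_subset (a : Fin 4 → Fin 4) : cell a ⊆ P22.domain := inter_subset_left

theorem isSemialgebraic_setOf_lt (i j : Fin 4) :
    IsSemialgebraic ℚ {z : Fin 4 → ℝ | z j < z i} := by
  convert Literature.ModelTheory.ExponentialFields.isSemialgebraic_setOf_eval_pos (R := ℝ)
    (X i - X j : MvPolynomial (Fin 4) ℚ) using 1
  ext z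
  simp [sub_pos]

theorem isSemialgebraic_cell (a : Fin 4 → Fin 4) : IsSemialgebraic ℚ (cell a) := by
  refine P22.isSemialgebraic_domain.inter ?_
  have : {z : Fin 4 → ℝ | z (a 1) < z (a 0) ∧ z (a 2) < z (a 1) ∧ z (a 3) < z (a 2)} =
      {z | z (a 1) < z (a 0)} ∩ {z | z (a 2) < z (a 1)} ∩ {z | z (a 3) < z (a 2)} := by
    ext z; simp [and_assoc]
  rw [this]
  exact ((isSemialgebraic_setOf_lt _ _).inter (isSemialgebraic_setOf_lt _ _)).inter
    (isSemialgebraic_setOf_lt _ _)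

/-- The restriction of the product representation to a cell. -/
def cellRep (a : Fin 4 → Fin 4) : KZ.IntegralRep 4 :=
  P22.restrict (cell a) (isSemialgebraic_cell a) (cell_subset a)

/-- **A cell is a word representation up to a coordinate permutation** (generic transfer lemma):
if reindexing by `e` carries the cell onto `Δ₄` and the product integrand onto the word form of
`ε`, then `[cell, ω⊗ω] ≡ [Δ₄, ω_ε]`. -/
theorem cellRep_equiv (a : Fin 4 → Fin 4) (e : Equiv.Perm (Fin 4)) (ε : Fin 4 → Bool) (hε : Adm ε)
    (hdom : {w : Fin 4 → ℝ | (fun i => w (e i)) ∈ cell a} = simplex 4)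
    (hint : ∀ w ∈ simplex 4, P22.integrand (fun i => w (e i)) = wordFun ε 1 w) :
    KZ.of (cellRep a) - KZ.of (wordRep ε 1 hε) ∈ KZ.relations := by
  have h1 := KZ.of_sub_of_reindex_mem_relations (cellRep a) e
  have h2 : KZ.of ((cellRep a).reindex e) - KZ.of (wordRep ε 1 hε) ∈ KZ.relations := by
    refine of_sub_of_mem_relations_of_eqOn ?_ ?_
    · rw [wordRep_domain, KZ.IntegralRep.reindex_domain]
      exact hdom.symm
    · intro w hw
      rw [KZ.IntegralRep.reindex_domain] at hw
      change (fun i => w (e i)) ∈ cell a at hw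
      have hw' : w ∈ simplex 4 := by rw [← hdom]; exact hw
      simp only [KZ.IntegralRep.reindex_integrand, wordRep_integrand]
      exact hint w hw'
  have : KZ.of (cellRep a) - KZ.of (wordRep ε 1 hε) =
      (KZ.of (cellRep a) - KZ.of ((cellRep a).reindex e)) +
        (KZ.of ((cellRep a).reindex e) - KZ.of (wordRep ε 1 hε)) := by abel
  rw [this]
  exact add_mem h1 h2

/-- Membership in a cell, unfolded. -/
theorem mem_cell {a : Fin 4 → Fin 4} {z : Fin 4 → ℝ} :
    z ∈ cell a ↔ z ∈ P22.domain ∧ z (a 1) < z (a 0) ∧ z (a 2) < z (a 1) ∧ z (a 3) < z (a 2) :=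
  Iff.rfl

/-! ### The six cells -/

/-- The six orders `a` (the coordinates listed decreasingly) and the sorting permutations `e`
(`e i` = position of `zᵢ`), as pairs `(a, e)` with `a ∘ e = id`. -/
def aA : Fin 4 → Fin 4 := ![0, 1, 2, 3]
def aB : Fin 4 → Fin 4 := ![0, 2, 1, 3]
def aC : Fin 4 → Fin 4 := ![0, 2, 3, 1]
def aD : Fin 4 → Fin 4 := ![2, 0, 1, 3]
def aE : Fin 4 → Fin 4 := ![2, 0, 3, 1]
def aF : Fin 4 → Fin 4 := ![2, 3, 0, 1]

/-- Generic: reindexing by the permutation `e` with `w (e i) = zᵢ`, i.e. `z = w ∘ e`, where `a` lists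
the coordinates decreasingly and `e = a⁻¹`, carries the cell onto the simplex. We prove it for each
cell by unfolding. -/
theorem cell_dom (a : Fin 4 → Fin 4) (e : Equiv.Perm (Fin 4)) (h0 : e (a 0) = 0) (h1 : e (a 1) = 1)
    (h2 : e (a 2) = 2) (h3 : e (a 3) = 3)
    (hP : ∀ w : Fin 4 → ℝ, w ∈ simplex 4 →  (fun i => w (e i)) ∈ P22.domain)
    (hP' : ∀ w : Fin 4 → ℝ, (fun i => w (e i)) ∈ P22.domain →
      (∀ i, 0 < w i) ∧ (∀ i, w i < 1)) :
    {w : Fin 4 → ℝ | (fun i => w (e i)) ∈ cell a} = simplex 4 := by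
  ext w
  simp only [mem_setOf_eq, mem_cell, h0, h1, h2, h3]
  constructor
  · rintro ⟨hP0, c1, c2, c3⟩
    obtain ⟨hp, hl⟩ := hP' w hP0
    refine ⟨hp, hl, ?_⟩
    rw [Fin.strictAnti_iff_succ_lt]
    intro i
    fin_cases i
    · simpa using c1
    · simpa using c2
    · simpa using c3
  · intro hw
    refine ⟨hP w hw, ?_⟩
    obtain ⟨-, -, c1, c2, c3⟩ := mem_simplex_four.mp hw
    exact ⟨c1, c2, c3⟩


/-- The sorting permutations (`e = a⁻¹`). -/
def eA : Equiv.Perm (Fin 4) := Equiv.refl _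
def eB : Equiv.Perm (Fin 4) := ⟨![0, 2, 1, 3], ![0, 2, 1, 3], by decide, by decide⟩
def eC : Equiv.Perm (Fin 4) := ⟨![0, 3, 1, 2], ![0, 2, 3, 1], by decide, by decide⟩
def eD : Equiv.Perm (Fin 4) := ⟨![1, 2, 0, 3], ![2, 0, 1, 3], by decide, by decide⟩
def eE : Equiv.Perm (Fin 4) := ⟨![1, 3, 0, 2], ![2, 0, 3, 1], by decide, by decide⟩
def eF : Equiv.Perm (Fin 4) := ⟨![2, 3, 0, 1], ![2, 3, 0, 1], by decide, by decide⟩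

theorem dom_A : {w : Fin 4 → ℝ | (fun i => w (eA i)) ∈ cell aA} = simplex 4 := by
  refine cell_dom aA eA (by decide) (by decide) (by decide) (by decide) (fun w hw => ?_) (fun w hw => ?_)
  · obtain ⟨⟨p0, p1, p2, p3⟩, ⟨l0, l1, l2, l3⟩, c1, c2, c3⟩ := mem_simplex_four.mp hw
    rw [mem_P22_domain]
    simp only [eA, Equiv.refl_apply]
    exact ⟨⟨p0, p1, l0, l1, c1⟩, ⟨p2, p3, l2, l3, c3⟩⟩
  · rw [mem_P22_domain] at hw
    simp only [eA, Equiv.refl_apply] at hw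
    obtain ⟨⟨p0, p1, l0, l1, -⟩, ⟨p2, p3, l2, l3, -⟩⟩ := hw
    refine ⟨fun i => ?_, fun i => ?_⟩ <;> fin_cases i <;> assumption

theorem dom_B : {w : Fin 4 → ℝ | (fun i => w (eB i)) ∈ cell aB} = simplex 4 := by
  refine cell_dom aB eB (by decide) (by decide) (by decide) (by decide) (fun w hw => ?_) (fun w hw => ?_)
  · obtain ⟨⟨p0, p1, p2, p3⟩, ⟨l0, l1, l2, l3⟩, c1, c2, c3⟩ := mem_simplex_four.mp hw
    rw [mem_P22_domain]
    simp [eB]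
    exact ⟨⟨p0, p2, l0, l2, by linarith⟩, ⟨p1, p3, l1, l3, by linarith⟩⟩
  · rw [mem_P22_domain] at hw
    simp [eB] at hw
    obtain ⟨⟨p0, p2, l0, l2, -⟩, ⟨p1, p3, l1, l3, -⟩⟩ := hw
    refine ⟨fun i => ?_, fun i => ?_⟩ <;> fin_cases i <;> assumption

theorem dom_C : {w : Fin 4 → ℝ | (fun i => w (eC i)) ∈ cell aC} = simplex 4 := by
  refine cell_dom aC eC (by decide) (by decide) (by decide) (by decide) (fun w hw => ?_) (fun w hw => ?_)
  · obtain ⟨⟨p0, p1, p2, p3⟩, ⟨l0, l1, l2, l3⟩, c1, c2, c3⟩ := mem_simplex_four.mp hw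
    rw [mem_P22_domain]
    simp [eC]
    exact ⟨⟨p0, p3, l0, l3, by linarith⟩, ⟨p1, p2, l1, l2, by linarith⟩⟩
  · rw [mem_P22_domain] at hw
    simp [eC] at hw
    obtain ⟨⟨p0, p3, l0, l3, -⟩, ⟨p1, p2, l1, l2, -⟩⟩ := hw
    refine ⟨fun i => ?_, fun i => ?_⟩ <;> fin_cases i <;> assumption

theorem dom_D : {w : Fin 4 → ℝ | (fun i => w (eD i)) ∈ cell aD} = simplex 4 := by
  refine cell_dom aD eD (by decide) (by decide) (by decide) (by decide) (fun w hw => ?_) (fun w hw => ?_)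
  · obtain ⟨⟨p0, p1, p2, p3⟩, ⟨l0, l1, l2, l3⟩, c1, c2, c3⟩ := mem_simplex_four.mp hw
    rw [mem_P22_domain]
    simp [eD]
    exact ⟨⟨p1, p2, l1, l2, by linarith⟩, ⟨p0, p3, l0, l3, by linarith⟩⟩
  · rw [mem_P22_domain] at hw
    simp [eD] at hw
    obtain ⟨⟨p1, p2, l1, l2, -⟩, ⟨p0, p3, l0, l3, -⟩⟩ := hw
    refine ⟨fun i => ?_, fun i => ?_⟩ <;> fin_cases i <;> assumption

theorem dom_E : {w : Fin 4 → ℝ | (fun i => w (eE i)) ∈ cell aE} = simplex 4 := by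
  refine cell_dom aE eE (by decide) (by decide) (by decide) (by decide) (fun w hw => ?_) (fun w hw => ?_)
  · obtain ⟨⟨p0, p1, p2, p3⟩, ⟨l0, l1, l2, l3⟩, c1, c2, c3⟩ := mem_simplex_four.mp hw
    rw [mem_P22_domain]
    simp [eE]
    exact ⟨⟨p1, p3, l1, l3, by linarith⟩, ⟨p0, p2, l0, l2, by linarith⟩⟩
  · rw [mem_P22_domain] at hw
    simp [eE] at hw
    obtain ⟨⟨p1, p3, l1, l3, -⟩, ⟨p0, p2, l0, l2, -⟩⟩ := hw
    refine ⟨fun i => ?_, fun i => ?_⟩ <;> fin_cases i <;> assumption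

theorem dom_F : {w : Fin 4 → ℝ | (fun i => w (eF i)) ∈ cell aF} = simplex 4 := by
  refine cell_dom aF eF (by decide) (by decide) (by decide) (by decide) (fun w hw => ?_) (fun w hw => ?_)
  · obtain ⟨⟨p0, p1, p2, p3⟩, ⟨l0, l1, l2, l3⟩, c1, c2, c3⟩ := mem_simplex_four.mp hw
    rw [mem_P22_domain]
    simp [eF]
    exact ⟨⟨p2, p3, l2, l3, by linarith⟩, ⟨p0, p1, l0, l1, by linarith⟩⟩
  · rw [mem_P22_domain] at hw
    simp [eF] at hw
    obtain ⟨⟨p2, p3, l2, l3, -⟩, ⟨p0, p1, l0, l1, -⟩⟩ := hw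
    refine ⟨fun i => ?_, fun i => ?_⟩ <;> fin_cases i <;> assumption

/-- The six cells are word representations: `A, F ≡ [Δ₄, ω₀₁₀₁]`, `B, C, D, E ≡ [Δ₄, ω₀₀₁₁]`. -/
theorem cellA_equiv : KZ.of (cellRep aA) - KZ.of (wordRep ω22 1 adm_ω22) ∈ KZ.relations :=
  cellRep_equiv aA eA ω22 adm_ω22 dom_A fun w _ => by
    simp [P22_integrand_apply, wordFun_ω22, eA]; ring

theorem cellB_equiv : KZ.of (cellRep aB) - KZ.of (wordRep ω31 1 adm_ω31) ∈ KZ.relations :=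
  cellRep_equiv aB eB ω31 adm_ω31 dom_B fun w _ => by
    simp [P22_integrand_apply, wordFun_ω31, eB]; ring

theorem cellC_equiv : KZ.of (cellRep aC) - KZ.of (wordRep ω31 1 adm_ω31) ∈ KZ.relations :=
  cellRep_equiv aC eC ω31 adm_ω31 dom_C fun w _ => by
    simp [P22_integrand_apply, wordFun_ω31, eC]; ring

theorem cellD_equiv : KZ.of (cellRep aD) - KZ.of (wordRep ω31 1 adm_ω31) ∈ KZ.relations :=
  cellRep_equiv aD eD ω31 adm_ω31 dom_D fun w _ => by
    simp [P22_integrand_apply, wordFun_ω31, eD]; ring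

theorem cellE_equiv : KZ.of (cellRep aE) - KZ.of (wordRep ω31 1 adm_ω31) ∈ KZ.relations :=
  cellRep_equiv aE eE ω31 adm_ω31 dom_E fun w _ => by
    simp [P22_integrand_apply, wordFun_ω31, eE]; ring

theorem cellF_equiv : KZ.of (cellRep aF) - KZ.of (wordRep ω22 1 adm_ω22) ∈ KZ.relations :=
  cellRep_equiv aF eF ω22 adm_ω22 dom_F fun w _ => by
    simp [P22_integrand_apply, wordFun_ω22, eF]; ring


/-! ### Peeling the six cells off `Δ₂ × Δ₂` (rule 1a, disjoint pieces), the remainder is null -/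

/-- One peeling step: for a semialgebraic `T ⊆ P22.domain` and a cell `cell a ⊆ T`,
`[T] − [cell a] − [T ∖ cell a]` is a domain-additivity move. -/
theorem peel {T : Set (Fin 4 → ℝ)} (hT : IsSemialgebraic ℚ T) (hTD : T ⊆ P22.domain)
    (a : Fin 4 → Fin 4) (ha : cell a ⊆ T) :
    KZ.of (P22.restrict T hT hTD) - KZ.of (cellRep a) -
      KZ.of (P22.restrict (T \ cell a) (hT.diff (isSemialgebraic_cell a)) (Set.sdiff_subset.trans hTD)) ∈
      KZ.domainAddRel := by
  refine ⟨4, P22.restrict T hT hTD, cellRep a, P22.restrict (T \ cell a) (hT.diff (isSemialgebraic_cell a))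
    (Set.sdiff_subset.trans hTD), ?_, ?_, fun _ _ => rfl, fun _ _ => rfl, rfl⟩
  · change T = cell a ∪ (T \ cell a)
    rw [Set.union_sdiff_cancel ha]
  · change volume (cell a ∩ (T \ cell a)) = 0
    rw [Set.inter_sdiff_self, measure_empty]

/-- The remainders. -/
def T1 : Set (Fin 4 → ℝ) := P22.domain \ cell aA
def T2 : Set (Fin 4 → ℝ) := T1 \ cell aB
def T3 : Set (Fin 4 → ℝ) := T2 \ cell aC
def T4 : Set (Fin 4 → ℝ) := T3 \ cell aD
def T5 : Set (Fin 4 → ℝ) := T4 \ cell aE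
def T6 : Set (Fin 4 → ℝ) := T5 \ cell aF

theorem sa_T1 : IsSemialgebraic ℚ T1 := P22.isSemialgebraic_domain.diff (isSemialgebraic_cell _)
theorem sa_T2 : IsSemialgebraic ℚ T2 := sa_T1.diff (isSemialgebraic_cell _)
theorem sa_T3 : IsSemialgebraic ℚ T3 := sa_T2.diff (isSemialgebraic_cell _)
theorem sa_T4 : IsSemialgebraic ℚ T4 := sa_T3.diff (isSemialgebraic_cell _)
theorem sa_T5 : IsSemialgebraic ℚ T5 := sa_T4.diff (isSemialgebraic_cell _)
theorem sa_T6 : IsSemialgebraic ℚ T6 := sa_T5.diff (isSemialgebraic_cell _)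

theorem T1_sub : T1 ⊆ P22.domain := Set.sdiff_subset
theorem T2_sub : T2 ⊆ P22.domain := Set.sdiff_subset.trans T1_sub
theorem T3_sub : T3 ⊆ P22.domain := Set.sdiff_subset.trans T2_sub
theorem T4_sub : T4 ⊆ P22.domain := Set.sdiff_subset.trans T3_sub
theorem T5_sub : T5 ⊆ P22.domain := Set.sdiff_subset.trans T4_sub
theorem T6_sub : T6 ⊆ P22.domain := Set.sdiff_subset.trans T5_sub

/-- Unfolded cell memberships. -/
theorem mem_cellA {z : Fin 4 → ℝ} : z ∈ cell aA ↔ z ∈ P22.domain ∧ z 1 < z 0 ∧ z 2 < z 1 ∧ z 3 < z 2 := by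
  simp [mem_cell, aA]
theorem mem_cellB {z : Fin 4 → ℝ} : z ∈ cell aB ↔ z ∈ P22.domain ∧ z 2 < z 0 ∧ z 1 < z 2 ∧ z 3 < z 1 := by
  simp [mem_cell, aB]
theorem mem_cellC {z : Fin 4 → ℝ} : z ∈ cell aC ↔ z ∈ P22.domain ∧ z 2 < z 0 ∧ z 3 < z 2 ∧ z 1 < z 3 := by
  simp [mem_cell, aC]
theorem mem_cellD {z : Fin 4 → ℝ} : z ∈ cell aD ↔ z ∈ P22.domain ∧ z 0 < z 2 ∧ z 1 < z 0 ∧ z 3 < z 1 := by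
  simp [mem_cell, aD]
theorem mem_cellE {z : Fin 4 → ℝ} : z ∈ cell aE ↔ z ∈ P22.domain ∧ z 0 < z 2 ∧ z 3 < z 0 ∧ z 1 < z 3 := by
  simp [mem_cell, aE]
theorem mem_cellF {z : Fin 4 → ℝ} : z ∈ cell aF ↔ z ∈ P22.domain ∧ z 3 < z 2 ∧ z 0 < z 3 ∧ z 1 < z 0 := by
  simp [mem_cell, aF]

theorem cellB_sub_T1 : cell aB ⊆ T1 := by
  intro z hz
  obtain ⟨hD, b1, b2, b3⟩ := mem_cellB.mp hz
  refine ⟨hD, fun hA => ?_⟩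
  obtain ⟨-, a1, a2, a3⟩ := mem_cellA.mp hA
  linarith

theorem cellC_sub_T2 : cell aC ⊆ T2 := by
  intro z hz
  obtain ⟨hD, c1, c2, c3⟩ := mem_cellC.mp hz
  refine ⟨⟨hD, fun hA => ?_⟩, fun hB => ?_⟩
  · obtain ⟨-, a1, a2, a3⟩ := mem_cellA.mp hA; linarith
  · obtain ⟨-, b1, b2, b3⟩ := mem_cellB.mp hB; linarith

theorem cellD_sub_T3 : cell aD ⊆ T3 := by
  intro z hz
  obtain ⟨hD, d1, d2, d3⟩ := mem_cellD.mp hz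
  refine ⟨⟨⟨hD, fun hA => ?_⟩, fun hB => ?_⟩, fun hC => ?_⟩
  · obtain ⟨-, a1, a2, a3⟩ := mem_cellA.mp hA; linarith
  · obtain ⟨-, b1, b2, b3⟩ := mem_cellB.mp hB; linarith
  · obtain ⟨-, c1, c2, c3⟩ := mem_cellC.mp hC; linarith

theorem cellE_sub_T4 : cell aE ⊆ T4 := by
  intro z hz
  obtain ⟨hD, e1, e2, e3⟩ := mem_cellE.mp hz
  refine ⟨⟨⟨⟨hD, fun hA => ?_⟩, fun hB => ?_⟩, fun hC => ?_⟩, fun hD' => ?_⟩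
  · obtain ⟨-, a1, a2, a3⟩ := mem_cellA.mp hA; linarith
  · obtain ⟨-, b1, b2, b3⟩ := mem_cellB.mp hB; linarith
  · obtain ⟨-, c1, c2, c3⟩ := mem_cellC.mp hC; linarith
  · obtain ⟨-, d1, d2, d3⟩ := mem_cellD.mp hD'; linarith

theorem cellF_sub_T5 : cell aF ⊆ T5 := by
  intro z hz
  obtain ⟨hD, f1, f2, f3⟩ := mem_cellF.mp hz
  refine ⟨⟨⟨⟨⟨hD, fun hA => ?_⟩, fun hB => ?_⟩, fun hC => ?_⟩, fun hD' => ?_⟩, fun hE => ?_⟩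
  · obtain ⟨-, a1, a2, a3⟩ := mem_cellA.mp hA; linarith
  · obtain ⟨-, b1, b2, b3⟩ := mem_cellB.mp hB; linarith
  · obtain ⟨-, c1, c2, c3⟩ := mem_cellC.mp hC; linarith
  · obtain ⟨-, d1, d2, d3⟩ := mem_cellD.mp hD'; linarith
  · obtain ⟨-, e1, e2, e3⟩ := mem_cellE.mp hE; linarith

/-- The ties (walls) `zᵢ = zⱼ` between the two factors. -/
def walls : Set (Fin 4 → ℝ) := {z | z 1 = z 2} ∪ {z | z 0 = z 2} ∪ {z | z 1 = z 3} ∪ {z | z 0 = z 3}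

/-- **What is left after the six cells is contained in the walls** (trichotomy). -/
theorem T6_subset_walls : T6 ⊆ walls := by
  intro z hz
  obtain ⟨⟨⟨⟨⟨⟨hD, nA⟩, nB⟩, nC⟩, nD⟩, nE⟩, nF⟩ := hz
  obtain ⟨⟨-, -, -, -, h10⟩, ⟨-, -, -, -, h32⟩⟩ := mem_P22_domain.mp hD
  simp only [walls, mem_union, mem_setOf_eq]
  by_contra hw
  simp only [not_or] at hw
  obtain ⟨⟨⟨w12, w02⟩, w13⟩, w03⟩ := hw
  rcases lt_or_gt_of_ne w12 with h12 | h12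
  · -- z1 < z2
    rcases lt_or_gt_of_ne w02 with h02 | h02
    · -- z0 < z2
      rcases lt_or_gt_of_ne w03 with h03 | h03
      · exact nF (mem_cellF.mpr ⟨hD, h32, h03, h10⟩)
      · rcases lt_or_gt_of_ne w13 with h13 | h13
        · exact nE (mem_cellE.mpr ⟨hD, h02, h03, h13⟩)
        · exact nD (mem_cellD.mpr ⟨hD, h02, h10, h13⟩)
    · -- z2 < z0
      rcases lt_or_gt_of_ne w13 with h13 | h13
      · exact nC (mem_cellC.mpr ⟨hD, h02, h32, h13⟩)
      · exact nB (mem_cellB.mpr ⟨hD, h02, h12, h13⟩)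
  · -- z2 < z1
    exact nA (mem_cellA.mpr ⟨hD, h10, h12, h32⟩)

/-- A coordinate hyperplane `zᵢ = zⱼ` (`i ≠ j`) is Lebesgue-null. -/
theorem volume_setOf_eq_zero {i j : Fin 4} (hij : i ≠ j) :
    volume {z : Fin 4 → ℝ | z i = z j} = 0 := by
  let L : (Fin 4 → ℝ) →ₗ[ℝ] ℝ :=
    LinearMap.proj (R := ℝ) (φ := fun _ : Fin 4 => ℝ) i - LinearMap.proj (R := ℝ) (φ := fun _ : Fin 4 => ℝ) j
  have hker : {z : Fin 4 → ℝ | z i = z j} = (LinearMap.ker L : Set (Fin 4 → ℝ)) := by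
    ext z
    simp [L, sub_eq_zero]
  rw [hker]
  refine Measure.addHaar_submodule volume (LinearMap.ker L) ?_
  intro htop
  have hmem : (Pi.single i (1 : ℝ) : Fin 4 → ℝ) ∈ LinearMap.ker L := by rw [htop]; trivial
  have : (Pi.single i (1 : ℝ) : Fin 4 → ℝ) i = (Pi.single i (1 : ℝ) : Fin 4 → ℝ) j := by
    simpa [L, sub_eq_zero] using hmem
  simp [hij.symm] at this

theorem volume_walls : volume walls = 0 := by
  simp only [walls]
  refine measure_union_null (measure_union_null (measure_union_null ?_ ?_) ?_) ?_ <;>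
    exact volume_setOf_eq_zero (by decide)

theorem volume_T6 : volume T6 = 0 := measure_mono_null T6_subset_walls volume_walls

/-- The null remainder is a relation. -/
theorem restrict_T6_mem : KZ.of (P22.restrict T6 sa_T6 T6_sub) ∈ KZ.relations :=
  KZ.levelRel_le_relations (KZ.of_mem_levelRel_of_volume_eq_zero _ volume_T6)

/-! ### Assembly of the shuffle -/


/-- `P22.restrict P22.domain = P22`. -/
theorem restrict_self : P22.restrict P22.domain P22.isSemialgebraic_domain subset_rfl = P22 :=
  KZ.IntegralRep.ext' rfl rfl

/-- **THE SHUFFLE AT WEIGHT 4 IS A MOVE CHAIN** (six domain additivities with disjoint pieces, six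
coordinate permutations, one null remainder, bookkeeping): `cShuffle4 ∈ KZ.relations`. -/
theorem cShuffle4_mem_relations : cShuffle4 ∈ KZ.relations := by
  have p1 := KZ.domainAddRel_subset_relations
    (peel P22.isSemialgebraic_domain subset_rfl aA (cell_subset aA))
  rw [restrict_self] at p1
  have p2 := KZ.domainAddRel_subset_relations (peel sa_T1 T1_sub aB cellB_sub_T1)
  have p3 := KZ.domainAddRel_subset_relations (peel sa_T2 T2_sub aC cellC_sub_T2)
  have p4 := KZ.domainAddRel_subset_relations (peel sa_T3 T3_sub aD cellD_sub_T3)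
  have p5 := KZ.domainAddRel_subset_relations (peel sa_T4 T4_sub aE cellE_sub_T4)
  have p6 := KZ.domainAddRel_subset_relations (peel sa_T5 T5_sub aF cellF_sub_T5)
  have p7 := restrict_T6_mem
  have qA := cellA_equiv
  have qB := cellB_equiv
  have qC := cellC_equiv
  have qD := cellD_equiv
  have qE := cellE_equiv
  have qF := cellF_equiv
  have r22 := of_wordRep_add ω22 1 1 adm_ω22
  have r31a := of_wordRep_add ω31 1 1 adm_ω31
  have r31b := of_wordRep_add ω31 2 2 adm_ω31
  norm_num at r22 r31a r31b
  -- abbreviations for readability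
  set P := KZ.of P22
  set A := KZ.of (cellRep aA); set B := KZ.of (cellRep aB); set C := KZ.of (cellRep aC)
  set D := KZ.of (cellRep aD); set E := KZ.of (cellRep aE); set F := KZ.of (cellRep aF)
  set R1 := KZ.of (P22.restrict T1 sa_T1 T1_sub)
  set R2 := KZ.of (P22.restrict T2 sa_T2 T2_sub)
  set R3 := KZ.of (P22.restrict T3 sa_T3 T3_sub)
  set R4 := KZ.of (P22.restrict T4 sa_T4 T4_sub)
  set R5 := KZ.of (P22.restrict T5 sa_T5 T5_sub)
  set R6 := KZ.of (P22.restrict T6 sa_T6 T6_sub)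
  set W22a := KZ.of (wordRep ω22 1 adm_ω22); set W22b := KZ.of (wordRep ω22 2 adm_ω22)
  set W31a := KZ.of (wordRep ω31 1 adm_ω31); set W31b := KZ.of (wordRep ω31 2 adm_ω31)
  set W31c := KZ.of (wordRep ω31 4 adm_ω31)
  have : cShuffle4 = (P - A - R1) + (R1 - B - R2) + (R2 - C - R3) + (R3 - D - R4) + (R4 - E - R5)
      + (R5 - F - R6) + R6 + (A - W22a) + (B - W31a) + (C - W31a) + (D - W31a) + (E - W31a)
      + (F - W22a) - (W22b - W22a - W22a) - (W31b - W31a - W31a) - (W31b - W31a - W31a)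
      - (W31c - W31b - W31b) := by
    simp only [cShuffle4]; abel
  rw [this]
  exact sub_mem (sub_mem (sub_mem (sub_mem (add_mem (add_mem (add_mem (add_mem (add_mem (add_mem
    (add_mem (add_mem (add_mem (add_mem (add_mem (add_mem p1 p2) p3) p4) p5) p6) p7) qA) qB) qC)
    qD) qE) qF) r22) r31a) r31a) r31b

/-! ## The finite double shuffle `ζ(4) = 4ζ(3,1)` inside the calculus -/


/-- **`ζ(4) = 4ζ(3,1)` IS A MOVE CHAIN**: `cFds4 = cShuffle4 − cStuffle4 ∈ KZ.relations`; the
product representation cancels, so the chain never uses the value `ζ(2)²`. -/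
theorem cFds4_mem_relations : cFds4 ∈ KZ.relations := by
  have : cFds4 = cShuffle4 - cStuffle4 := by
    simp only [cFds4, cShuffle4, cStuffle4]; abel
  rw [this]
  exact sub_mem cShuffle4_mem_relations cStuffle4_mem_relations


end ShuffleChain

/-! ## §10 (cycle 3) EULER'S `3ζ(4) = 4ζ(2,2)` IS A MOVE CHAIN ⇒ THE WEIGHT-4 RUNG HOLDS UNCONDITIONALLY

PROVED in full (attached evidence `EulerCheck.lean`, rc0, 0 sorries, std axioms; landed as
`Negative/{ScalingDivision,HalfAngle,SquareDissection,CalabiTwo,ZetaTwo,DimFourDissection,CalabiPolytope,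
CalabiFourMap,CalabiFourOnto,EulerFour}.lean`): Beukers–Kolk–Calabi made `ℚ`-semialgebraic by the
half-angle parametrisation `t = tan(u/2)` — quarter circle `Q = [(0,1), 2dt/(1+t²)]`;
`Q² ≡ 2·[P₂] ≡ 2·[□², 1/(1−x²y²)]` (reflection `t ↦ (1−t)/(1+t)`, rational Calabi map with Jacobian
`g g (1−x²y²)`); `3·[ζ(2)] ≡ 2·Q²` (split + squaring map); `Q⁴ ≡ 6·[U] ≡ 6·[P₄] ≡ 6·[□⁴, 1/(1−∏xᵢ²)]`
(bottom-pair dissection, double reflection, 4-dim rational Calabi map with BKC's Jacobian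
`∏g·(1−∏xᵢ²)` and inversion formula); `45·[□⁴,1/(1−abcd)] ≡ 8·Q⁴` (split + squaring `1/16`);
ring structure, stuffle (§8), INTEGER DIVISION (derived rule, below) ⇒ `cEuler4 ∈ relations`,
`cHoffman4 ∈ relations`, `WeightKernel 4`.  This work file (size-capped) carries the checked
REDUCTION `cEuler4_mem_relations_of` / `weightKernel_four_of` from the two Calabi identities, and
the integer-division rule. -/

section EulerChain
section Scaling

variable {n : ℕ}

/-- Composition of scalings on a generator. -/
theorem scale_scale_of_sub_mem (a b : ℝ) (ha : IsAlgebraic ℚ a) (hb : IsAlgebraic ℚ b)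
    (r : KZ.IntegralRep n) :
    KZ.scale a ha (KZ.scale b hb (KZ.of r)) - KZ.scale (a * b) (ha.mul hb) (KZ.of r) ∈ KZ.relations := by
  rw [KZ.scale_of, KZ.scale_of, KZ.scale_of]
  exact of_sub_of_mem_relations_of_eqOn rfl fun x _ => by
    simp only [KZ.IntegralRep.integrand_constMul]; ring

/-- A relation-valued identity between additive maps holds everywhere once it holds on generators. -/
theorem sub_mem_relations_of_forall_of (f g : KZ.FormalRep →+ KZ.FormalRep)
    (h : ∀ (k : ℕ) (r : KZ.IntegralRep k), f (KZ.of r) - g (KZ.of r) ∈ KZ.relations) (c : KZ.FormalRep) :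
    f c - g c ∈ KZ.relations := by
  induction c using FreeAbelianGroup.induction_on with
  | zero => simp [KZ.relations.zero_mem]
  | of x => obtain ⟨k, r⟩ := x; exact h k r
  | neg x hx =>
    obtain ⟨k, r⟩ := x
    have := KZ.relations.neg_mem (h k r)
    rw [map_neg, map_neg]
    convert this using 1
    change -f (KZ.of r) - -g (KZ.of r) = _
    abel
  | add x y hx hy =>
    rw [map_add, map_add]
    have : f x + f y - (g x + g y) = (f x - g x) + (f y - g y) := by abel
    rw [this]
    exact add_mem hx hy

/-- `scale a ∘ scale b ≡ scale (ab)` modulo relations. -/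
theorem scale_scale_sub_mem (a b : ℝ) (ha : IsAlgebraic ℚ a) (hb : IsAlgebraic ℚ b) (c : KZ.FormalRep) :
    KZ.scale a ha (KZ.scale b hb c) - KZ.scale (a * b) (ha.mul hb) c ∈ KZ.relations :=
  sub_mem_relations_of_forall_of ((KZ.scale a ha).comp (KZ.scale b hb)) (KZ.scale (a * b) (ha.mul hb))
    (fun _ r => scale_scale_of_sub_mem a b ha hb r) c

/-- `scale (a + b) ≡ scale a + scale b` modulo relations (integrand additivity). -/
theorem scale_add_sub_mem (a b : ℝ) (ha : IsAlgebraic ℚ a) (hb : IsAlgebraic ℚ b) (c : KZ.FormalRep) :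
    KZ.scale (a + b) (ha.add hb) c - (KZ.scale a ha c + KZ.scale b hb c) ∈ KZ.relations := by
  refine sub_mem_relations_of_forall_of (KZ.scale (a + b) (ha.add hb)) (KZ.scale a ha + KZ.scale b hb)
    (fun k r => ?_) c
  simp only [AddMonoidHom.add_apply, KZ.scale_of]
  rw [← sub_sub]
  exact KZ.integrandAddRel_subset_relations ⟨k, r.constMul (a + b) (ha.add hb), r.constMul a ha,
    r.constMul b hb, rfl, rfl, fun x _ => by simp [add_mul], rfl⟩

/-- `scale 1 ≡ id` modulo relations. -/
theorem scale_one_sub_mem (c : KZ.FormalRep) :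
    KZ.scale 1 isAlgebraic_one c - c ∈ KZ.relations := by
  refine sub_mem_relations_of_forall_of (KZ.scale 1 isAlgebraic_one) (AddMonoidHom.id _)
    (fun k r => ?_) c
  simp only [KZ.scale_of, AddMonoidHom.id_apply]
  exact of_sub_of_mem_relations_of_eqOn rfl fun x _ => by simp

/-- `KZ.scale` depends on the constant only (proof irrelevance). -/
theorem scale_congr {a b : ℝ} (ha : IsAlgebraic ℚ a) (hb : IsAlgebraic ℚ b) (h : a = b) (c : KZ.FormalRep) :
    KZ.scale a ha c = KZ.scale b hb c := by
  subst h; rfl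

/-- Natural numbers are algebraic. -/
theorem isAlgebraic_natCast (n : ℕ) : IsAlgebraic ℚ (n : ℝ) := isAlgebraic_nat n

/-- `scale n ≡ n • ·` modulo relations. -/
theorem scale_nat_sub_nsmul_mem (n : ℕ) (c : KZ.FormalRep) :
    KZ.scale (n : ℝ) (isAlgebraic_natCast n) c - n • c ∈ KZ.relations := by
  induction n with
  | zero =>
    rw [zero_smul, sub_zero]
    have h0 := sub_mem_relations_of_forall_of (KZ.scale ((0 : ℕ) : ℝ) (isAlgebraic_natCast 0)) 0
      (fun k r => ?_) c
    · simpa using h0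
    · simp only [KZ.scale_of, AddMonoidHom.zero_apply, sub_zero]
      exact of_mem_relations_of_eqOn_zero _ fun x _ => by simp
  | succ m ih =>
    have h1 := scale_add_sub_mem (m : ℝ) 1 (isAlgebraic_natCast m) isAlgebraic_one c
    have h2 := scale_one_sub_mem c
    have e : KZ.scale ((m : ℝ) + 1) ((isAlgebraic_natCast m).add isAlgebraic_one) c =
        KZ.scale ((m + 1 : ℕ) : ℝ) (isAlgebraic_natCast (m + 1)) c :=
      scale_congr _ _ (by push_cast; rfl) c
    rw [e] at h1
    have : KZ.scale ((m + 1 : ℕ) : ℝ) (isAlgebraic_natCast (m + 1)) c - (m + 1) • c =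
        (KZ.scale ((m + 1 : ℕ) : ℝ) (isAlgebraic_natCast (m + 1)) c -
          (KZ.scale (m : ℝ) (isAlgebraic_natCast m) c + KZ.scale 1 isAlgebraic_one c)) +
        (KZ.scale (m : ℝ) (isAlgebraic_natCast m) c - m • c) + (KZ.scale 1 isAlgebraic_one c - c) := by
      rw [add_smul, one_smul]; abel
    rw [this]
    exact add_mem (add_mem h1 ih) h2

/-- **INTEGER DIVISION is a derived rule of the calculus**: `n • c ∈ relations → c ∈ relations`
(`0 < n`).  Proof: `c ≡ scale 1 c = scale (n⁻¹ · n) c ≡ scale n⁻¹ (scale n c) ≡ scale n⁻¹ (n • c)`,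
and `scale` preserves relations. (Route FurushoPentagon files this as item `IntegerDivision`,
stmt-3934.) -/
theorem mem_relations_of_nsmul_mem {n : ℕ} (hn : 0 < n) {c : KZ.FormalRep}
    (h : n • c ∈ KZ.relations) : c ∈ KZ.relations := by
  have hn' : (n : ℝ) ≠ 0 := by exact_mod_cast hn.ne'
  have hinv : IsAlgebraic ℚ ((n : ℝ)⁻¹) := (isAlgebraic_natCast n).inv
  have h1 := scale_one_sub_mem c
  have h2 := scale_scale_sub_mem ((n : ℝ)⁻¹) (n : ℝ) hinv (isAlgebraic_natCast n) c
  have e : KZ.scale ((n : ℝ)⁻¹ * n) (hinv.mul (isAlgebraic_natCast n)) c = KZ.scale 1 isAlgebraic_one c :=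
    scale_congr _ _ (inv_mul_cancel₀ hn') c
  rw [e] at h2
  have h3 : KZ.scale ((n : ℝ)⁻¹) hinv (KZ.scale (n : ℝ) (isAlgebraic_natCast n) c - n • c) ∈ KZ.relations :=
    KZ.scale_mem_relations _ _ (scale_nat_sub_nsmul_mem n c)
  have h4 : KZ.scale ((n : ℝ)⁻¹) hinv (n • c) ∈ KZ.relations := KZ.scale_mem_relations _ _ h
  rw [map_sub] at h3
  have : c = -(KZ.scale 1 isAlgebraic_one c - c) +
      (-(KZ.scale ((n : ℝ)⁻¹) hinv (KZ.scale (n : ℝ) (isAlgebraic_natCast n) c) - KZ.scale 1 isAlgebraic_one c)) +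
      (KZ.scale ((n : ℝ)⁻¹) hinv (KZ.scale (n : ℝ) (isAlgebraic_natCast n) c) -
        KZ.scale ((n : ℝ)⁻¹) hinv (n • c)) + KZ.scale ((n : ℝ)⁻¹) hinv (n • c) := by abel
  rw [this]
  exact add_mem (add_mem (add_mem (neg_mem h1) (neg_mem h2)) h3) h4

/-- Scaling a generator by a natural number is `n` copies, modulo relations. -/
theorem of_constMul_nat_sub_nsmul_mem {k : ℕ} (n : ℕ) (r : KZ.IntegralRep k) :
    KZ.of (r.constMul (n : ℝ) (isAlgebraic_natCast n)) - n • KZ.of r ∈ KZ.relations := by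
  simpa using scale_nat_sub_nsmul_mem n (KZ.of r)

end Scaling

/-- `du/dt` in the half-angle parameter `t = tan(u/2)`: `2/(1+t²)`. -/
def gq (t : ℝ) : ℝ := 2 / (1 + t ^ 2)

theorem one_add_sq_pos (t : ℝ) : 0 < 1 + t ^ 2 := by positivity
theorem one_add_sq_ne (t : ℝ) : 1 + t ^ 2 ≠ 0 := (one_add_sq_pos t).ne'

/-- The open interval `(0,1) ⊆ ℝ¹`. -/
abbrev cube1 : Set (Fin 1 → ℝ) := openUnitCube 1

theorem mem_cube1 {x : Fin 1 → ℝ} : x ∈ cube1 ↔ 0 < x 0 ∧ x 0 < 1 := by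
  simp [mem_openUnitCube_iff, Fin.forall_fin_one]

/-- **The quarter circle** `Q = [(0,1), 2dt/(1+t²)]` (value `π/2`; only `Q²`, `Q⁴` are used). -/
def Qrep : KZ.IntegralRep 1 where
  domain := cube1
  integrand x := gq (x 0)
  isSemialgebraic_domain := isSemialgebraic_openUnitCube
  isSemialgebraicFunOn_integrand := by
    refine (isSemialgebraicFunOn_aeval_div_aeval (isSemialgebraic_openUnitCube (d := 1))
      (C 2 : MvPolynomial (Fin 1) ℚ) (1 + X 0 ^ 2) fun x _ => ?_).congr fun x _ => ?_
    · simp only [map_add, map_one, map_pow, aeval_X]; exact one_add_sq_ne _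
    · simp [gq]
  integrableOn := by
    have hc : Continuous fun x : Fin 1 → ℝ => gq (x 0) := by
      unfold gq
      exact continuous_const.div (continuous_const.add ((continuous_apply 0).pow 2))
        fun x => one_add_sq_ne _
    have hK : IsCompact (Set.Icc (0 : Fin 1 → ℝ) 1) := isCompact_Icc
    refine (hc.continuousOn.integrableOn_compact hK).mono_set fun x hx => ?_
    rw [mem_cube1] at hx
    exact ⟨fun i => by fin_cases i; simpa using hx.1.le, fun i => by fin_cases i; simpa using hx.2.le⟩

/-- `Q² = [(0,1)², g ⊗ g]` (Fubini product; value `(π/2)²`). -/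
def G2 : KZ.IntegralRep 2 := Qrep.prod Qrep

/-- `Q⁴ = [(0,1)⁴, g⊗4]` (value `(π/2)⁴`). -/
def G4 : KZ.IntegralRep 4 := G2.prod G2

theorem of_G2_mul_of_G2 : KZ.of G2 * KZ.of G2 = KZ.of G4 := KZ.of_mul_of _ _

/-- `[Δ, n·ω_ε] ≡ n · [Δ, ω_ε]`. -/
theorem of_wordRep_nat {w : ℕ} (ε : Fin w → Bool) (hε : Adm ε) (n : ℕ) :
    KZ.of (wordRep ε n hε) - n • KZ.of (wordRep ε 1 hε) ∈ KZ.relations := by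
  have h1 : KZ.of (wordRep ε n hε) - KZ.of ((wordRep ε 1 hε).constMul (n : ℝ) (isAlgebraic_natCast n)) ∈
      KZ.relations :=
    of_sub_of_mem_relations_of_eqOn rfl fun t _ => by
      rw [wordRep_integrand, KZ.IntegralRep.integrand_constMul, wordRep_integrand, wordFun_eq_mul_wordFun_one]
      simp
  have h2 := of_constMul_nat_sub_nsmul_mem n (wordRep ε 1 hε)
  have : KZ.of (wordRep ε n hε) - n • KZ.of (wordRep ε 1 hε) =
      (KZ.of (wordRep ε n hε) - KZ.of ((wordRep ε 1 hε).constMul (n : ℝ) (isAlgebraic_natCast n))) +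
      (KZ.of ((wordRep ε 1 hε).constMul (n : ℝ) (isAlgebraic_natCast n)) - n • KZ.of (wordRep ε 1 hε)) := by abel
  rw [this]
  exact add_mem h1 h2

/-- **CHECKED REDUCTION of the weight-4 rung to the two Beukers–Kolk–Calabi identities**
`3·[Δ₂, ω₀₁] ≡ 2·Q²` (`Negative/ZetaTwo.lean: three_zeta_two_sub_two_G2_mem`, PROVED) and
`45·[□⁴, 1/(1−abcd)] ≡ 8·Q⁴` (`Negative/EulerFour.lean: fortyfive_C4_sub_eight_G4_mem`, PROVED):
squaring the first in the formal ring, the stuffle (§8), the cubical chart and integer division give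
`9 • cEuler4 ∈ relations`, hence `cEuler4 ∈ relations`.  (The full chain, ~2300 lines, exceeds this
work file's size limit; it is attached as evidence `EulerCheck.lean` and landed under `Negative/`.) -/
theorem cEuler4_mem_relations_of
    (h3 : 3 • KZ.of (wordRep ω2 1 adm_ω2) - 2 • KZ.of G2 ∈ KZ.relations)
    (h45 : 45 • KZ.of C4 - 8 • KZ.of G4 ∈ KZ.relations) : cEuler4 ∈ KZ.relations := by
  have hW4 : KZ.of (wordRep ω4 3 adm_ω4) - 3 • KZ.of (wordRep ω4 1 adm_ω4) ∈ KZ.relations := by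
    simpa using of_wordRep_nat ω4 adm_ω4 3
  have hW22 : KZ.of (wordRep ω22 4 adm_ω22) - 4 • KZ.of (wordRep ω22 1 adm_ω22) ∈ KZ.relations := by
    simpa using of_wordRep_nat ω22 adm_ω22 4
  have hW22' : KZ.of (wordRep ω22 2 adm_ω22) - 2 • KZ.of (wordRep ω22 1 adm_ω22) ∈ KZ.relations := by
    simpa using of_wordRep_nat ω22 adm_ω22 2
  have hS := cStuffle4_mem_relations
  have hP : KZ.of P22 = KZ.of (wordRep ω2 1 adm_ω2) * KZ.of (wordRep ω2 1 adm_ω2) := (KZ.of_mul_of _ _).symm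
  have hC4 := KZ.changeOfVariablesRel_subset_relations C4_sub_mem_changeOfVariablesRel
  have h9 : 9 • (KZ.of (wordRep ω2 1 adm_ω2) * KZ.of (wordRep ω2 1 adm_ω2)) - 4 • KZ.of G4 ∈ KZ.relations := by
    have hm := KZ.mul_sub_mul_mem_relations h3 h3
    rw [smul_mul_smul_comm, smul_mul_smul_comm, of_G2_mul_of_G2] at hm
    exact hm
  set E := cEuler4 with hEdef
  set W4 := KZ.of (wordRep ω4 1 adm_ω4)
  set W22 := KZ.of (wordRep ω22 1 adm_ω22)
  set W2 := KZ.of (wordRep ω2 1 adm_ω2)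
  set G := KZ.of G4
  set C := KZ.of C4
  have hE : E - (3 • W4 - 4 • W22) ∈ KZ.relations := by
    have : E - (3 • W4 - 4 • W22) = (KZ.of (wordRep ω4 3 adm_ω4) - 3 • W4) - (KZ.of (wordRep ω22 4 adm_ω22) - 4 • W22) := by
      simp only [hEdef, cEuler4]; abel
    rw [this]; exact sub_mem hW4 hW22
  have hS' : W2 * W2 - 2 • W22 - W4 ∈ KZ.relations := by
    have : W2 * W2 - 2 • W22 - W4 = cStuffle4 - (-(KZ.of (wordRep ω22 2 adm_ω22) - 2 • W22)) := by
      simp only [cStuffle4, hP]; abel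
    rw [this]; exact sub_mem hS (neg_mem hW22')
  have h45' : 45 • W4 - 8 • G ∈ KZ.relations := by
    have : 45 • W4 - 8 • G = (45 • C - 8 • G) - 45 • (C - W4) := by abel
    rw [this]; exact sub_mem h45 (KZ.relations.nsmul_mem hC4 45)
  have h9E : 9 • E ∈ KZ.relations := by
    have : 9 • E = 9 • (E - (3 • W4 - 4 • W22)) + (45 • W4 - 8 • G) - 2 • (9 • (W2 * W2) - 4 • G)
        + 18 • (W2 * W2 - 2 • W22 - W4) := by abel
    rw [this]
    exact add_mem (sub_mem (add_mem (KZ.relations.nsmul_mem hE 9) h45') (KZ.relations.nsmul_mem h9 2))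
      (KZ.relations.nsmul_mem hS' 18)
  exact mem_relations_of_nsmul_mem (by norm_num) h9E

/-- Hence the weight-4 rung from the two Calabi identities (both proved in `Negative/`). -/
theorem weightKernel_four_of
    (h3 : 3 • KZ.of (wordRep ω2 1 adm_ω2) - 2 • KZ.of G2 ∈ KZ.relations)
    (h45 : 45 • KZ.of C4 - 8 • KZ.of G4 ∈ KZ.relations) : WeightKernel 4 :=
  weightKernel_four_iff.mpr ⟨cFds4_mem_relations, cEuler4_mem_relations_of h3 h45⟩

end EulerChain

end Summit.KontsevichZagierPeriods.KontsevichZagierPeriods.Cruxes.MzvKernelInKZ.Disproof
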